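import Literature.Probability.RandomPlanarGeometry.HexSAWLattice
import HarnessLib

/-!
# Turning numbers of simple cycles of the honeycomb lattice (discrete Umlaufsatz)

Topic `Literature/Probability/RandomPlanarGeometry`; support file for the discharge of
`Literature.Probability.RandomPlanarGeometry.SAW.DuminilCopinSmirnov2012_thm1` (`HexSAW.lean`), supplying the one topological input of
H. Duminil-Copin, S. Smirnov, *The connective constant of the honeycomb lattice equals
`√(2+√2)`*, Ann. of Math. 175 (2012), arXiv:1007.0575. In the proof of Lemma 1 (p. 4) the
winding of a self-avoiding loop traversed in the two directions is evaluated as `∓4π/3` with the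
remark "we used the fact that `a` is on the boundary and `Ω` is simply connected", and in the
proof of Lemma 2 (p. 5) "the winding of any self-avoiding walk from `a` to the bottom part of `α`
is `-π` while the winding to the top part is `π` … the winding from `a` to any half-edge in `β`
(resp. `ε` and `ε̄`) is `0` (resp. `2π/3` and `-2π/3`)". Both rest on the fact that a simple
closed polygon turns by `±2π` in total, the sign being determined by which side its interior
lies on — the Umlaufsatz together with a Jordan-curve-type inside/outside statement. This file
proves a self-contained combinatorial version for the honeycomb lattice `ℍ` (coordinate model
`HV` of `HexSAWLattice.lean`).

## Main definitions (namespace `Literature.Probability.RandomPlanarGeometry.SAW.HV`)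

* `tr` (translations), `pos` (position in the oblique frame of the triangular lattice, scaled by
  `3`), `turn u v w ∈ {±1}` (left/right turn of the two-step path `u → v → w`), `pturn`, `cturn`
  (turn sums of paths and of cyclic vertex lists; units of `π/3`).
* Faces of `ℍ` are the points of `ℤ²` (hexagon centres); `leftFace u v`, `rightFace u v` (the
  faces on the two sides of a dart), `hexV h k`, `hexExt h k`, `hexN h k` (the six vertices of the
  hexagon `h`, their exterior neighbours, the six neighbouring faces), `hexDarts h`.
* `cdarts l` (darts of a cyclic list), `IsCyc l` (simple cycle: `≥ 3` distinct vertices,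
  cyclically adjacent), `dartWnd`, `wnd l F` (**winding number** of `l` around the face `F`,
  counted as signed crossings of the ray from `F` in direction `-e₁`), `dcount`, `flux`.
* `Good l`: `cturn l = 6` and the face to the right of every dart has winding number `0`.

## Main results

* `wnd_left_sub_right` (locality): across a dart `u → v` the winding number drops from the left
  face to the right face by the flux of the cycle through the dart (Kirchhoff's law
  `kirchhoff_false/true` plus a descent to faces below the cycle);
  `wnd_eq_zero_of_le/_of_fst_ne/_of_snd_gt` (vanishing away from the cycle).
* `dwnd_hexDarts`: the boundary of a hexagon winds once around it and around nothing else.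
* **`good_or_good_reverse`**: every simple cycle of `ℍ` is positively oriented or its reverse
  is; in particular `cturn_eq_six_or`: its turning number is `±6` (`±2π`). Proof: induction on
  (length, total twist `Σ_F |wnd F|`); the lexicographically top face `h` of the support of `wnd`
  has winding number `±1`, its hexagon's upper three edges lie on the cycle, and the cycle is
  modified along that hexagon: replacing a boundary arc by the complementary arc (`ArcData`),
  splitting a pinch into two lobes (`PinchData`), or excluding the impossible crossing
  configuration (`RevData`).
* **`cturn_eq_neg_six_mul_turn`** (the loop lemma used for DCS's pair cancellation): a simple
  cycle `v → t₁ → ⋯ → v` seen from a neighbour `s ∉` cycle of `v` whose adjacent faces are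
  outside has turning number `-6 · turn s v t₁`.
* `wnd_faces_at_eq`, `wnd_rightFace_pdarts_eq`: the winding number is constant on the faces
  around a vertex off the cycle, hence along any path avoiding the cycle (used to certify
  "outside").

All statements are about finite lists of lattice points and integers; local geometric facts
are decided at the origin (`decide`) and transported by translation.
-/

noncomputable section

open Finset Literature.Probability.LatticeModels Literature.Probability.Percolation

namespace Literature.Probability.RandomPlanarGeometry.SAW

namespace HV

/-! ### Positions, turns, faces -/

/-- Translation of a vertex by a vector of the face lattice `ℤ²`. [folklore] -/
def tr (t : ℤ × ℤ) (v : HV) : HV := (v.1 + t.1, v.2.1 + t.2, v.2.2)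

/-- `tr t` is the automorphism `shift t.1 t.2`. [folklore] -/
theorem tr_eq_shift (t : ℤ × ℤ) (v : HV) : tr t v = shift t.1 t.2 v := rfl

/-- `tr 0 = id`. [folklore] -/
@[simp] theorem tr_zero (v : HV) : tr (0, 0) v = v := by
  obtain ⟨a, b, c⟩ := v; simp [tr]

/-- Translations preserve adjacency. [folklore] -/
theorem adj_tr_iff (t : ℤ × ℤ) (u v : HV) : hvGraph.Adj (tr t u) (tr t v) ↔ hvGraph.Adj u v :=
  (shift t.1 t.2).map_rel_iff

/-- `tr` is injective. [folklore] -/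
theorem tr_injective (t : ℤ × ℤ) : Function.Injective (tr t) := (shift t.1 t.2).injective

/-- Position of a vertex: three times its barycentric position in the oblique frame `(e₀, e₁)`
of the triangular lattice (an orientation-preserving affine image of the honeycomb embedding).
[folklore] -/
def pos (v : HV) : ℤ × ℤ :=
  if v.2.2 then (3 * v.1 + 2, 3 * v.2.1 + 2) else (3 * v.1 + 1, 3 * v.2.1 + 1)

/-- The planar cross product. [folklore] -/
def cross (a b : ℤ × ℤ) : ℤ := a.1 * b.2 - a.2 * b.1

/-- The turn of the two-step path `u → v → w`: `+1` for a left turn (by `π/3` at a vertex of `ℍ`),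
`-1` for a right turn (sign of the cross product of the two steps; the oblique frame is positively
oriented, so this is the turn of the embedded polyline). [cite: DuminilCopinSmirnov2012, §2
("the winding … as the total rotation of the direction in radians")] -/
def turn (u v w : HV) : ℤ :=
  Int.sign (cross (pos v - pos u) (pos w - pos v))

/-- Positions translate. [folklore] -/
theorem pos_tr (t : ℤ × ℤ) (v : HV) : pos (tr t v) = pos v + (3 * t.1, 3 * t.2) := by
  obtain ⟨a, b, c⟩ := v
  cases c <;> simp [pos, tr] <;> constructor <;> ring

/-- Turns are translation invariant. [folklore] -/
@[simp] theorem turn_tr (t : ℤ × ℤ) (u v w : HV) : turn (tr t u) (tr t v) (tr t w) = turn u v w := by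
  simp only [turn, pos_tr, add_sub_add_right_eq_sub]

/-- Turns are antisymmetric under reversal. [folklore] -/
theorem turn_rev (u v w : HV) : turn w v u = -turn u v w := by
  simp only [turn, cross, ← Int.sign_neg]
  congr 1
  simp only [Prod.fst_sub, Prod.snd_sub]
  ring

/-- The face of `ℍ` (a point of the triangular lattice `ℤ²`, the centre of a hexagon) to the left
of the dart `u → v` (junk `(0,0)` if `u`, `v` are not adjacent). [folklore] -/
def leftFace (u v : HV) : ℤ × ℤ :=
  match u, v with
  | (x0, x1, false), (y0, y1, true) =>
      if y0 = x0 ∧ y1 = x1 then (x0, x1 + 1)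
      else if y0 = x0 - 1 ∧ y1 = x1 then (x0, x1)
      else (x0 + 1, x1)
  | (x0, x1, true), (y0, y1, false) =>
      if y0 = x0 ∧ y1 = x1 then (x0 + 1, x1)
      else if y0 = x0 + 1 ∧ y1 = x1 then (x0 + 1, x1 + 1)
      else (x0, x1 + 1)
  | _, _ => (0, 0)

/-- The face to the right of the dart `u → v`. [folklore] -/
def rightFace (u v : HV) : ℤ × ℤ := leftFace v u

/-- Left faces translate. [folklore] -/
theorem leftFace_tr (t : ℤ × ℤ) {u v : HV} (h : hvGraph.Adj u v) :
    leftFace (tr t u) (tr t v) = leftFace u v + t := by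
  obtain ⟨t1, t2⟩ := t
  obtain ⟨a, b, c⟩ := u
  obtain ⟨a', b', c'⟩ := v
  cases c <;> cases c' <;> simp [hvGraph_adj, AdjRel] at h
  · rcases h with ⟨rfl, rfl⟩ | ⟨rfl, rfl⟩ | ⟨rfl, rfl⟩ <;> simp only [leftFace, tr] <;> split_ifs <;>
      simp only [Prod.mk_add_mk, Prod.mk.injEq, and_true, true_and, not_true_eq_false] at * <;> omega
  · rcases h with ⟨rfl, rfl⟩ | ⟨rfl, rfl⟩ | ⟨rfl, rfl⟩ <;> simp only [leftFace, tr] <;> split_ifs <;>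
      simp only [Prod.mk_add_mk, Prod.mk.injEq, and_true, true_and, not_true_eq_false] at * <;> omega

/-- Right faces translate. [folklore] -/
theorem rightFace_tr (t : ℤ × ℤ) {u v : HV} (h : hvGraph.Adj u v) :
    rightFace (tr t u) (tr t v) = rightFace u v + t :=
  leftFace_tr t h.symm

/-! ### Darts of a cyclic vertex list; winding numbers of faces -/

/-- The darts `(cᵢ, cᵢ₊₁)` (indices mod `n`) of a vertex list read cyclically. [folklore] -/
def cdarts (l : List HV) : List (HV × HV) := l.zip (l.rotate 1)

/-- Contribution of a dart to the winding number of the face `F`, computed with the ray from `F`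
in direction `-e₁`: the ray crosses the edges `{(G - e₀, 1), (G, 0)}`, `G = F - k e₁`, `k ≥ 1`,
and such an edge traversed from `(G - e₀, 1)` to `(G, 0)` has `G + e₁` on its left. [folklore] -/
def dartWnd (d : HV × HV) (F : ℤ × ℤ) : ℤ :=
  match d with
  | ((ux, uy, true), (vx, vy, false)) =>
      if vx = ux + 1 ∧ vy = uy ∧ F.1 = vx ∧ vy + 1 ≤ F.2 then 1 else 0
  | ((ux, uy, false), (vx, vy, true)) =>
      if vx = ux - 1 ∧ vy = uy ∧ F.1 = ux ∧ uy + 1 ≤ F.2 then -1 else 0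
  | _ => 0

/-- **The winding number** of the closed dart sequence of `l` around the face `F`. [folklore] -/
def wnd (l : List HV) (F : ℤ × ℤ) : ℤ := ((cdarts l).map fun d => dartWnd d F).sum

/-- Multiplicity of the dart `(u, v)` in the cyclic list `l`. [folklore] -/
def dcount (l : List HV) (u v : HV) : ℤ := (cdarts l).count (u, v)

/-- Net flux of `l` through the dart `(u, v)`. [folklore] -/
def flux (l : List HV) (u v : HV) : ℤ := dcount l u v - dcount l v u

/-- **Simple cycle of `ℍ`** as a cyclic vertex list: at least three distinct vertices,
cyclically consecutive ones adjacent. [folklore] -/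
def IsCyc (l : List HV) : Prop := 3 ≤ l.length ∧ l.Nodup ∧ ∀ d ∈ cdarts l, hvGraph.Adj d.1 d.2

/-! ### Turning numbers -/

/-- The sum of the turns at the interior vertices of a path. [cite: DuminilCopinSmirnov2012, §2] -/
def pturn : List HV → ℤ
  | u :: v :: w :: L => turn u v w + pturn (v :: w :: L)
  | _ => 0

/-- **The turning number** (in units of `π/3`) of a cyclic vertex list: the sum of the turns at
all its vertices. [cite: DuminilCopinSmirnov2012, §2] -/
def cturn (l : List HV) : ℤ := pturn (l ++ l.take 2)

/-! ### The hexagon around a face -/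

/-- The six vertices of the hexagon `h`, counterclockwise, starting at angle `-π/6`:
`(h-e₁,1), (h,0), (h-e₀,1), (h-e₀,0), (h-e₀-e₁,1), (h-e₁,0)`. [folklore] -/
def hexV (h : ℤ × ℤ) : Fin 6 → HV
  | 0 => (h.1, h.2 - 1, true)
  | 1 => (h.1, h.2, false)
  | 2 => (h.1 - 1, h.2, true)
  | 3 => (h.1 - 1, h.2, false)
  | 4 => (h.1 - 1, h.2 - 1, true)
  | 5 => (h.1, h.2 - 1, false)

/-- The neighbour of the `k`-th vertex of the hexagon `h` outside the hexagon. [folklore] -/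
def hexExt (h : ℤ × ℤ) : Fin 6 → HV
  | 0 => (h.1 + 1, h.2 - 1, false)
  | 1 => (h.1, h.2, true)
  | 2 => (h.1 - 1, h.2 + 1, false)
  | 3 => (h.1 - 2, h.2, true)
  | 4 => (h.1 - 1, h.2 - 1, false)
  | 5 => (h.1, h.2 - 2, true)

/-- Hexagon vertices translate. [folklore] -/
theorem hexV_eq_tr (h : ℤ × ℤ) (k : Fin 6) : hexV h k = tr h (hexV (0, 0) k) := by
  obtain ⟨h1, h2⟩ := h
  fin_cases k <;> simp [hexV, tr] <;> omega

/-- Exterior neighbours translate. [folklore] -/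
theorem hexExt_eq_tr (h : ℤ × ℤ) (k : Fin 6) : hexExt h k = tr h (hexExt (0, 0) k) := by
  obtain ⟨h1, h2⟩ := h
  fin_cases k <;> simp [hexExt, tr] <;> omega

/-! ### Cyclic vertex lists: darts, rotations, reversal -/

section Cyclic

variable {l : List HV}

/-- The darts along a path (consecutive pairs). [folklore] -/
def pdarts : List HV → List (HV × HV)
  | a :: b :: L => (a, b) :: pdarts (b :: L)
  | _ => []

/-- `pdarts` of a two-element prefix. [folklore] -/
@[simp] theorem pdarts_cons_cons (a b : HV) (L : List HV) :
    pdarts (a :: b :: L) = (a, b) :: pdarts (b :: L) := rfl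

/-- `pdarts` of short lists. [folklore] -/
@[simp] theorem pdarts_singleton (a : HV) : pdarts [a] = [] := rfl

/-- `pdarts` of the empty list. [folklore] -/
@[simp] theorem pdarts_nil : pdarts [] = [] := rfl

/-- Appending one vertex adds one dart. [folklore] -/
theorem pdarts_append_singleton (P : List HV) (hP : P ≠ []) (x : HV) :
    pdarts (P ++ [x]) = pdarts P ++ [(P.getLast hP, x)] := by
  induction P with
  | nil => exact absurd rfl hP
  | cons a L ih =>
    cases L with
    | nil => simp [pdarts]
    | cons b L' =>
      simp only [List.cons_append, pdarts_cons_cons, ne_eq, reduceCtorEq, not_false_eq_true,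
        List.getLast_cons]
      rw [← List.cons_append, ih (List.cons_ne_nil _ _)]

/-- `pdarts` splits at an overlap of two. [folklore] -/
theorem pdarts_append_cons_cons (P Q : List HV) (x y : HV) :
    pdarts (P ++ x :: y :: Q) = pdarts (P ++ [x]) ++ pdarts (x :: y :: Q) := by
  induction P with
  | nil => simp
  | cons a L ih =>
    cases L with
    | nil => simp
    | cons b L' => simp only [List.cons_append, pdarts_cons_cons] at ih ⊢; rw [ih]

/-- The number of path darts. [folklore] -/
theorem length_pdarts : ∀ (P : List HV), (pdarts P).length = P.length - 1
  | [] => rfl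
  | [_] => rfl
  | a :: b :: L => by simp [length_pdarts (b :: L)]

/-- Members of `pdarts` are consecutive entries. [folklore] -/
theorem mem_pdarts_iff : ∀ {P : List HV} {d : HV × HV},
    d ∈ pdarts P ↔ ∃ (i : ℕ) (h : i + 1 < P.length), d = (P[i], P[i + 1])
  | [], d => by simp
  | [a], d => by simp
  | a :: b :: L, d => by
    rw [pdarts_cons_cons, List.mem_cons, mem_pdarts_iff]
    constructor
    · rintro (rfl | ⟨i, hi, rfl⟩)
      · exact ⟨0, by simp, rfl⟩
      · exact ⟨i + 1, by simpa using hi, rfl⟩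
    · rintro ⟨i, hi, rfl⟩
      cases i with
      | zero => exact Or.inl rfl
      | succ i => exact Or.inr ⟨i, by simpa using hi, rfl⟩

/-- Both ends of a path dart lie on the path. [folklore] -/
theorem mem_of_mem_pdarts {P : List HV} {d : HV × HV} (h : d ∈ pdarts P) : d.1 ∈ P ∧ d.2 ∈ P := by
  obtain ⟨i, hi, rfl⟩ := mem_pdarts_iff.1 h
  exact ⟨List.getElem_mem _, List.getElem_mem _⟩

/-- The cyclic darts of a nonempty list are its path darts plus the closing dart.
[folklore] -/
theorem cdarts_cons (a : HV) (L : List HV) :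
    cdarts (a :: L) = pdarts (a :: L) ++ [((a :: L).getLast (List.cons_ne_nil _ _), a)] := by
  rw [cdarts, show (a :: L).rotate 1 = L ++ [a] by simp]
  suffices h : ∀ (a a' : HV) (L : List HV),
      (a :: L).zip (L ++ [a']) = pdarts (a :: L) ++ [((a :: L).getLast (List.cons_ne_nil _ _), a')] from
    h a a L
  intro a a' L
  induction L generalizing a with
  | nil => simp
  | cons b L ih =>
    rw [List.cons_append, List.zip_cons_cons, ih b, pdarts_cons_cons, List.getLast_cons (List.cons_ne_nil _ _)]
    rfl

/-- `cdarts [] = []`. [folklore] -/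
@[simp] theorem cdarts_nil : cdarts [] = [] := rfl

/-- The number of cyclic darts. [folklore] -/
@[simp] theorem length_cdarts (l : List HV) : (cdarts l).length = l.length := by
  simp [cdarts]

/-- Members of `cdarts` are cyclically consecutive entries. [folklore] -/
theorem mem_cdarts_iff {d : HV × HV} : d ∈ cdarts l ↔
    ∃ (i : ℕ) (h : i < l.length), d = (l[i], l[(i + 1) % l.length]'(Nat.mod_lt _ (by omega))) := by
  rw [cdarts, List.mem_iff_getElem]
  simp only [List.length_zip, List.length_rotate, min_self, List.getElem_zip, List.getElem_rotate]
  constructor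
  · rintro ⟨i, hi, rfl⟩; exact ⟨i, hi, rfl⟩
  · rintro ⟨i, hi, rfl⟩; exact ⟨i, hi, rfl⟩

/-- Both ends of a cyclic dart lie on the list. [folklore] -/
theorem mem_of_mem_cdarts {d : HV × HV} (h : d ∈ cdarts l) : d.1 ∈ l ∧ d.2 ∈ l := by
  obtain ⟨i, hi, rfl⟩ := mem_cdarts_iff.1 h
  exact ⟨List.getElem_mem _, List.getElem_mem _⟩

/-- `cdarts` of a nonempty list via its head and last element. [folklore] -/
theorem cdarts_eq (hl : l ≠ []) : cdarts l = pdarts l ++ [(l.getLast hl, l.head hl)] := by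
  match l, hl with
  | a :: L, _ => exact cdarts_cons a L

/-- Rotations rotate the darts. [folklore] -/
theorem cdarts_rotate (l : List HV) (k : ℕ) : cdarts (l.rotate k) = (cdarts l).rotate k := by
  apply List.ext_getElem
  · simp
  intro i h1 h2
  simp only [cdarts, List.getElem_zip, List.getElem_rotate, List.length_rotate, Prod.mk.injEq,
    List.length_zip, min_self, true_and]
  congr 1
  rw [Nat.mod_add_mod, Nat.mod_add_mod]
  congr 1
  omega

/-- Rotations permute the darts. [folklore] -/
theorem cdarts_rotate_perm (l : List HV) (k : ℕ) : (cdarts (l.rotate k)).Perm (cdarts l) := by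
  rw [cdarts_rotate]; exact List.rotate_perm _ _

/-- Reversing a path reverses and swaps its darts. [folklore] -/
theorem pdarts_reverse : ∀ (P : List HV), pdarts P.reverse = ((pdarts P).map Prod.swap).reverse
  | [] => rfl
  | [a] => rfl
  | a :: b :: L => by
    rw [List.reverse_cons, pdarts_append_singleton _ (by simp), pdarts_reverse (b :: L)]
    simp

/-- Reversal swaps the cyclic darts (up to order). [folklore] -/
theorem cdarts_reverse_perm (l : List HV) : (cdarts l.reverse).Perm ((cdarts l).map Prod.swap) := by
  rcases eq_or_ne l [] with rfl | hl
  · exact List.Perm.refl _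
  have hr : l.reverse ≠ [] := by simpa using hl
  rw [cdarts_eq hr, cdarts_eq hl, pdarts_reverse, List.map_append, List.map_singleton,
    Prod.swap_prod_mk, List.getLast_reverse, List.head_reverse]
  exact (List.reverse_perm _).append_right _

/-- A vertex of a duplicate-free cyclic list has a unique successor. [folklore] -/
theorem cdarts_succ_unique (hn : l.Nodup) {u v v' : HV} (h : (u, v) ∈ cdarts l)
    (h' : (u, v') ∈ cdarts l) : v = v' := by
  obtain ⟨i, hi, he⟩ := mem_cdarts_iff.1 h
  obtain ⟨j, hj, he'⟩ := mem_cdarts_iff.1 h'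
  simp only [Prod.mk.injEq] at he he'
  obtain rfl : i = j := (List.Nodup.getElem_inj_iff hn).1 (he.1.symm.trans he'.1)
  rw [he.2, he'.2]

/-- A vertex of a duplicate-free cyclic list has a unique predecessor. [folklore] -/
theorem cdarts_pred_unique (hn : l.Nodup) {u u' v : HV} (h : (u, v) ∈ cdarts l)
    (h' : (u', v) ∈ cdarts l) : u = u' := by
  obtain ⟨i, hi, he⟩ := mem_cdarts_iff.1 h
  obtain ⟨j, hj, he'⟩ := mem_cdarts_iff.1 h'
  simp only [Prod.mk.injEq] at he he'
  have hij : (i + 1) % l.length = (j + 1) % l.length :=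
    (List.Nodup.getElem_inj_iff hn).1 (he.2.symm.trans he'.2)
  have : i = j := by
    rcases Nat.lt_or_ge (i + 1) l.length with hi1 | hi1 <;>
    rcases Nat.lt_or_ge (j + 1) l.length with hj1 | hj1
    · rw [Nat.mod_eq_of_lt hi1, Nat.mod_eq_of_lt hj1] at hij; omega
    · rw [Nat.mod_eq_of_lt hi1, show j + 1 = l.length by omega, Nat.mod_self] at hij; omega
    · rw [Nat.mod_eq_of_lt hj1, show i + 1 = l.length by omega, Nat.mod_self] at hij; omega
    · omega
  subst this
  rw [he.1, he'.1]

/-- Every vertex of a cyclic list is the source of a dart. [folklore] -/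
theorem exists_cdarts_fst {u : HV} (hu : u ∈ l) : ∃ v, (u, v) ∈ cdarts l := by
  obtain ⟨i, hi, rfl⟩ := List.getElem_of_mem hu
  exact ⟨_, mem_cdarts_iff.2 ⟨i, hi, rfl⟩⟩

/-- Every vertex of a cyclic list is the target of a dart. [folklore] -/
theorem exists_cdarts_snd {v : HV} (hv : v ∈ l) : ∃ u, (u, v) ∈ cdarts l := by
  have hv' : v ∈ l.reverse := List.mem_reverse.2 hv
  obtain ⟨u, hu⟩ := exists_cdarts_fst hv'
  have := (cdarts_reverse_perm l).mem_iff.1 hu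
  rw [List.mem_map] at this
  obtain ⟨⟨a, b⟩, hab, he⟩ := this
  simp only [Prod.swap_prod_mk, Prod.mk.injEq] at he
  obtain ⟨rfl, rfl⟩ := he
  exact ⟨a, hab⟩

/-- Rotating a cyclic list to start with a given dart. [folklore] -/
theorem exists_rotate_eq_cons_cons (h3 : 3 ≤ l.length) {u v : HV} (h : (u, v) ∈ cdarts l) :
    ∃ (k : ℕ) (M : List HV), l.rotate k = u :: v :: M := by
  obtain ⟨i, hi, he⟩ := mem_cdarts_iff.1 h
  simp only [Prod.mk.injEq] at he
  refine ⟨i, (l.rotate i).drop 2, ?_⟩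
  have hlen : (l.rotate i).length = l.length := List.length_rotate _ _
  have e0 : (l.rotate i)[0]'(by omega) = u := by
    rw [List.getElem_rotate, he.1]; congr 1; simp [Nat.mod_eq_of_lt hi]
  have e1 : (l.rotate i)[1]'(by omega) = v := by
    rw [List.getElem_rotate, he.2]; congr 1; rw [Nat.add_comm]
  calc l.rotate i = (l.rotate i).drop 0 := rfl
    _ = (l.rotate i)[0]'(by omega) :: (l.rotate i).drop 1 := List.drop_eq_getElem_cons _
    _ = u :: ((l.rotate i)[1]'(by omega) :: (l.rotate i).drop 2) := by
        rw [e0, List.drop_eq_getElem_cons]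
    _ = u :: v :: (l.rotate i).drop 2 := by rw [e1]

/-- The darts of `u :: v :: M` begin with `(u, v)`; the successor of `v` is the head of `M`
(or `u`). [folklore] -/
theorem cdarts_cons_cons (u v : HV) (M : List HV) :
    cdarts (u :: v :: M) = (u, v) :: pdarts (v :: M) ++
      [((v :: M).getLast (List.cons_ne_nil _ _), u)] := by
  rw [cdarts_cons]; rfl

end Cyclic

/-! ### Turn sums of paths and cycles -/

section Turns

/-- Three-term recursion of `pturn`. [folklore] -/
@[simp] theorem pturn_cons₃ (u v w : HV) (L : List HV) :
    pturn (u :: v :: w :: L) = turn u v w + pturn (v :: w :: L) := rfl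

/-- Short paths have no turns. [folklore] -/
@[simp] theorem pturn_two (u v : HV) : pturn [u, v] = 0 := rfl

/-- Short paths have no turns. [folklore] -/
@[simp] theorem pturn_one (u : HV) : pturn [u] = 0 := rfl

/-- Short paths have no turns. [folklore] -/
@[simp] theorem pturn_nil : pturn [] = 0 := rfl

/-- Peeling the first turn. [folklore] -/
theorem pturn_cons (a : HV) (P : List HV) (hP : 2 ≤ P.length) :
    pturn (a :: P) = turn a (P[0]'(by omega)) (P[1]'(by omega)) + pturn P := by
  match P, hP with
  | b :: c :: L, _ => rfl

/-- Splitting a turn sum at an overlap of two vertices. [folklore] -/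
theorem pturn_append_cons_cons (P Q : List HV) (x y : HV) :
    pturn (P ++ x :: y :: Q) = pturn (P ++ [x, y]) + pturn (x :: y :: Q) := by
  induction P with
  | nil => simp
  | cons a L ih =>
    match L, ih with
    | [], _ => simp
    | [b], _ => simp [add_assoc]
    | b :: c :: L', ih =>
      simp only [List.cons_append, pturn_cons₃] at ih ⊢
      rw [ih]; ring

/-- Turn sums are translation invariant. [folklore] -/
theorem pturn_map_tr (t : ℤ × ℤ) : ∀ (P : List HV), pturn (P.map (tr t)) = pturn P
  | [] => rfl
  | [_] => rfl
  | [_, _] => rfl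
  | a :: b :: c :: L => by
    rw [List.map_cons, List.map_cons, List.map_cons, pturn_cons₃, turn_tr, ← List.map_cons,
      ← List.map_cons, pturn_map_tr t (b :: c :: L), pturn_cons₃]

/-- Turn sums are odd under reversal. [folklore] -/
theorem pturn_reverse : ∀ (P : List HV), pturn P.reverse = -pturn P
  | [] => rfl
  | [_] => rfl
  | [_, _] => rfl
  | a :: b :: c :: L => by
    have ih := pturn_reverse (b :: c :: L)
    have e1 : (a :: b :: c :: L).reverse = L.reverse ++ c :: b :: [a] := by simp
    have e2 : (b :: c :: L).reverse = L.reverse ++ [c, b] := by simp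
    rw [e1, pturn_append_cons_cons, ← e2, ih, pturn_cons₃, pturn_cons₃, pturn_two, turn_rev]
    ring

/-- **Splitting the turning number of a cycle** written as `A ++ M` (the cycle closes from the
last vertex of `M` to the first of `A`): the turns at the vertices of `A` (with their outer
neighbours) plus the turns at the vertices of `M`. [folklore] -/
theorem cturn_split (A M : List HV) (hA : 2 ≤ A.length) (hM : M ≠ []) :
    cturn (A ++ M) = pturn (M.getLast hM :: A ++ [M.head hM]) +
      pturn (A.getLast (List.ne_nil_of_length_pos (by omega)) :: M ++ [A.head
        (List.ne_nil_of_length_pos (by omega))]) := by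
  obtain ⟨a0, a1, A', rfl⟩ : ∃ a0 a1 A', A = a0 :: a1 :: A' := by
    match A, hA with
    | a0 :: a1 :: A', _ => exact ⟨a0, a1, A', rfl⟩
  obtain ⟨m0, M', rfl⟩ : ∃ m0 M', M = m0 :: M' := List.exists_cons_of_ne_nil hM
  have hA0 : a0 :: a1 :: A' ≠ [] := List.cons_ne_nil _ _
  simp only [List.head_cons]
  -- expand the closing segment
  have h0 : cturn (a0 :: a1 :: A' ++ m0 :: M') = pturn (a0 :: a1 :: A' ++ m0 :: M' ++ [a0, a1]) := by
    rw [cturn, List.take_append_of_le_length (by simp)]; rfl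
  have e1 : a0 :: a1 :: A' ++ m0 :: M' ++ [a0, a1] =
      (a0 :: a1 :: A').dropLast ++ (a0 :: a1 :: A').getLast hA0 :: m0 :: (M' ++ [a0, a1]) := by
    conv_lhs => rw [← List.dropLast_append_getLast hA0]
    simp
  have e2 : (a0 :: a1 :: A').dropLast ++ [(a0 :: a1 :: A').getLast hA0, m0] =
      a0 :: a1 :: A' ++ [m0] := by
    conv_rhs => rw [← List.dropLast_append_getLast hA0]
    simp
  have e3 : (a0 :: a1 :: A').getLast hA0 :: m0 :: (M' ++ [a0, a1]) =
      ((a0 :: a1 :: A').getLast hA0 :: (m0 :: M').dropLast) ++ (m0 :: M').getLast hM :: a0 :: [a1] := by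
    rw [show (m0 :: M').getLast hM :: a0 :: [a1] = [(m0 :: M').getLast hM] ++ [a0, a1] from rfl,
      List.cons_append, ← List.append_assoc _ [(m0 :: M').getLast hM] _, List.dropLast_append_getLast hM]
    simp
  have e4 : (a0 :: a1 :: A').getLast hA0 :: (m0 :: M').dropLast ++ [(m0 :: M').getLast hM, a0] =
      (a0 :: a1 :: A').getLast hA0 :: (m0 :: M') ++ [a0] := by
    conv_rhs => rw [← List.dropLast_append_getLast hM]
    simp
  rw [h0, e1, pturn_append_cons_cons, e2, e3, pturn_append_cons_cons, e4]
  simp only [List.cons_append, pturn_cons₃, pturn_two, add_zero]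
  ring

end Turns

/-! ### Winding numbers of dart lists -/

section Wnd

variable {l : List HV}

/-- The winding number of a list of darts around `F`. [folklore] -/
def dwnd (D : List (HV × HV)) (F : ℤ × ℤ) : ℤ := (D.map fun d => dartWnd d F).sum

/-- `wnd` is `dwnd` of the cyclic darts. [folklore] -/
theorem wnd_eq_dwnd (l : List HV) (F : ℤ × ℤ) : wnd l F = dwnd (cdarts l) F := rfl

/-- `dwnd` of the empty list. [folklore] -/
@[simp] theorem dwnd_nil (F : ℤ × ℤ) : dwnd [] F = 0 := rfl

/-- `dwnd` of a cons. [folklore] -/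
@[simp] theorem dwnd_cons (d : HV × HV) (D : List (HV × HV)) (F : ℤ × ℤ) :
    dwnd (d :: D) F = dartWnd d F + dwnd D F := by simp [dwnd]

/-- `dwnd` is additive. [folklore] -/
@[simp] theorem dwnd_append (D D' : List (HV × HV)) (F : ℤ × ℤ) :
    dwnd (D ++ D') F = dwnd D F + dwnd D' F := by simp [dwnd]

/-- `dwnd` is invariant under permutations. [folklore] -/
theorem dwnd_perm {D D' : List (HV × HV)} (h : D.Perm D') (F : ℤ × ℤ) : dwnd D F = dwnd D' F :=
  (h.map _).sum_eq

/-- Reversing a dart negates its contribution. [folklore] -/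
theorem dartWnd_swap (d : HV × HV) (F : ℤ × ℤ) : dartWnd d.swap F = -dartWnd d F := by
  obtain ⟨⟨ux, uy, ub⟩, ⟨vx, vy, vb⟩⟩ := d
  cases ub <;> cases vb <;> simp only [dartWnd, Prod.swap_prod_mk, neg_zero] <;> split_ifs <;> omega

/-- Reversing all darts negates the winding number. [folklore] -/
theorem dwnd_map_swap (D : List (HV × HV)) (F : ℤ × ℤ) : dwnd (D.map Prod.swap) F = -dwnd D F := by
  induction D with
  | nil => simp
  | cons d D ih => simp [dartWnd_swap, ih]; ring

/-- Winding numbers are invariant under rotation of the cycle. [folklore] -/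
theorem wnd_rotate (l : List HV) (k : ℕ) (F : ℤ × ℤ) : wnd (l.rotate k) F = wnd l F := by
  rw [wnd_eq_dwnd, wnd_eq_dwnd]; exact dwnd_perm (cdarts_rotate_perm l k) F

/-- Winding numbers change sign under reversal of the cycle. [folklore] -/
theorem wnd_reverse (l : List HV) (F : ℤ × ℤ) : wnd l.reverse F = -wnd l F := by
  rw [wnd_eq_dwnd, wnd_eq_dwnd, dwnd_perm (cdarts_reverse_perm l) F, dwnd_map_swap]

/-- Dart counts are invariant under rotation. [folklore] -/
theorem dcount_rotate (l : List HV) (k : ℕ) (u v : HV) : dcount (l.rotate k) u v = dcount l u v := by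
  rw [dcount, dcount, (cdarts_rotate_perm l k).count_eq]

/-- Dart counts are swapped under reversal. [folklore] -/
theorem dcount_reverse (l : List HV) (u v : HV) : dcount l.reverse u v = dcount l v u := by
  rw [dcount, dcount, (cdarts_reverse_perm l).count_eq]
  rw [show (u, v) = Prod.swap (v, u) from rfl, List.count_map_of_injective _ _ Prod.swap_injective]

/-- Flux is invariant under rotation. [folklore] -/
theorem flux_rotate (l : List HV) (k : ℕ) (u v : HV) : flux (l.rotate k) u v = flux l u v := by
  rw [flux, flux, dcount_rotate, dcount_rotate]

/-- Flux changes sign under reversal. [folklore] -/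
theorem flux_reverse (l : List HV) (u v : HV) : flux l.reverse u v = -flux l u v := by
  rw [flux, flux, dcount_reverse, dcount_reverse]; ring

/-- Flux is antisymmetric. [folklore] -/
theorem flux_antisymm (l : List HV) (u v : HV) : flux l u v = -flux l v u := by
  rw [flux, flux]; ring

/-- A dart off the list carries no count. [folklore] -/
theorem dcount_eq_zero_of_not_mem {u v : HV} (h : u ∉ l ∨ v ∉ l) : dcount l u v = 0 := by
  rw [dcount, Nat.cast_eq_zero, List.count_eq_zero]
  intro hm
  have := mem_of_mem_cdarts hm
  tauto

/-- A dart off the list carries no flux. [folklore] -/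
theorem flux_eq_zero_of_not_mem {u v : HV} (h : u ∉ l ∨ v ∉ l) : flux l u v = 0 := by
  rw [flux, dcount_eq_zero_of_not_mem h, dcount_eq_zero_of_not_mem (by tauto), sub_zero]

/-- Simple cycles are invariant under rotation. [folklore] -/
theorem IsCyc.rotate (h : IsCyc l) (k : ℕ) : IsCyc (l.rotate k) :=
  ⟨by rw [List.length_rotate]; exact h.1, List.nodup_rotate.2 h.2.1,
    fun d hd => h.2.2 d ((cdarts_rotate_perm l k).mem_iff.1 hd)⟩

/-- Simple cycles are invariant under reversal. [folklore] -/
theorem IsCyc.reverse (h : IsCyc l) : IsCyc l.reverse := by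
  refine ⟨by rw [List.length_reverse]; exact h.1, List.nodup_reverse.2 h.2.1, fun d hd => ?_⟩
  have := (cdarts_reverse_perm l).mem_iff.1 hd
  rw [List.mem_map] at this
  obtain ⟨d', hd', rfl⟩ := this
  exact (h.2.2 d' hd').symm

/-- In a simple cycle a dart occurs at most once. [folklore] -/
theorem IsCyc.dcount_le_one (h : IsCyc l) (u v : HV) : dcount l u v ≤ 1 := by
  rw [dcount, Nat.cast_le_one]
  refine List.nodup_iff_count_le_one.1 ?_ _
  rw [cdarts]
  exact List.Nodup.of_map Prod.fst (by rw [List.map_fst_zip (by simp)]; exact h.2.1)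

/-- In a simple cycle the count of a dart is `1` iff the dart occurs. [folklore] -/
theorem IsCyc.dcount_eq_one_iff (h : IsCyc l) (u v : HV) : dcount l u v = 1 ↔ (u, v) ∈ cdarts l := by
  rw [dcount, Nat.cast_eq_one]
  constructor
  · intro h1; exact List.count_pos_iff.1 (by omega)
  · intro hm
    have := List.count_pos_iff.2 hm
    have h2 := h.dcount_le_one u v
    rw [dcount, Nat.cast_le_one] at h2
    omega

/-- `dcount` is `0` or `1` on a simple cycle. [folklore] -/
theorem IsCyc.dcount_eq_zero_or_one (h : IsCyc l) (u v : HV) : dcount l u v = 0 ∨ dcount l u v = 1 := by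
  have h1 := h.dcount_le_one u v
  have h0 : 0 ≤ dcount l u v := by rw [dcount]; positivity
  omega

/-- In a simple cycle (of length `≥ 3`) a dart and its reverse do not both occur. [folklore] -/
theorem IsCyc.not_mem_swap (h : IsCyc l) {u v : HV} (huv : (u, v) ∈ cdarts l) : (v, u) ∉ cdarts l := by
  intro hvu
  obtain ⟨i, hi, he⟩ := mem_cdarts_iff.1 huv
  obtain ⟨j, hj, he'⟩ := mem_cdarts_iff.1 hvu
  simp only [Prod.mk.injEq] at he he'
  have hn := h.2.1
  have h3 := h.1
  -- `u = l[i] = l[(j+1) % n]`, `v = l[(i+1) % n] = l[j]`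
  have e1 : i = (j + 1) % l.length := (List.Nodup.getElem_inj_iff hn).1 (he.1.symm.trans he'.2)
  have e2 : (i + 1) % l.length = j := (List.Nodup.getElem_inj_iff hn).1 (he.2.symm.trans he'.1)
  rcases Nat.lt_or_ge (j + 1) l.length with hj1 | hj1
  · rw [Nat.mod_eq_of_lt hj1] at e1
    subst e1
    rcases Nat.lt_or_ge (j + 1 + 1) l.length with hj2 | hj2
    · rw [Nat.mod_eq_of_lt hj2] at e2; omega
    · rw [show j + 1 + 1 = l.length by omega, Nat.mod_self] at e2; omega
  · rw [show j + 1 = l.length by omega, Nat.mod_self] at e1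
    subst e1
    rw [Nat.mod_eq_of_lt (by omega)] at e2
    omega

/-- On a simple cycle the flux through an occurring dart is `1`. [folklore] -/
theorem IsCyc.flux_eq_one (h : IsCyc l) {u v : HV} (huv : (u, v) ∈ cdarts l) : flux l u v = 1 := by
  rw [flux, (h.dcount_eq_one_iff u v).2 huv, dcount_eq_zero_of_count (h.not_mem_swap huv)]
  · norm_num
where
  /-- helper: a dart not in the list has count zero -/
  dcount_eq_zero_of_count {a b : HV} (hn : (a, b) ∉ cdarts l) : dcount l a b = 0 := by
    rw [dcount, Nat.cast_eq_zero, List.count_eq_zero]; exact hn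

/-- A dart not occurring has count `0`. [folklore] -/
theorem dcount_eq_zero_of_not_mem_cdarts {u v : HV} (hn : (u, v) ∉ cdarts l) : dcount l u v = 0 := by
  rw [dcount, Nat.cast_eq_zero, List.count_eq_zero]; exact hn

/-- On a simple cycle: flux `1` through occurring darts, `-1` through their reverses, `0` else.
[folklore] -/
theorem IsCyc.flux_eq (h : IsCyc l) (u v : HV) :
    flux l u v = (if (u, v) ∈ cdarts l then 1 else 0) - (if (v, u) ∈ cdarts l then 1 else 0) := by
  rw [flux]
  congr 1
  · split_ifs with h1
    · exact (h.dcount_eq_one_iff u v).2 h1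
    · exact dcount_eq_zero_of_not_mem_cdarts h1
  · split_ifs with h1
    · exact (h.dcount_eq_one_iff v u).2 h1
    · exact dcount_eq_zero_of_not_mem_cdarts h1

/-! ### Kirchhoff's law: the darts of a cyclic list form a cycle -/

/-- Indicator sums over a list: `Σ_{t ∈ L} [a = t] = count`. [folklore] -/
theorem sum_map_ite_eq (L : List HV) (a : HV) :
    (L.map fun t => if a = t then (1 : ℕ) else 0).sum = L.count a := by
  induction L with
  | nil => simp
  | cons b L ih =>
    rw [List.map_cons, List.sum_cons, ih, List.count_cons]
    by_cases hab : a = b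
    · subst hab; simp [add_comm]
    · simp [hab, Ne.symm hab]

/-- For a dart `d` between adjacent vertices, exactly one neighbour `t` of `v` has `d = (t, v)`
when `d` ends at `v`, none otherwise. [folklore] -/
theorem sum_nbrs_ite_eq (v : HV) {d : HV × HV} (hd : hvGraph.Adj d.1 d.2) :
    ((nbrs v).map fun t => if d = (t, v) then (1 : ℕ) else 0).sum = if d.2 = v then 1 else 0 := by
  obtain ⟨d1, d2⟩ := d
  by_cases h2 : d2 = v
  · subst h2
    simp only [Prod.mk.injEq, and_true, if_true]
    rw [sum_map_ite_eq]
    exact List.count_eq_one_of_mem (nbrs_nodup_length' d2).1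
      ((hvGraph_adj_iff_mem_nbrs _ _).1 hd.symm)
  · simp only [Prod.mk.injEq, h2, and_false, if_false]
    simp
where
  /-- helper: the neighbour list has three distinct entries -/
  nbrs_nodup_length' (w : HV) : (nbrs w).Nodup ∧ (nbrs w).length = 3 := by
    obtain ⟨a, b, c⟩ := w
    cases c
    · simp [nbrs]; omega
    · simp [nbrs]

/-- In-degree: `Σ_{t ∼ v} #(t, v) = #{darts ending at v}`. [folklore] -/
theorem sum_nbrs_count_snd (D : List (HV × HV)) (hD : ∀ d ∈ D, hvGraph.Adj d.1 d.2) (v : HV) :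
    ((nbrs v).map fun t => D.count (t, v)).sum = D.countP fun d => d.2 = v := by
  induction D with
  | nil => simp
  | cons d D ih =>
    have hd := hD d (by simp)
    have hD' : ∀ d' ∈ D, hvGraph.Adj d'.1 d'.2 := fun d' h => hD d' (by simp [h])
    simp only [List.count_cons, List.sum_map_add, ih hD', List.countP_cons, beq_iff_eq,
      decide_eq_true_eq]
    congr 1
    have := sum_nbrs_ite_eq v hd
    simp only [eq_comm (a := d)] at this ⊢
    convert this using 2

/-- Out-degree: `Σ_{t ∼ v} #(v, t) = #{darts starting at v}`. [folklore] -/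
theorem sum_nbrs_count_fst (D : List (HV × HV)) (hD : ∀ d ∈ D, hvGraph.Adj d.1 d.2) (v : HV) :
    ((nbrs v).map fun t => D.count (v, t)).sum = D.countP fun d => d.1 = v := by
  have h := sum_nbrs_count_snd (D.map Prod.swap) (fun d hd => ?_) v
  · simp only [List.countP_map] at h
    have e : (fun d : HV × HV => decide (d.1 = v)) = (fun d => decide (d.2 = v)) ∘ Prod.swap := by
      funext d; rfl
    rw [e, ← h]
    congr 1
    refine List.map_congr_left fun t _ => ?_
    rw [show (t, v) = Prod.swap (v, t) from rfl, List.count_map_of_injective _ _ Prod.swap_injective]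
  · rw [List.mem_map] at hd
    obtain ⟨d', hd', rfl⟩ := hd
    exact (hD d' hd').symm

/-- The number of cyclic darts ending at `v` is the multiplicity of `v`. [folklore] -/
theorem countP_cdarts_snd (l : List HV) (v : HV) : ((cdarts l).countP fun d => d.2 = v) = l.count v := by
  rw [cdarts, show (fun d : HV × HV => decide (d.2 = v)) = (fun w => decide (w = v)) ∘ Prod.snd from rfl,
    ← List.countP_map, List.map_snd_zip (by simp), (List.rotate_perm l 1).countP_eq, List.count_eq_countP]
  exact List.countP_congr fun x _ => by simp [beq_eq_decide]

/-- The number of cyclic darts starting at `v` is the multiplicity of `v`. [folklore] -/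
theorem countP_cdarts_fst (l : List HV) (v : HV) : ((cdarts l).countP fun d => d.1 = v) = l.count v := by
  rw [cdarts, show (fun d : HV × HV => decide (d.1 = v)) = (fun w => decide (w = v)) ∘ Prod.fst from rfl,
    ← List.countP_map, List.map_fst_zip (by simp), List.count_eq_countP]
  exact List.countP_congr fun x _ => by simp [beq_eq_decide]

/-- **Kirchhoff's law** at a vertex of type `0`: the net flux into `v` vanishes.
[folklore] -/
theorem kirchhoff_false (hl : ∀ d ∈ cdarts l, hvGraph.Adj d.1 d.2) (a b : ℤ) :
    flux l (a, b, true) (a, b, false) + flux l (a - 1, b, true) (a, b, false) +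
      flux l (a, b - 1, true) (a, b, false) = 0 := by
  have h1 := sum_nbrs_count_snd (cdarts l) hl (a, b, false)
  have h2 := sum_nbrs_count_fst (cdarts l) hl (a, b, false)
  rw [countP_cdarts_snd] at h1
  rw [countP_cdarts_fst] at h2
  simp only [nbrs, List.map_cons, List.map_nil, List.sum_cons, List.sum_nil, add_zero] at h1 h2
  simp only [flux, dcount]
  omega

/-- **Kirchhoff's law** at a vertex of type `1`. [folklore] -/
theorem kirchhoff_true (hl : ∀ d ∈ cdarts l, hvGraph.Adj d.1 d.2) (a b : ℤ) :
    flux l (a, b, false) (a, b, true) + flux l (a + 1, b, false) (a, b, true) +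
      flux l (a, b + 1, false) (a, b, true) = 0 := by
  have h1 := sum_nbrs_count_snd (cdarts l) hl (a, b, true)
  have h2 := sum_nbrs_count_fst (cdarts l) hl (a, b, true)
  rw [countP_cdarts_snd] at h1
  rw [countP_cdarts_fst] at h2
  simp only [nbrs, List.map_cons, List.map_nil, List.sum_cons, List.sum_nil, add_zero] at h1 h2
  simp only [flux, dcount]
  omega

/-! ### Locality of the winding number -/

/-- Moving the face one step up the ray changes the contribution of a dart exactly when the dart
is the crossed edge. [folklore] -/
theorem dartWnd_up_sub (d : HV × HV) (a b : ℤ) :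
    dartWnd d (a, b + 1) - dartWnd d (a, b) =
      (if d = ((a - 1, b, true), (a, b, false)) then 1 else 0) -
        (if d = ((a, b, false), (a - 1, b, true)) then 1 else 0) := by
  obtain ⟨⟨ux, uy, ub⟩, ⟨vx, vy, vb⟩⟩ := d
  cases ub <;> cases vb <;> simp only [dartWnd] <;> split_ifs <;>
    simp only [Prod.mk.injEq, and_true, Bool.false_eq_true, Bool.true_eq_false, and_false, false_and,
      not_false_eq_true] at * <;> omega

/-- The vertical step for dart lists. [folklore] -/
theorem dwnd_up_sub (D : List (HV × HV)) (a b : ℤ) :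
    dwnd D (a, b + 1) - dwnd D (a, b) =
      (D.count ((a - 1, b, true), (a, b, false)) : ℤ) - D.count ((a, b, false), (a - 1, b, true)) := by
  induction D with
  | nil => simp
  | cons d D ih =>
    simp only [dwnd_cons, List.count_cons, beq_iff_eq, Nat.cast_add, Nat.cast_ite, Nat.cast_one,
      Nat.cast_zero]
    have := dartWnd_up_sub d a b
    linarith

/-- **The vertical step**: crossing the edge `{(a-1,b,1), (a,b,0)}` from the face `(a,b)` to the
face `(a,b+1)` changes the winding number by the flux through it. [folklore] -/
theorem wnd_up_sub (l : List HV) (a b : ℤ) :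
    wnd l (a, b + 1) - wnd l (a, b) = flux l (a - 1, b, true) (a, b, false) := by
  rw [wnd_eq_dwnd, wnd_eq_dwnd, dwnd_up_sub, flux, dcount, dcount]

/-- A dart contributes only to faces above its lower endpoint levels. [folklore] -/
theorem dartWnd_eq_zero_of_le (d : HV × HV) (F : ℤ × ℤ) (h1 : F.2 ≤ d.1.2.1) (h2 : F.2 ≤ d.2.2.1) :
    dartWnd d F = 0 := by
  obtain ⟨⟨ux, uy, ub⟩, ⟨vx, vy, vb⟩⟩ := d
  simp only at h1 h2
  cases ub <;> cases vb <;> simp only [dartWnd] <;> split_ifs <;> omega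

/-- A dart contributes only to faces in the column of its endpoints. [folklore] -/
theorem dartWnd_eq_zero_of_ne (d : HV × HV) (F : ℤ × ℤ) (h1 : F.1 ≠ d.1.1) (h2 : F.1 ≠ d.2.1) :
    dartWnd d F = 0 := by
  obtain ⟨⟨ux, uy, ub⟩, ⟨vx, vy, vb⟩⟩ := d
  simp only at h1 h2
  cases ub <;> cases vb <;> simp only [dartWnd] <;> split_ifs <;> omega

/-- Faces below the cycle have winding number `0`. [folklore] -/
theorem wnd_eq_zero_of_le {F : ℤ × ℤ} (h : ∀ w ∈ l, F.2 ≤ w.2.1) : wnd l F = 0 := by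
  rw [wnd_eq_dwnd, dwnd]
  refine List.sum_eq_zero fun x hx => ?_
  rw [List.mem_map] at hx
  obtain ⟨d, hd, rfl⟩ := hx
  have := mem_of_mem_cdarts hd
  exact dartWnd_eq_zero_of_le d F (h _ this.1) (h _ this.2)

/-- Faces in a column avoiding the cycle have winding number `0`. [folklore] -/
theorem wnd_eq_zero_of_fst_ne {F : ℤ × ℤ} (h : ∀ w ∈ l, w.1 ≠ F.1) : wnd l F = 0 := by
  rw [wnd_eq_dwnd, dwnd]
  refine List.sum_eq_zero fun x hx => ?_
  rw [List.mem_map] at hx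
  obtain ⟨d, hd, rfl⟩ := hx
  have := mem_of_mem_cdarts hd
  exact dartWnd_eq_zero_of_ne d F (h _ this.1).symm (h _ this.2).symm

/-- Every list has a lower bound for the second coordinates of its entries. [folklore] -/
theorem exists_le_snd (l : List HV) : ∃ m : ℤ, ∀ w ∈ l, m ≤ w.2.1 := by
  induction l with
  | nil => exact ⟨0, by simp⟩
  | cons a L ih =>
    obtain ⟨m, hm⟩ := ih
    exact ⟨min m a.2.1, fun w hw => by
      rcases List.mem_cons.1 hw with rfl | hw
      · exact min_le_right _ _
      · exact (min_le_left _ _).trans (hm w hw)⟩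

/-- Every list has an upper bound for the second coordinates of its entries. [folklore] -/
theorem exists_snd_le (l : List HV) : ∃ m : ℤ, ∀ w ∈ l, w.2.1 ≤ m := by
  induction l with
  | nil => exact ⟨0, by simp⟩
  | cons a L ih =>
    obtain ⟨m, hm⟩ := ih
    exact ⟨max m a.2.1, fun w hw => by
      rcases List.mem_cons.1 hw with rfl | hw
      · exact le_max_right _ _
      · exact (hm w hw).trans (le_max_left _ _)⟩

/-- Every list has an upper bound for the first coordinates of its entries. [folklore] -/
theorem exists_fst_le (l : List HV) : ∃ m : ℤ, ∀ w ∈ l, w.1 ≤ m := by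
  induction l with
  | nil => exact ⟨0, by simp⟩
  | cons a L ih =>
    obtain ⟨m, hm⟩ := ih
    exact ⟨max m a.1, fun w hw => by
      rcases List.mem_cons.1 hw with rfl | hw
      · exact le_max_right _ _
      · exact (hm w hw).trans (le_max_left _ _)⟩

section Locality

variable (hl : ∀ d ∈ cdarts l, hvGraph.Adj d.1 d.2)
include hl

/-- Descent step for the edges `{(a,b,0), (a,b,1)}` (between the faces `(a+1,b)` and `(a,b+1)`).
[folklore] -/
theorem locA_step (a b : ℤ) :
    wnd l (a, b + 1) - wnd l (a + 1, b) - flux l (a, b, false) (a, b, true) =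
      wnd l (a, b) - wnd l (a + 1, b - 1) - flux l (a, b - 1, false) (a, b - 1, true) := by
  have v1 := wnd_up_sub l a b
  have v2 := wnd_up_sub l (a + 1) (b - 1)
  simp only [add_sub_cancel_right, sub_add_cancel] at v2
  have k1 := kirchhoff_false hl a b
  have k2 := kirchhoff_true hl a (b - 1)
  simp only [sub_add_cancel] at k2
  have as1 := flux_antisymm l (a, b, false) (a, b, true)
  have as2 := flux_antisymm l (a, b - 1, true) (a + 1, b - 1, false)
  have as3 := flux_antisymm l (a, b, false) (a, b - 1, true)
  linarith

/-- Descent step for the edges `{(a,b-1,1), (a,b,0)}` (between the faces `(a,b)` and `(a+1,b)`).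
[folklore] -/
theorem locB_step (a b : ℤ) :
    wnd l (a, b) - wnd l (a + 1, b) - flux l (a, b - 1, true) (a, b, false) =
      wnd l (a, b - 1) - wnd l (a + 1, b - 1) - flux l (a, b - 1 - 1, true) (a, b - 1, false) := by
  have v1 := wnd_up_sub l a (b - 1)
  have v2 := wnd_up_sub l (a + 1) (b - 1)
  simp only [add_sub_cancel_right, sub_add_cancel] at v1 v2
  have k1 := kirchhoff_false hl a (b - 1)
  have k2 := kirchhoff_true hl a (b - 1)
  simp only [sub_add_cancel] at k2
  have as1 := flux_antisymm l (a, b - 1, true) (a + 1, b - 1, false)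
  have as2 := flux_antisymm l (a, b - 1, true) (a, b, false)
  have as3 := flux_antisymm l (a, b - 1, false) (a, b - 1, true)
  linarith

/-- **Locality, edges of type A**: `w(a, b+1) - w(a+1, b)` is the flux through the dart
`(a,b,0) → (a,b,1)` (which has `(a,b+1)` on its left and `(a+1,b)` on its right). [folklore] -/
theorem wnd_locA (a b : ℤ) : wnd l (a, b + 1) - wnd l (a + 1, b) = flux l (a, b, false) (a, b, true) := by
  obtain ⟨m, hm⟩ := exists_le_snd l
  have key : ∀ k : ℕ, wnd l (a, b + 1) - wnd l (a + 1, b) - flux l (a, b, false) (a, b, true) =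
      wnd l (a, b - k + 1) - wnd l (a + 1, b - k) - flux l (a, b - k, false) (a, b - k, true) := by
    intro k
    induction k with
    | zero => simp
    | succ k ih =>
      rw [ih, locA_step hl a (b - k)]
      push_cast
      ring_nf
  obtain ⟨k, hk⟩ : ∃ k : ℕ, b - k + 1 ≤ m :=
    ⟨(b + 1 - m).toNat, by have := Int.self_le_toNat (b + 1 - m); omega⟩
  have h := key k
  rw [wnd_eq_zero_of_le (F := (a, b - k + 1)) (fun w hw => by have := hm w hw; show b - k + 1 ≤ _; omega),
    wnd_eq_zero_of_le (F := (a + 1, b - k)) (fun w hw => by have := hm w hw; show b - k ≤ _; omega),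
    flux_eq_zero_of_not_mem (u := (a, b - k, false)) (v := (a, b - k, true))
      (Or.inl fun hmem => by have := hm _ hmem; simp only at this; omega)] at h
  linarith

/-- **Locality, edges of type B**: `w(a, b) - w(a+1, b)` is the flux through the dart
`(a,b-1,1) → (a,b,0)` (left face `(a,b)`, right face `(a+1,b)`). [folklore] -/
theorem wnd_locB (a b : ℤ) : wnd l (a, b) - wnd l (a + 1, b) = flux l (a, b - 1, true) (a, b, false) := by
  obtain ⟨m, hm⟩ := exists_le_snd l
  have key : ∀ k : ℕ, wnd l (a, b) - wnd l (a + 1, b) - flux l (a, b - 1, true) (a, b, false) =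
      wnd l (a, b - k) - wnd l (a + 1, b - k) - flux l (a, b - k - 1, true) (a, b - k, false) := by
    intro k
    induction k with
    | zero => simp
    | succ k ih =>
      rw [ih, locB_step hl a (b - k)]
      push_cast
      ring_nf
  obtain ⟨k, hk⟩ : ∃ k : ℕ, b - k ≤ m := ⟨(b - m).toNat, by have := Int.self_le_toNat (b - m); omega⟩
  have h := key k
  rw [wnd_eq_zero_of_le (F := (a, b - k)) (fun w hw => by have := hm w hw; show b - k ≤ _; omega),
    wnd_eq_zero_of_le (F := (a + 1, b - k)) (fun w hw => by have := hm w hw; show b - k ≤ _; omega),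
    flux_eq_zero_of_not_mem (u := (a, b - k - 1, true)) (v := (a, b - k, false))
      (Or.inl fun hmem => by have := hm _ hmem; simp only at this; omega)] at h
  linarith

omit hl in
/-- Left face of `(a,b,0) → (a,b,1)`. [folklore] -/
@[simp] theorem leftFace_ff0 (a b : ℤ) : leftFace (a, b, false) (a, b, true) = (a, b + 1) := by
  simp [leftFace]

omit hl in
/-- Left face of `(a,b,0) → (a-1,b,1)`. [folklore] -/
@[simp] theorem leftFace_ff1 (a b : ℤ) : leftFace (a, b, false) (a - 1, b, true) = (a, b) := by
  simp [leftFace]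

omit hl in
/-- Left face of `(a,b,0) → (a,b-1,1)`. [folklore] -/
@[simp] theorem leftFace_ff2 (a b : ℤ) : leftFace (a, b, false) (a, b - 1, true) = (a + 1, b) := by
  simp [leftFace]

omit hl in
/-- Left face of `(a,b,1) → (a,b,0)`. [folklore] -/
@[simp] theorem leftFace_tt0 (a b : ℤ) : leftFace (a, b, true) (a, b, false) = (a + 1, b) := by
  simp [leftFace]

omit hl in
/-- Left face of `(a,b,1) → (a+1,b,0)`. [folklore] -/
@[simp] theorem leftFace_tt1 (a b : ℤ) : leftFace (a, b, true) (a + 1, b, false) = (a + 1, b + 1) := by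
  simp [leftFace]

omit hl in
/-- Left face of `(a,b,1) → (a,b+1,0)`. [folklore] -/
@[simp] theorem leftFace_tt2 (a b : ℤ) : leftFace (a, b, true) (a, b + 1, false) = (a, b + 1) := by
  simp [leftFace]

omit hl in
/-- Right face of `(a,b,0) → (a,b,1)`. [folklore] -/
@[simp] theorem rightFace_ff0 (a b : ℤ) : rightFace (a, b, false) (a, b, true) = (a + 1, b) := by
  simp [rightFace]

omit hl in
/-- Right face of `(a,b,0) → (a-1,b,1)`. [folklore] -/
@[simp] theorem rightFace_ff1 (a b : ℤ) : rightFace (a, b, false) (a - 1, b, true) = (a, b + 1) := by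
  rw [rightFace, show (a, b, false) = (a - 1 + 1, b, false) by simp, leftFace_tt1]; simp

omit hl in
/-- Right face of `(a,b,0) → (a,b-1,1)`. [folklore] -/
@[simp] theorem rightFace_ff2 (a b : ℤ) : rightFace (a, b, false) (a, b - 1, true) = (a, b) := by
  rw [rightFace, show (a, b, false) = (a, b - 1 + 1, false) by simp, leftFace_tt2]; simp

omit hl in
/-- Right face of `(a,b,1) → (a,b,0)`. [folklore] -/
@[simp] theorem rightFace_tt0 (a b : ℤ) : rightFace (a, b, true) (a, b, false) = (a, b + 1) := by
  simp [rightFace]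

omit hl in
/-- Right face of `(a,b,1) → (a+1,b,0)`. [folklore] -/
@[simp] theorem rightFace_tt1 (a b : ℤ) : rightFace (a, b, true) (a + 1, b, false) = (a + 1, b) := by
  rw [rightFace, show (a, b, true) = (a + 1 - 1, b, true) by simp, leftFace_ff1]

omit hl in
/-- Right face of `(a,b,1) → (a,b+1,0)`. [folklore] -/
@[simp] theorem rightFace_tt2 (a b : ℤ) : rightFace (a, b, true) (a, b + 1, false) = (a + 1, b + 1) := by
  rw [rightFace, show (a, b, true) = (a, b + 1 - 1, true) by simp, leftFace_ff2]

/-- **Locality of the winding number**: across any dart `u → v` of `ℍ`, the winding number drops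
from the left face to the right face by the flux through the dart. [folklore] -/
theorem wnd_left_sub_right {u v : HV} (huv : hvGraph.Adj u v) :
    wnd l (leftFace u v) - wnd l (rightFace u v) = flux l u v := by
  obtain ⟨a, b, c⟩ := u
  obtain ⟨a', b', c'⟩ := v
  cases c <;> cases c' <;> simp only [hvGraph_adj, AdjRel] at huv <;> simp at huv
  · rcases huv with ⟨h1, h2⟩ | ⟨h1, h2⟩ | ⟨h1, h2⟩ <;> subst a' b'
    · rw [leftFace_ff0, rightFace_ff0]; exact wnd_locA hl a b
    · rw [leftFace_ff1, rightFace_ff1]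
      have h := wnd_up_sub l a b
      have has := flux_antisymm l (a, b, false) (a - 1, b, true)
      linarith
    · rw [leftFace_ff2, rightFace_ff2]
      have h := wnd_locB hl a b
      have has := flux_antisymm l (a, b, false) (a, b - 1, true)
      linarith
  · rcases huv with ⟨h1, h2⟩ | ⟨h1, h2⟩ | ⟨h1, h2⟩ <;> subst a' b'
    · rw [leftFace_tt0, rightFace_tt0]
      have h := wnd_locA hl a b
      have has := flux_antisymm l (a, b, true) (a, b, false)
      linarith
    · rw [leftFace_tt1, rightFace_tt1]
      have h := wnd_up_sub l (a + 1) b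
      simp only [add_sub_cancel_right] at h
      linarith
    · rw [leftFace_tt2, rightFace_tt2]
      have h := wnd_locB hl a (b + 1)
      simp only [add_sub_cancel_right] at h
      linarith

/-- Across an edge carrying no flux the winding number does not change. [folklore] -/
theorem wnd_left_eq_right {u v : HV} (huv : hvGraph.Adj u v) (h0 : flux l u v = 0) :
    wnd l (leftFace u v) = wnd l (rightFace u v) := by
  have := wnd_left_sub_right hl huv; omega

/-- Faces above the cycle have winding number `0`. [folklore] -/
theorem wnd_eq_zero_of_snd_gt {F : ℤ × ℤ} (h : ∀ w ∈ l, w.2.1 < F.2) : wnd l F = 0 := by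
  obtain ⟨M, hM⟩ := exists_fst_le l
  have key : ∀ k : ℕ, wnd l F = wnd l (F.1 + k, F.2) := by
    intro k
    induction k with
    | zero => simp
    | succ k ih =>
      rw [ih]
      have := wnd_locB hl (F.1 + k) F.2
      rw [flux_eq_zero_of_not_mem (Or.inr fun hmem => by have := h _ hmem; simp at this)] at this
      push_cast
      rw [← add_assoc]
      linarith
  obtain ⟨k, hk⟩ : ∃ k : ℕ, M < F.1 + k :=
    ⟨(M - F.1 + 1).toNat, by have := Int.self_le_toNat (M - F.1 + 1); omega⟩
  rw [key k]
  exact wnd_eq_zero_of_fst_ne fun w hw => by have := hM w hw; simp; omega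

end Locality

end Wnd

/-! ### Local geometry of a hexagon (decided at the origin, transported by translation) -/

section Hexagon

/-- The face across the `k`-th edge of the hexagon `h` (edge from `hexV h k` to `hexV h (k+1)`):
`h+e₀, h+e₁, h-e₀+e₁, h-e₀, h-e₁, h+e₀-e₁`. [folklore] -/
def hexN (h : ℤ × ℤ) : Fin 6 → ℤ × ℤ
  | 0 => (h.1 + 1, h.2)
  | 1 => (h.1, h.2 + 1)
  | 2 => (h.1 - 1, h.2 + 1)
  | 3 => (h.1 - 1, h.2)
  | 4 => (h.1, h.2 - 1)
  | 5 => (h.1 + 1, h.2 - 1)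

/-- Neighbouring faces translate. [folklore] -/
theorem hexN_eq_add (h : ℤ × ℤ) (k : Fin 6) : hexN h k = hexN (0, 0) k + h := by
  obtain ⟨h1, h2⟩ := h
  fin_cases k <;> simp [hexN] <;> omega

/-- The neighbour list translates. [folklore] -/
theorem nbrs_tr (t : ℤ × ℤ) (v : HV) : nbrs (tr t v) = (nbrs v).map (tr t) := by
  obtain ⟨a, b, c⟩ := v
  cases c <;> simp [nbrs, tr] <;> constructor <;> ring

/-- Consecutive hexagon vertices are adjacent. [folklore] -/
theorem adj_hexV_succ (h : ℤ × ℤ) (k : Fin 6) : hvGraph.Adj (hexV h k) (hexV h (k + 1)) := by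
  rw [hexV_eq_tr h k, hexV_eq_tr h (k + 1), adj_tr_iff]
  revert k; decide

/-- A hexagon vertex is adjacent to its exterior neighbour. [folklore] -/
theorem adj_hexV_hexExt (h : ℤ × ℤ) (k : Fin 6) : hvGraph.Adj (hexV h k) (hexExt h k) := by
  rw [hexV_eq_tr h k, hexExt_eq_tr h k, adj_tr_iff]
  revert k; decide

/-- The six vertices of a hexagon are distinct. [folklore] -/
theorem hexV_injective (h : ℤ × ℤ) : Function.Injective (hexV h) := by
  intro k k' e
  rw [hexV_eq_tr h k, hexV_eq_tr h k'] at e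
  have e' := tr_injective h e
  have key : ∀ k k' : Fin 6, hexV (0, 0) k = hexV (0, 0) k' → k = k' := by decide
  exact key k k' e'

/-- Exterior neighbours are not vertices of the hexagon. [folklore] -/
theorem hexExt_ne_hexV (h : ℤ × ℤ) (k k' : Fin 6) : hexExt h k ≠ hexV h k' := by
  rw [hexV_eq_tr h k', hexExt_eq_tr h k, (tr_injective h).ne_iff]
  revert k k'; decide

/-- **The three neighbours of a hexagon vertex**: the next and previous vertices and the exterior
neighbour. [folklore] -/
theorem adj_hexV_iff (h : ℤ × ℤ) (k : Fin 6) (t : HV) :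
    hvGraph.Adj (hexV h k) t ↔ t = hexV h (k + 1) ∨ t = hexV h (k - 1) ∨ t = hexExt h k := by
  constructor
  · intro ht
    have hmem := (hvGraph_adj_iff_mem_nbrs _ _).1 ht
    rw [hexV_eq_tr h k, nbrs_tr, List.mem_map] at hmem
    obtain ⟨t0, ht0, rfl⟩ := hmem
    have key : ∀ k : Fin 6, ∀ t0 ∈ nbrs (hexV (0, 0) k),
        t0 = hexV (0, 0) (k + 1) ∨ t0 = hexV (0, 0) (k - 1) ∨ t0 = hexExt (0, 0) k := by decide
    rcases key k t0 ht0 with rfl | rfl | rfl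
    · left; rw [hexV_eq_tr h (k + 1)]
    · right; left; rw [hexV_eq_tr h (k - 1)]
    · right; right; rw [hexExt_eq_tr h k]
  · rintro (rfl | rfl | rfl)
    · exact adj_hexV_succ h k
    · have := adj_hexV_succ h (k - 1); rwa [sub_add_cancel, hvGraph.adj_comm] at this
    · exact adj_hexV_hexExt h k

/-- The hexagon lies to the left of its counterclockwise boundary darts. [folklore] -/
@[simp] theorem leftFace_hexV (h : ℤ × ℤ) (k : Fin 6) : leftFace (hexV h k) (hexV h (k + 1)) = h := by
  have key : ∀ k : Fin 6, leftFace (hexV (0, 0) k) (hexV (0, 0) (k + 1)) = (0, 0) := by decide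
  rw [hexV_eq_tr h k, hexV_eq_tr h (k + 1), leftFace_tr _ (adj_hexV_succ (0, 0) k), key]
  simp

/-- The neighbouring faces lie to the right of the counterclockwise boundary darts. [folklore] -/
@[simp] theorem rightFace_hexV (h : ℤ × ℤ) (k : Fin 6) :
    rightFace (hexV h k) (hexV h (k + 1)) = hexN h k := by
  have key : ∀ k : Fin 6, rightFace (hexV (0, 0) k) (hexV (0, 0) (k + 1)) = hexN (0, 0) k := by decide
  rw [hexV_eq_tr h k, hexV_eq_tr h (k + 1), rightFace_tr _ (adj_hexV_succ (0, 0) k), key,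
    hexN_eq_add h]

/-- Clockwise boundary darts have the hexagon on their right. [folklore] -/
@[simp] theorem rightFace_hexV_rev (h : ℤ × ℤ) (k : Fin 6) : rightFace (hexV h (k + 1)) (hexV h k) = h :=
  leftFace_hexV h k

/-- Clockwise boundary darts have the neighbouring face on their left. [folklore] -/
@[simp] theorem leftFace_hexV_rev (h : ℤ × ℤ) (k : Fin 6) :
    leftFace (hexV h (k + 1)) (hexV h k) = hexN h k :=
  rightFace_hexV h k

/-- **Which darts have a given face on their left**: exactly the counterclockwise boundary darts
of that hexagon. [folklore] -/
theorem leftFace_eq_iff {u v : HV} (huv : hvGraph.Adj u v) (h : ℤ × ℤ) :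
    leftFace u v = h ↔ ∃ k : Fin 6, u = hexV h k ∧ v = hexV h (k + 1) := by
  constructor
  · intro hf
    obtain ⟨a, b, c⟩ := u
    obtain ⟨a', b', c'⟩ := v
    obtain ⟨h1, h2⟩ := h
    cases c <;> cases c' <;> simp only [hvGraph_adj, AdjRel] at huv <;> simp at huv
    · rcases huv with ⟨e1, e2⟩ | ⟨e1, e2⟩ | ⟨e1, e2⟩ <;> subst a' b'
      · rw [leftFace_ff0, Prod.mk.injEq] at hf; obtain ⟨rfl, rfl⟩ := hf
        exact ⟨5, by simp [hexV], by simp [hexV]⟩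
      · rw [leftFace_ff1, Prod.mk.injEq] at hf; obtain ⟨rfl, rfl⟩ := hf
        exact ⟨1, by simp [hexV], by simp [hexV]⟩
      · rw [leftFace_ff2, Prod.mk.injEq] at hf; obtain ⟨rfl, rfl⟩ := hf
        exact ⟨3, by simp [hexV], by simp [hexV]⟩
    · rcases huv with ⟨e1, e2⟩ | ⟨e1, e2⟩ | ⟨e1, e2⟩ <;> subst a' b'
      · rw [leftFace_tt0, Prod.mk.injEq] at hf; obtain ⟨rfl, rfl⟩ := hf
        exact ⟨2, by simp [hexV], by simp [hexV]⟩
      · rw [leftFace_tt1, Prod.mk.injEq] at hf; obtain ⟨rfl, rfl⟩ := hf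
        exact ⟨4, by simp [hexV], by simp [hexV]⟩
      · rw [leftFace_tt2, Prod.mk.injEq] at hf; obtain ⟨rfl, rfl⟩ := hf
        exact ⟨0, by simp [hexV], by simp [hexV]⟩
  · rintro ⟨k, rfl, rfl⟩
    exact leftFace_hexV h k

/-- **Which darts have a given face on their right**: exactly the clockwise boundary darts of
that hexagon. [folklore] -/
theorem rightFace_eq_iff {u v : HV} (huv : hvGraph.Adj u v) (h : ℤ × ℤ) :
    rightFace u v = h ↔ ∃ k : Fin 6, u = hexV h (k + 1) ∧ v = hexV h k := by
  rw [rightFace, leftFace_eq_iff huv.symm]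
  exact ⟨fun ⟨k, h1, h2⟩ => ⟨k, h2, h1⟩, fun ⟨k, h1, h2⟩ => ⟨k, h2, h1⟩⟩

/-- An exterior dart does not bound the hexagon on its left. [folklore] -/
theorem leftFace_hexExt_ne (h : ℤ × ℤ) (k : Fin 6) : leftFace (hexV h k) (hexExt h k) ≠ h := by
  rw [Ne, leftFace_eq_iff (adj_hexV_hexExt h k)]
  rintro ⟨k', -, e⟩
  exact hexExt_ne_hexV h k (k' + 1) e

/-- An exterior dart does not bound the hexagon on its right. [folklore] -/
theorem rightFace_hexExt_ne (h : ℤ × ℤ) (k : Fin 6) : rightFace (hexV h k) (hexExt h k) ≠ h := by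
  rw [Ne, rightFace_eq_iff (adj_hexV_hexExt h k)]
  rintro ⟨k', -, e⟩
  exact hexExt_ne_hexV h k k' e

/-- An incoming exterior dart does not bound the hexagon on its left. [folklore] -/
theorem leftFace_hexExt_ne' (h : ℤ × ℤ) (k : Fin 6) : leftFace (hexExt h k) (hexV h k) ≠ h :=
  rightFace_hexExt_ne h k

/-- An incoming exterior dart does not bound the hexagon on its right. [folklore] -/
theorem rightFace_hexExt_ne' (h : ℤ × ℤ) (k : Fin 6) : rightFace (hexExt h k) (hexV h k) ≠ h :=
  leftFace_hexExt_ne h k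

/-- Going around the hexagon counterclockwise one turns left at every vertex. [folklore] -/
@[simp] theorem turn_hexV_ccw (h : ℤ × ℤ) (k : Fin 6) :
    turn (hexV h (k - 1)) (hexV h k) (hexV h (k + 1)) = 1 := by
  rw [hexV_eq_tr h (k - 1), hexV_eq_tr h k, hexV_eq_tr h (k + 1), turn_tr]
  revert k; decide

/-- Going around the hexagon clockwise one turns right at every vertex. [folklore] -/
@[simp] theorem turn_hexV_cw (h : ℤ × ℤ) (k : Fin 6) :
    turn (hexV h (k + 1)) (hexV h k) (hexV h (k - 1)) = -1 := by
  rw [turn_rev, turn_hexV_ccw]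

/-- Entering the counterclockwise boundary from outside is a right turn. [folklore] -/
@[simp] theorem turn_hexExt_ccw (h : ℤ × ℤ) (k : Fin 6) :
    turn (hexExt h k) (hexV h k) (hexV h (k + 1)) = -1 := by
  rw [hexV_eq_tr h k, hexExt_eq_tr h k, hexV_eq_tr h (k + 1), turn_tr]
  revert k; decide

/-- Leaving the counterclockwise boundary to the outside is a right turn. [folklore] -/
@[simp] theorem turn_ccw_hexExt (h : ℤ × ℤ) (k : Fin 6) :
    turn (hexV h (k - 1)) (hexV h k) (hexExt h k) = -1 := by
  rw [hexV_eq_tr h (k - 1), hexExt_eq_tr h k, hexV_eq_tr h k, turn_tr]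
  revert k; decide

/-- Entering the clockwise boundary from outside is a left turn. [folklore] -/
@[simp] theorem turn_hexExt_cw (h : ℤ × ℤ) (k : Fin 6) :
    turn (hexExt h k) (hexV h k) (hexV h (k - 1)) = 1 := by
  have := turn_ccw_hexExt h k; rw [turn_rev] at this; omega

/-- Leaving the clockwise boundary to the outside is a left turn. [folklore] -/
@[simp] theorem turn_cw_hexExt (h : ℤ × ℤ) (k : Fin 6) :
    turn (hexV h (k + 1)) (hexV h k) (hexExt h k) = 1 := by
  have := turn_hexExt_ccw h k; rw [turn_rev] at this; omega

/-- The six counterclockwise boundary darts of the hexagon `h`. [folklore] -/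
def hexDarts (h : ℤ × ℤ) : List (HV × HV) := (List.finRange 6).map fun k => (hexV h k, hexV h (k + 1))

/-- Dart contributions translate. [folklore] -/
theorem dartWnd_tr (t : ℤ × ℤ) (u v : HV) (F : ℤ × ℤ) :
    dartWnd (tr t u, tr t v) F = dartWnd (u, v) (F - t) := by
  obtain ⟨ux, uy, ub⟩ := u
  obtain ⟨vx, vy, vb⟩ := v
  obtain ⟨t1, t2⟩ := t
  obtain ⟨F1, F2⟩ := F
  cases ub <;> cases vb <;> simp only [dartWnd, tr, Prod.mk_sub_mk] <;> split_ifs <;> omega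

/-- **The boundary of a hexagon winds once around it and around nothing else.** [folklore] -/
theorem dwnd_hexDarts (h F : ℤ × ℤ) : dwnd (hexDarts h) F = if F = h then 1 else 0 := by
  have key : ∀ G : ℤ × ℤ, dwnd (hexDarts (0, 0)) G = if G = (0, 0) then 1 else 0 := by
    intro G
    obtain ⟨G1, G2⟩ := G
    simp only [dwnd, hexDarts, List.map_map]
    simp [List.finRange_succ, hexV, dartWnd]
    split_ifs <;> omega
  have e : hexDarts h = (hexDarts (0, 0)).map (fun d => (tr h d.1, tr h d.2)) := by
    simp [hexDarts, hexV_eq_tr h]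
  rw [e, dwnd, List.map_map]
  rw [show ((fun d => dartWnd d F) ∘ fun d : HV × HV => (tr h d.1, tr h d.2)) =
    fun d => dartWnd d (F - h) by funext d; exact dartWnd_tr h d.1 d.2 F]
  rw [← dwnd, key]
  obtain ⟨F1, F2⟩ := F; obtain ⟨h1, h2⟩ := h
  simp only [Prod.mk_sub_mk, Prod.mk.injEq]
  split_ifs <;> omega

end Hexagon

/-! ### Turning numbers under rotation and reversal; positively oriented cycles -/

section Orient

variable {l : List HV}

/-- The turning number is invariant under rotating the cycle by one (length `≥ 3`). [folklore] -/
theorem cturn_rotate_one (h3 : 3 ≤ l.length) : cturn (l.rotate 1) = cturn l := by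
  match l, h3 with
  | a :: b :: c :: M, _ =>
    rw [show (a :: b :: c :: M).rotate 1 = b :: c :: M ++ [a] by simp, cturn, cturn,
      List.take_append_of_le_length (by simp)]
    simp only [List.take_succ_cons, List.take_zero, List.cons_append, List.append_assoc,
      List.nil_append, pturn_cons₃]
    have := pturn_append_cons_cons (b :: c :: M) [c] a b
    simp only [List.cons_append, pturn_cons₃, pturn_two, add_zero] at this
    rw [this]
    ring

/-- The turning number is invariant under rotations (length `≥ 3`). [folklore] -/
theorem cturn_rotate (h3 : 3 ≤ l.length) (k : ℕ) : cturn (l.rotate k) = cturn l := by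
  induction k with
  | zero => rw [List.rotate_zero]
  | succ k ih => rw [← List.rotate_rotate, cturn_rotate_one (by rw [List.length_rotate]; exact h3), ih]

/-- The turning number changes sign under reversal (length `≥ 3`). [folklore] -/
theorem cturn_reverse (h3 : 3 ≤ l.length) : cturn l.reverse = -cturn l := by
  match l, h3 with
  | a :: b :: M, h3 =>
    have e1 : ((a :: b :: M).reverse).rotate M.length = b :: a :: M.reverse := by
      rw [show (a :: b :: M).reverse = M.reverse ++ [b, a] by simp, ← List.length_reverse (as := M),
        List.rotate_append_length_eq]
      rfl
    rw [← cturn_rotate (by simpa using h3) M.length, e1, cturn, cturn,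
      show b :: a :: M.reverse ++ (b :: a :: M.reverse).take 2 =
        (a :: b :: M ++ (a :: b :: M).take 2).reverse by simp]
    exact pturn_reverse _

/-- **Positively oriented simple cycle**: turning number `+6` (one full counterclockwise turn in
units of `π/3`) and winding number `0` on the face to the right of every dart (hence `1` on the
face to the left). [folklore] -/
def Good (l : List HV) : Prop := cturn l = 6 ∧ ∀ d ∈ cdarts l, wnd l (rightFace d.1 d.2) = 0

/-- `Good` is invariant under rotation. [folklore] -/
theorem good_rotate_iff (h3 : 3 ≤ l.length) (k : ℕ) : Good (l.rotate k) ↔ Good l := by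
  simp only [Good, cturn_rotate h3, wnd_rotate, (cdarts_rotate_perm l k).mem_iff]

/-- In a positively oriented simple cycle the faces to the left of the darts have winding number
`1`. [folklore] -/
theorem Good.wnd_leftFace (hg : Good l) (hc : IsCyc l) {d : HV × HV} (hd : d ∈ cdarts l) :
    wnd l (leftFace d.1 d.2) = 1 := by
  have h1 := wnd_left_sub_right hc.2.2 (hc.2.2 d hd)
  rw [hc.flux_eq_one hd, hg.2 d hd] at h1
  omega

/-- `Good l.reverse` in terms of `l`: turning number `-6` and winding number `0` to the left of
every dart. [folklore] -/
theorem good_reverse_iff (h3 : 3 ≤ l.length) :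
    Good l.reverse ↔ cturn l = -6 ∧ ∀ d ∈ cdarts l, wnd l (leftFace d.1 d.2) = 0 := by
  rw [Good, cturn_reverse h3]
  constructor
  · rintro ⟨h1, h2⟩
    refine ⟨by omega, fun d hd => ?_⟩
    have : d.swap ∈ cdarts l.reverse :=
      (cdarts_reverse_perm l).mem_iff.2 (List.mem_map.2 ⟨d, hd, rfl⟩)
    have h3 := h2 _ this
    rw [wnd_reverse, neg_eq_zero] at h3
    exact h3
  · rintro ⟨h1, h2⟩
    refine ⟨by omega, fun d hd => ?_⟩
    have := (cdarts_reverse_perm l).mem_iff.1 hd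
    rw [List.mem_map] at this
    obtain ⟨d', hd', rfl⟩ := this
    rw [wnd_reverse, neg_eq_zero]
    exact h2 d' hd'

/-! ### Faces around a vertex off the cycle; propagation along paths -/

/-- **All three faces at a vertex not on the cycle have the same winding number** (no flux
through its edges). Version `left = right`. [folklore] -/
theorem wnd_faces_at_eq (hl : ∀ d ∈ cdarts l, hvGraph.Adj d.1 d.2) {q t t' : HV} (hq : q ∉ l)
    (ht : hvGraph.Adj q t) (ht' : hvGraph.Adj q t') :
    wnd l (leftFace q t) = wnd l (rightFace q t') := by
  have h0 : ∀ s, hvGraph.Adj q s → wnd l (leftFace q s) = wnd l (rightFace q s) := fun s hs =>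
    wnd_left_eq_right hl hs (flux_eq_zero_of_not_mem (Or.inl hq))
  obtain ⟨a, b, c⟩ := q
  obtain ⟨x, y, z⟩ := t
  obtain ⟨x', y', z'⟩ := t'
  cases c
  · have n0 := h0 (a, b, true) (by simp [hvGraph_adj, AdjRel])
    have n1 := h0 (a - 1, b, true) (by simp [hvGraph_adj, AdjRel])
    have n2 := h0 (a, b - 1, true) (by simp [hvGraph_adj, AdjRel])
    simp only [leftFace_ff0, rightFace_ff0, leftFace_ff1, rightFace_ff1, leftFace_ff2,
      rightFace_ff2] at n0 n1 n2
    cases z <;> cases z' <;> simp only [hvGraph_adj, AdjRel] at ht ht' <;> simp at ht ht'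
    rcases ht with ⟨e1, e2⟩ | ⟨e1, e2⟩ | ⟨e1, e2⟩ <;> rcases ht' with ⟨e3, e4⟩ | ⟨e3, e4⟩ | ⟨e3, e4⟩ <;>
      subst x y x' y' <;> simp <;> linarith
  · have n0 := h0 (a, b, false) (by simp [hvGraph_adj, AdjRel])
    have n1 := h0 (a + 1, b, false) (by simp [hvGraph_adj, AdjRel])
    have n2 := h0 (a, b + 1, false) (by simp [hvGraph_adj, AdjRel])
    simp only [leftFace_tt0, rightFace_tt0, leftFace_tt1, rightFace_tt1, leftFace_tt2,
      rightFace_tt2] at n0 n1 n2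
    cases z <;> cases z' <;> simp only [hvGraph_adj, AdjRel] at ht ht' <;> simp at ht ht'
    rcases ht with ⟨e1, e2⟩ | ⟨e1, e2⟩ | ⟨e1, e2⟩ <;> rcases ht' with ⟨e3, e4⟩ | ⟨e3, e4⟩ | ⟨e3, e4⟩ <;>
      subst x y x' y' <;> simp <;> linarith

/-- All three faces at a vertex not on the cycle have the same winding number, version
`right = right`. [folklore] -/
theorem wnd_faces_at_eq' (hl : ∀ d ∈ cdarts l, hvGraph.Adj d.1 d.2) {q t t' : HV} (hq : q ∉ l)
    (ht : hvGraph.Adj q t) (ht' : hvGraph.Adj q t') :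
    wnd l (rightFace q t) = wnd l (rightFace q t') := by
  rw [← wnd_faces_at_eq hl hq ht ht', wnd_faces_at_eq hl hq ht ht]

/-- **Propagation along a path avoiding the cycle**: the faces to the right of consecutive darts
of a path whose interior vertices are off the cycle all have the same winding number.
[folklore] -/
theorem wnd_rightFace_pdarts_eq (hl : ∀ d ∈ cdarts l, hvGraph.Adj d.1 d.2) :
    ∀ (Q : List HV), Q.IsChain hvGraph.Adj → (∀ q ∈ Q.tail.dropLast, q ∉ l) →
      ∀ d ∈ pdarts Q, ∀ d' ∈ pdarts Q, wnd l (rightFace d.1 d.2) = wnd l (rightFace d'.1 d'.2)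
  | [], _, _ => by simp
  | [_], _, _ => by simp
  | [a, b], _, _ => by simp
  | a :: b :: c :: Q, hc, hq => by
    have hb : b ∉ l := hq b (by simp [List.dropLast_cons_of_ne_nil])
    have hab : hvGraph.Adj a b := (List.isChain_cons_cons.1 hc).1
    have hc' : (b :: c :: Q).IsChain hvGraph.Adj := (List.isChain_cons_cons.1 hc).2
    have hbc : hvGraph.Adj b c := (List.isChain_cons_cons.1 hc').1
    have ih := wnd_rightFace_pdarts_eq hl (b :: c :: Q) hc' fun q hmem => hq q (by
      simp only [List.tail_cons] at hmem ⊢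
      rw [List.dropLast_cons_of_ne_nil (List.cons_ne_nil _ _)]
      exact List.mem_cons_of_mem _ hmem)
    -- the first two darts share the vertex `b ∉ l`
    have key : wnd l (rightFace a b) = wnd l (rightFace b c) := by
      rw [show rightFace a b = leftFace b a from rfl]
      exact wnd_faces_at_eq hl hb hab.symm hbc
    have hbc_mem : (b, c) ∈ pdarts (b :: c :: Q) := by simp
    intro d hd d' hd'
    rw [pdarts_cons_cons, List.mem_cons] at hd hd'
    rcases hd with rfl | hd <;> rcases hd' with rfl | hd'
    · rfl
    · rw [key]; exact ih _ hbc_mem _ hd'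
    · rw [key]; exact ih _ hd _ hbc_mem
    · exact ih _ hd _ hd'

end Orient

/-! ### The support of the winding number; the total twist; the top face -/

section Support

variable {l : List HV}

/-- Lower bound of the first coordinates. [folklore] -/
def lo1 (l : List HV) : ℤ := (l.map fun w => w.1).foldr min 0
/-- Upper bound of the first coordinates. [folklore] -/
def hi1 (l : List HV) : ℤ := (l.map fun w => w.1).foldr max 0
/-- Lower bound of the second coordinates. [folklore] -/
def lo2 (l : List HV) : ℤ := (l.map fun w => w.2.1).foldr min 0
/-- Upper bound of the second coordinates. [folklore] -/
def hi2 (l : List HV) : ℤ := (l.map fun w => w.2.1).foldr max 0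

/-- `foldr min` is a lower bound. [folklore] -/
theorem foldr_min_le {L : List ℤ} {z : ℤ} (hz : z ∈ L) (a : ℤ) : L.foldr min a ≤ z := by
  induction L with
  | nil => simp at hz
  | cons b L ih =>
    rw [List.foldr_cons]
    rcases List.mem_cons.1 hz with rfl | hz
    · exact min_le_left _ _
    · exact (min_le_right _ _).trans (ih hz)

/-- `foldr max` is an upper bound. [folklore] -/
theorem le_foldr_max {L : List ℤ} {z : ℤ} (hz : z ∈ L) (a : ℤ) : z ≤ L.foldr max a := by
  induction L with
  | nil => simp at hz
  | cons b L ih =>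
    rw [List.foldr_cons]
    rcases List.mem_cons.1 hz with rfl | hz
    · exact le_max_left _ _
    · exact (ih hz).trans (le_max_right _ _)

/-- The coordinate bounds. [folklore] -/
theorem bounds_of_mem {w : HV} (hw : w ∈ l) : lo1 l ≤ w.1 ∧ w.1 ≤ hi1 l ∧ lo2 l ≤ w.2.1 ∧ w.2.1 ≤ hi2 l :=
  ⟨foldr_min_le (List.mem_map.2 ⟨w, hw, rfl⟩) 0, le_foldr_max (List.mem_map.2 ⟨w, hw, rfl⟩) 0,
    foldr_min_le (List.mem_map.2 ⟨w, hw, rfl⟩) 0, le_foldr_max (List.mem_map.2 ⟨w, hw, rfl⟩) 0⟩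

/-- A finite box of faces containing the support of the winding number. [folklore] -/
def wbox (l : List HV) : Finset (ℤ × ℤ) := Finset.Icc (lo1 l) (hi1 l) ×ˢ Finset.Icc (lo2 l) (hi2 l)

/-- The winding number vanishes outside the box. [folklore] -/
theorem mem_wbox_of_wnd_ne_zero (hl : ∀ d ∈ cdarts l, hvGraph.Adj d.1 d.2) {F : ℤ × ℤ}
    (hF : wnd l F ≠ 0) : F ∈ wbox l := by
  rw [wbox, Finset.mem_product, Finset.mem_Icc, Finset.mem_Icc]
  by_contra hcon
  apply hF
  have : F.1 < lo1 l ∨ hi1 l < F.1 ∨ F.2 < lo2 l ∨ hi2 l < F.2 := by omega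
  rcases this with h1 | h1 | h1 | h1
  · exact wnd_eq_zero_of_fst_ne fun w hw => by have := (bounds_of_mem hw).1; omega
  · exact wnd_eq_zero_of_fst_ne fun w hw => by have := (bounds_of_mem hw).2.1; omega
  · exact wnd_eq_zero_of_le fun w hw => by have := (bounds_of_mem hw).2.2.1; omega
  · exact wnd_eq_zero_of_snd_gt hl fun w hw => by have := (bounds_of_mem hw).2.2.2; omega

/-- **The total twist** `Σ_F |w(F)|` of a cyclic list (a finite sum over its box). [folklore] -/
def twist (l : List HV) : ℕ := ∑ F ∈ wbox l, (wnd l F).natAbs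

/-- The total twist may be computed over any finite set containing the support. [folklore] -/
theorem twist_eq_sum (hl : ∀ d ∈ cdarts l, hvGraph.Adj d.1 d.2) (B : Finset (ℤ × ℤ))
    (hB : ∀ F, wnd l F ≠ 0 → F ∈ B) : twist l = ∑ F ∈ B, (wnd l F).natAbs := by
  rw [twist]
  have h1 : ∑ F ∈ wbox l, (wnd l F).natAbs = ∑ F ∈ wbox l ∪ B, (wnd l F).natAbs :=
    Finset.sum_subset Finset.subset_union_left fun F _ hF => by
      rw [Int.natAbs_eq_zero]; by_contra h; exact hF (mem_wbox_of_wnd_ne_zero hl h)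
  have h2 : ∑ F ∈ B, (wnd l F).natAbs = ∑ F ∈ wbox l ∪ B, (wnd l F).natAbs :=
    Finset.sum_subset Finset.subset_union_right fun F _ hF => by
      rw [Int.natAbs_eq_zero]; by_contra h; exact hF (hB F h)
  rw [h1, h2]

/-- **The top face**: a face of nonzero winding number, maximal for the lexicographic order
`(y₁, y₀)`; it exists for every simple cycle. [folklore] -/
theorem exists_top (hc : IsCyc l) :
    ∃ h : ℤ × ℤ, wnd l h ≠ 0 ∧ ∀ F, wnd l F ≠ 0 → toLex (F.2, F.1) ≤ toLex (h.2, h.1) := by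
  classical
  set S := (wbox l).filter fun F => wnd l F ≠ 0 with hS
  have hne : S.Nonempty := by
    have hl3 := hc.1
    obtain ⟨a, L, hal⟩ : ∃ a L, l = a :: L := by
      match l, hl3 with
      | a :: L, _ => exact ⟨a, L, rfl⟩
    obtain ⟨v, hv⟩ := exists_cdarts_fst (l := l) (u := a) (by rw [hal]; simp)
    have h1 := wnd_left_sub_right hc.2.2 (u := a) (v := v) (hc.2.2 _ hv)
    rw [hc.flux_eq_one hv] at h1
    by_cases h0 : wnd l (rightFace a v) = 0
    · refine ⟨leftFace a v, Finset.mem_filter.2 ⟨mem_wbox_of_wnd_ne_zero hc.2.2 ?_, ?_⟩⟩ <;> omega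
    · exact ⟨rightFace a v, Finset.mem_filter.2 ⟨mem_wbox_of_wnd_ne_zero hc.2.2 h0, h0⟩⟩
  obtain ⟨h, hmem, hmax⟩ := S.exists_max_image (fun F => toLex (F.2, F.1)) hne
  refine ⟨h, (Finset.mem_filter.1 hmem).2, fun F hF => hmax F ?_⟩
  exact Finset.mem_filter.2 ⟨mem_wbox_of_wnd_ne_zero hc.2.2 hF, hF⟩

/-- The three upper neighbours of the top face have winding number `0`. [folklore] -/
theorem wnd_hexN_top_eq_zero {h : ℤ × ℤ}
    (htop : ∀ F, wnd l F ≠ 0 → toLex (F.2, F.1) ≤ toLex (h.2, h.1)) {k : Fin 6} (hk : k.val < 3) :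
    wnd l (hexN h k) = 0 := by
  by_contra hne
  have := htop _ hne
  rw [Prod.Lex.le_iff] at this
  have hk' : k = 0 ∨ k = 1 ∨ k = 2 := by
    rcases k with ⟨k, hk6⟩
    interval_cases k <;> simp
  obtain ⟨h1, h2⟩ := h
  rcases hk' with rfl | rfl | rfl <;> simp [hexN] at this

/-- **The winding number of the top face is `±1`**, and accordingly the three upper boundary darts
of its hexagon occur in the cycle, counterclockwise (`+1`) or clockwise (`-1`). [folklore] -/
theorem top_cases (hc : IsCyc l) {h : ℤ × ℤ} (h0 : wnd l h ≠ 0)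
    (htop : ∀ F, wnd l F ≠ 0 → toLex (F.2, F.1) ≤ toLex (h.2, h.1)) :
    (wnd l h = 1 ∧ ∀ k : Fin 6, k.val < 3 → (hexV h k, hexV h (k + 1)) ∈ cdarts l) ∨
    (wnd l h = -1 ∧ ∀ k : Fin 6, k.val < 3 → (hexV h (k + 1), hexV h k) ∈ cdarts l) := by
  have key : ∀ k : Fin 6, k.val < 3 → wnd l h =
      (if (hexV h k, hexV h (k + 1)) ∈ cdarts l then 1 else 0) -
        (if (hexV h (k + 1), hexV h k) ∈ cdarts l then 1 else 0) := by
    intro k hk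
    have h1 := wnd_left_sub_right hc.2.2 (adj_hexV_succ h k)
    rw [leftFace_hexV, rightFace_hexV, wnd_hexN_top_eq_zero htop hk, sub_zero, hc.flux_eq] at h1
    exact h1
  have k0 := key 0 (by decide)
  rcases Int.lt_or_gt_of_ne h0 with hneg | hpos
  · right
    have hm1 : wnd l h = -1 := by
      by_cases hA : (hexV h 0, hexV h (0 + 1)) ∈ cdarts l <;>
        by_cases hB : (hexV h (0 + 1), hexV h 0) ∈ cdarts l <;>
          simp only [hA, hB, if_true, if_false] at k0 <;> omega
    refine ⟨hm1, fun k hk => ?_⟩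
    have := key k hk
    rw [hm1] at this
    by_contra hn
    rw [if_neg hn] at this
    split_ifs at this <;> omega
  · left
    have hp1 : wnd l h = 1 := by
      by_cases hA : (hexV h 0, hexV h (0 + 1)) ∈ cdarts l <;>
        by_cases hB : (hexV h (0 + 1), hexV h 0) ∈ cdarts l <;>
          simp only [hA, hB, if_true, if_false] at k0 <;> omega
    refine ⟨hp1, fun k hk => ?_⟩
    have := key k hk
    rw [hp1] at this
    by_contra hn
    rw [if_neg hn] at this
    split_ifs at this <;> omega

end Support

/-! ### Arcs of a hexagon inside a cycle -/

section Arcs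

variable {l : List HV}

/-- Reduction of a natural number modulo `6`, as an element of `Fin 6`. [folklore] -/
def fin6 (m : ℕ) : Fin 6 := ⟨m % 6, Nat.mod_lt _ (by decide)⟩

/-- `fin6` is additive by one. [folklore] -/
theorem fin6_succ (m : ℕ) : fin6 (m + 1) = fin6 m + 1 := by
  ext; simp [fin6, Fin.val_add, Nat.add_mod]

/-- `fin6 0 = 0`. [folklore] -/
@[simp] theorem fin6_zero : fin6 0 = 0 := rfl

/-- The counterclockwise arc `hexV h j, hexV h (j+1), …, hexV h (j+m)` of the hexagon `h`.
[folklore] -/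
def arcL (h : ℤ × ℤ) : Fin 6 → ℕ → List HV
  | j, 0 => [hexV h j]
  | j, m + 1 => hexV h j :: arcL h (j + 1) m

/-- The clockwise arc `hexV h j, hexV h (j-1), …, hexV h (j-n)` of the hexagon `h`. [folklore] -/
def compL (h : ℤ × ℤ) : Fin 6 → ℕ → List HV
  | j, 0 => [hexV h j]
  | j, n + 1 => hexV h j :: compL h (j - 1) n

/-- `arcL` unfolds. [folklore] -/
@[simp] theorem arcL_zero (h : ℤ × ℤ) (j : Fin 6) : arcL h j 0 = [hexV h j] := rfl
/-- `arcL` unfolds. [folklore] -/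
@[simp] theorem arcL_succ (h : ℤ × ℤ) (j : Fin 6) (m : ℕ) : arcL h j (m + 1) = hexV h j :: arcL h (j + 1) m := rfl
/-- `compL` unfolds. [folklore] -/
@[simp] theorem compL_zero (h : ℤ × ℤ) (j : Fin 6) : compL h j 0 = [hexV h j] := rfl
/-- `compL` unfolds. [folklore] -/
@[simp] theorem compL_succ (h : ℤ × ℤ) (j : Fin 6) (n : ℕ) : compL h j (n + 1) = hexV h j :: compL h (j - 1) n := rfl

/-- Arcs translate. [folklore] -/
theorem arcL_eq_map (h : ℤ × ℤ) (j : Fin 6) (m : ℕ) : arcL h j m = (arcL (0, 0) j m).map (tr h) := by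
  induction m generalizing j with
  | zero => simp [hexV_eq_tr h]
  | succ m ih => simp [ih, hexV_eq_tr h j]

/-- Arcs translate. [folklore] -/
theorem compL_eq_map (h : ℤ × ℤ) (j : Fin 6) (n : ℕ) : compL h j n = (compL (0, 0) j n).map (tr h) := by
  induction n generalizing j with
  | zero => simp [hexV_eq_tr h]
  | succ n ih => simp [ih, hexV_eq_tr h j]

/-- Length of an arc. [folklore] -/
@[simp] theorem length_arcL (h : ℤ × ℤ) (j : Fin 6) (m : ℕ) : (arcL h j m).length = m + 1 := by
  induction m generalizing j with
  | zero => rfl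
  | succ m ih => simp [ih]

/-- Length of an arc. [folklore] -/
@[simp] theorem length_compL (h : ℤ × ℤ) (j : Fin 6) (n : ℕ) : (compL h j n).length = n + 1 := by
  induction n generalizing j with
  | zero => rfl
  | succ n ih => simp [ih]

/-- Arcs are nonempty. [folklore] -/
theorem arcL_ne_nil (h : ℤ × ℤ) (j : Fin 6) (m : ℕ) : arcL h j m ≠ [] := by cases m <;> simp

/-- Arcs are nonempty. [folklore] -/
theorem compL_ne_nil (h : ℤ × ℤ) (j : Fin 6) (n : ℕ) : compL h j n ≠ [] := by cases n <;> simp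

/-- The first vertex of an arc. [folklore] -/
@[simp] theorem head_arcL (h : ℤ × ℤ) (j : Fin 6) (m : ℕ) : (arcL h j m).head (arcL_ne_nil h j m) = hexV h j := by
  cases m <;> rfl

/-- The first vertex of an arc. [folklore] -/
@[simp] theorem head_compL (h : ℤ × ℤ) (j : Fin 6) (n : ℕ) : (compL h j n).head (compL_ne_nil h j n) = hexV h j := by
  cases n <;> rfl

/-- The last vertex of an arc. [folklore] -/
@[simp] theorem getLast_arcL (h : ℤ × ℤ) (j : Fin 6) (m : ℕ) :
    (arcL h j m).getLast (arcL_ne_nil h j m) = hexV h (j + fin6 m) := by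
  induction m generalizing j with
  | zero => simp
  | succ m ih =>
    simp only [arcL_succ, List.getLast_cons (arcL_ne_nil _ _ _), ih]
    congr 1; rw [fin6_succ]; abel

/-- The last vertex of an arc. [folklore] -/
@[simp] theorem getLast_compL (h : ℤ × ℤ) (j : Fin 6) (n : ℕ) :
    (compL h j n).getLast (compL_ne_nil h j n) = hexV h (j - fin6 n) := by
  induction n generalizing j with
  | zero => simp
  | succ n ih =>
    simp only [compL_succ, List.getLast_cons (compL_ne_nil _ _ _), ih]
    congr 1; rw [fin6_succ]; abel

/-- Path darts translate. [folklore] -/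
theorem pdarts_map_tr (t : ℤ × ℤ) : ∀ (P : List HV),
    pdarts (P.map (tr t)) = (pdarts P).map fun d => (tr t d.1, tr t d.2)
  | [] => rfl
  | [_] => rfl
  | a :: b :: L => by
    rw [List.map_cons, List.map_cons, pdarts_cons_cons, pdarts_cons_cons, List.map_cons,
      ← List.map_cons, pdarts_map_tr t (b :: L)]

/-- **An arc and the reversed complementary arc make up the hexagon boundary** (as dart
multisets), for arcs of `3`, `4`, `5` edges. [folklore] -/
theorem pdarts_arcL_compL_perm (h : ℤ × ℤ) (j : Fin 6) {m n : ℕ} (hmn : (m, n) ∈ [(3, 3), (4, 2), (5, 1)]) :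
    (pdarts (arcL h j m) ++ (pdarts (compL h j n)).map Prod.swap).Perm (hexDarts h) := by
  have key : ∀ j : Fin 6, ∀ mn ∈ [((3 : ℕ), (3 : ℕ)), (4, 2), (5, 1)],
      (pdarts (arcL (0, 0) j mn.1) ++ (pdarts (compL (0, 0) j mn.2)).map Prod.swap).Perm
        (hexDarts (0, 0)) := by decide
  have := (key j (m, n) hmn).map fun d => (tr h d.1, tr h d.2)
  dsimp only at this
  simp only [List.map_append, List.map_map] at this
  have e1 : (pdarts (arcL (0, 0) j m)).map (fun d => (tr h d.1, tr h d.2)) = pdarts (arcL h j m) := by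
    conv_rhs => rw [arcL_eq_map h j m, pdarts_map_tr]
  have e2 : (pdarts (compL (0, 0) j n)).map ((fun d : HV × HV => (tr h d.1, tr h d.2)) ∘ Prod.swap) =
      (pdarts (compL h j n)).map Prod.swap := by
    conv_rhs => rw [compL_eq_map h j n, pdarts_map_tr, List.map_map]
    rfl
  have e3 : (hexDarts (0, 0)).map (fun d => (tr h d.1, tr h d.2)) = hexDarts h := by
    simp [hexDarts, hexV_eq_tr h]
  rw [e1, e2, e3] at this
  exact this

/-- The winding numbers of an arc and of the complementary clockwise arc differ by the indicator
of the hexagon. [folklore] -/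
theorem dwnd_arcL_sub_compL (h : ℤ × ℤ) (j : Fin 6) {m n : ℕ} (hmn : (m, n) ∈ [(3, 3), (4, 2), (5, 1)])
    (F : ℤ × ℤ) : dwnd (pdarts (arcL h j m)) F - dwnd (pdarts (compL h j n)) F = if F = h then 1 else 0 := by
  rw [← dwnd_hexDarts, ← dwnd_perm (pdarts_arcL_compL_perm h j hmn), dwnd_append, dwnd_map_swap]
  ring

/-- The clockwise arc is a chain of adjacent, distinct hexagon vertices. [folklore] -/
theorem compL_nodup_isChain (h : ℤ × ℤ) (j : Fin 6) {n : ℕ} (hn : n ≤ 5) :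
    (compL h j n).Nodup ∧ (compL h j n).IsChain hvGraph.Adj := by
  have key : ∀ j : Fin 6, ∀ n ∈ [0, 1, 2, 3, 4, 5],
      (compL (0, 0) j n).Nodup ∧ (compL (0, 0) j n).IsChain hvGraph.Adj := by decide
  obtain ⟨h1, h2⟩ := key j n (by interval_cases n <;> simp)
  rw [compL_eq_map]
  exact ⟨h1.map (tr_injective h), (List.isChain_map _).2 (h2.imp fun a b hab => (adj_tr_iff h a b).2 hab)⟩

/-- Entries of the clockwise arc are hexagon vertices. [folklore] -/
theorem mem_compL_iff (h : ℤ × ℤ) (j : Fin 6) {n : ℕ} (hn : n ≤ 5) (v : HV) :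
    v ∈ compL h j n ↔ ∃ i : Fin 6, i.val ≤ n ∧ v = hexV h (j - i) := by
  have key : ∀ j : Fin 6, ∀ n ∈ [0, 1, 2, 3, 4, 5], ∀ i : Fin 6,
      (hexV (0, 0) (j - i) ∈ compL (0, 0) j n ↔ i.val ≤ n) := by decide
  constructor
  · intro hv
    have hv' : v ∈ (compL (0, 0) j n).map (tr h) := by rwa [← compL_eq_map]
    rw [List.mem_map] at hv'
    obtain ⟨v0, hv0, rfl⟩ := hv'
    -- every entry of `compL 0 j n` is some `hexV 0 (j - i)` with `i ≤ n`
    have key2 : ∀ j : Fin 6, ∀ n ∈ [0, 1, 2, 3, 4, 5], ∀ v0 ∈ compL (0, 0) j n,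
        ∃ i : Fin 6, i.val ≤ n ∧ v0 = hexV (0, 0) (j - i) := by decide
    obtain ⟨i, hi, rfl⟩ := key2 j n (by interval_cases n <;> simp) v0 hv0
    exact ⟨i, hi, by rw [hexV_eq_tr h]⟩
  · rintro ⟨i, hi, rfl⟩
    rw [compL_eq_map, hexV_eq_tr h, List.mem_map]
    exact ⟨_, (key j n (by interval_cases n <;> simp) i).2 hi, rfl⟩

/-- Entries of the counterclockwise arc are hexagon vertices. [folklore] -/
theorem mem_arcL_iff (h : ℤ × ℤ) (j : Fin 6) {m : ℕ} (hm : m ≤ 5) (v : HV) :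
    v ∈ arcL h j m ↔ ∃ i : Fin 6, i.val ≤ m ∧ v = hexV h (j + i) := by
  have key : ∀ j : Fin 6, ∀ m ∈ [0, 1, 2, 3, 4, 5], ∀ i : Fin 6,
      (hexV (0, 0) (j + i) ∈ arcL (0, 0) j m ↔ i.val ≤ m) := by decide
  constructor
  · intro hv
    have hv' : v ∈ (arcL (0, 0) j m).map (tr h) := by rwa [← arcL_eq_map]
    rw [List.mem_map] at hv'
    obtain ⟨v0, hv0, rfl⟩ := hv'
    have key2 : ∀ j : Fin 6, ∀ m ∈ [0, 1, 2, 3, 4, 5], ∀ v0 ∈ arcL (0, 0) j m,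
        ∃ i : Fin 6, i.val ≤ m ∧ v0 = hexV (0, 0) (j + i) := by decide
    obtain ⟨i, hi, rfl⟩ := key2 j m (by interval_cases m <;> simp) v0 hv0
    exact ⟨i, hi, by rw [hexV_eq_tr h]⟩
  · rintro ⟨i, hi, rfl⟩
    rw [arcL_eq_map, hexV_eq_tr h, List.mem_map]
    exact ⟨_, (key j m (by interval_cases m <;> simp) i).2 hi, rfl⟩

/-- **The turning number is unchanged when an arc is replaced by the complementary clockwise
arc** (the outer neighbours at the two ends being the exterior vertices). [folklore] -/
theorem pturn_arcL_eq_compL (h : ℤ × ℤ) (j : Fin 6) {m n : ℕ} (hmn : (m, n) ∈ [(3, 3), (4, 2), (5, 1)]) :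
    pturn (hexExt h j :: arcL h j m ++ [hexExt h (j + fin6 m)]) =
      pturn (hexExt h j :: compL h j n ++ [hexExt h (j + fin6 m)]) := by
  have key : ∀ j : Fin 6, ∀ mn ∈ [((3 : ℕ), (3 : ℕ)), (4, 2), (5, 1)],
      pturn (hexExt (0, 0) j :: arcL (0, 0) j mn.1 ++ [hexExt (0, 0) (j + fin6 mn.1)]) =
        pturn (hexExt (0, 0) j :: compL (0, 0) j mn.2 ++ [hexExt (0, 0) (j + fin6 mn.1)]) := by decide
  have := key j (m, n) hmn
  dsimp only at this
  rw [← pturn_map_tr h, ← pturn_map_tr h (hexExt (0, 0) j :: compL (0, 0) j n ++ _)] at this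
  simpa [← arcL_eq_map, ← compL_eq_map, ← hexExt_eq_tr] using this

/-- Path darts of a concatenation. [folklore] -/
theorem pdarts_append (A M : List HV) (hA : A ≠ []) (hM : M ≠ []) :
    pdarts (A ++ M) = pdarts A ++ (A.getLast hA, M.head hM) :: pdarts M := by
  obtain ⟨m0, M', rfl⟩ := List.exists_cons_of_ne_nil hM
  induction A with
  | nil => exact absurd rfl hA
  | cons a L ih =>
    rcases eq_or_ne L [] with rfl | hL
    · simp
    · obtain ⟨b, L', rfl⟩ := List.exists_cons_of_ne_nil hL
      simp only [List.cons_append, pdarts_cons_cons, List.getLast_cons (List.cons_ne_nil _ _),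
        List.head_cons] at ih ⊢
      rw [ih (List.cons_ne_nil _ _)]

/-- Cyclic darts of a concatenation: the path darts of both pieces and the two junction darts.
[folklore] -/
theorem cdarts_append (A M : List HV) (hA : A ≠ []) (hM : M ≠ []) :
    cdarts (A ++ M) = pdarts A ++ (A.getLast hA, M.head hM) :: pdarts M ++ [(M.getLast hM, A.head hA)] := by
  rw [cdarts_eq (by simp [hA]), pdarts_append A M hA hM, List.getLast_append_of_ne_nil _ hM,
    List.head_append_of_ne_nil]

/-- Rotating `A ++ M` to bring the last vertex of `M` to the front. [folklore] -/
theorem rotate_to_front (A M : List HV) (hM : M ≠ []) :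
    (A ++ M).rotate ((A ++ M).length - 1) = M.getLast hM :: (A ++ M.dropLast) := by
  conv_lhs => rw [← List.dropLast_append_getLast hM, ← List.append_assoc]
  rw [show (A ++ M.dropLast ++ [M.getLast hM]).length - 1 = (A ++ M.dropLast).length by simp,
    List.rotate_append_length_eq]
  rfl

/-- `pdarts` of a cons onto a nonempty list. [folklore] -/
theorem pdarts_cons_of_ne_nil (a : HV) {B : List HV} (hB : B ≠ []) :
    pdarts (a :: B) = (a, B.head hB) :: pdarts B := by
  obtain ⟨b, B', rfl⟩ := List.exists_cons_of_ne_nil hB; rfl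

/-- The darts of a longer arc: the first edge, then the darts of the shifted arc. [folklore] -/
theorem pdarts_arcL_succ (h : ℤ × ℤ) (j : Fin 6) (m : ℕ) :
    pdarts (arcL h j (m + 1)) = (hexV h j, hexV h (j + 1)) :: pdarts (arcL h (j + 1) m) := by
  rw [arcL_succ, pdarts_cons_of_ne_nil _ (arcL_ne_nil _ _ _), head_arcL]

/-- `fin6 m + 1 ≠ 0` for `1 ≤ m ≤ 4`. [folklore] -/
theorem fin6_add_one_ne_zero {m : ℕ} (h1 : 1 ≤ m) (h4 : m ≤ 4) (j : Fin 6) : j + 1 + fin6 m ≠ j := by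
  interval_cases m <;> revert j <;> decide

/-- **Normal form**: if the darts of the arc `hexV h j → ⋯ → hexV h (j+m)` (`1 ≤ m ≤ 5`) all occur in
the simple cycle `l`, then some rotation of `l` starts with that arc. [folklore] -/
theorem exists_rotate_eq_arcL (hc : IsCyc l) (h : ℤ × ℤ) :
    ∀ (m : ℕ) (j : Fin 6), 1 ≤ m → m ≤ 5 → (∀ d ∈ pdarts (arcL h j m), d ∈ cdarts l) →
      ∃ (k : ℕ) (M : List HV), l.rotate k = arcL h j m ++ M
  | 0, _, h1, _, _ => absurd h1 (by decide)
  | 1, j, _, _, hd => by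
    have hmem : (hexV h j, hexV h (j + 1)) ∈ cdarts l := hd _ (by simp)
    obtain ⟨k, M, hk⟩ := exists_rotate_eq_cons_cons hc.1 hmem
    exact ⟨k, M, by rw [hk]; simp⟩
  | m + 2, j, _, hm5, hd => by
    rw [pdarts_arcL_succ] at hd
    obtain ⟨k, M, hk⟩ := exists_rotate_eq_arcL hc h (m + 1) (j + 1) (by omega) (by omega)
      fun d hd' => hd d (List.mem_cons_of_mem _ hd')
    have hfirst : (hexV h j, hexV h (j + 1)) ∈ cdarts (l.rotate k) :=
      (cdarts_rotate_perm l k).mem_iff.2 (hd _ (by simp))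
    have hc' := hc.rotate k
    set L' := l.rotate k with hL'
    have hL'ne : L' ≠ [] := by rw [hk]; simp
    -- the closing dart of `L'` enters its head `hexV h (j+1)`, hence starts at `hexV h j`
    have hclose : (L'.getLast hL'ne, L'.head hL'ne) ∈ cdarts L' := by
      rw [cdarts_eq hL'ne]; simp
    have hhead : L'.head hL'ne = hexV h (j + 1) := by
      simp only [hk, List.head_append_of_ne_nil (arcL_ne_nil _ _ _), head_arcL]
    rw [hhead] at hclose
    have hlast : L'.getLast hL'ne = hexV h j := cdarts_pred_unique hc'.2.1 hclose hfirst
    -- `M` is nonempty: otherwise the last vertex of the arc would be `hexV h j`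
    have hMne : M ≠ [] := by
      rintro rfl
      have : L'.getLast hL'ne = hexV h (j + 1 + fin6 (m + 1)) := by
        simp only [hk, List.append_nil, getLast_arcL]
      rw [hlast] at this
      exact fin6_add_one_ne_zero (by omega) (by omega) j ((hexV_injective h) this).symm
    have hMlast : M.getLast hMne = hexV h j := by
      rw [← hlast]; simp only [hk, List.getLast_append_of_ne_nil _ hMne]
    refine ⟨k + (L'.length - 1), M.dropLast, ?_⟩
    rw [← List.rotate_rotate, ← hL', hk, rotate_to_front _ _ hMne, hMlast]
    simp

/-- Darts of a counterclockwise arc are counterclockwise boundary darts. [folklore] -/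
theorem mem_pdarts_arcL {h : ℤ × ℤ} {j : Fin 6} {m : ℕ} (hm : m ≤ 5) {d : HV × HV}
    (hd : d ∈ pdarts (arcL h j m)) : ∃ k : Fin 6, d = (hexV h k, hexV h (k + 1)) := by
  have key : ∀ j : Fin 6, ∀ m ∈ [0, 1, 2, 3, 4, 5], ∀ d ∈ pdarts (arcL (0, 0) j m),
      ∃ k : Fin 6, d = (hexV (0, 0) k, hexV (0, 0) (k + 1)) := by decide
  rw [arcL_eq_map, pdarts_map_tr, List.mem_map] at hd
  obtain ⟨d0, hd0, rfl⟩ := hd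
  obtain ⟨k, rfl⟩ := key j m (by interval_cases m <;> simp) d0 hd0
  exact ⟨k, by simp [hexV_eq_tr h]⟩

/-- Darts of a clockwise arc are clockwise boundary darts. [folklore] -/
theorem mem_pdarts_compL {h : ℤ × ℤ} {j : Fin 6} {n : ℕ} (hn : n ≤ 5) {d : HV × HV}
    (hd : d ∈ pdarts (compL h j n)) : ∃ k : Fin 6, d = (hexV h (k + 1), hexV h k) := by
  have key : ∀ j : Fin 6, ∀ n ∈ [0, 1, 2, 3, 4, 5], ∀ d ∈ pdarts (compL (0, 0) j n),
      ∃ k : Fin 6, d = (hexV (0, 0) (k + 1), hexV (0, 0) k) := by decide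
  rw [compL_eq_map, pdarts_map_tr, List.mem_map] at hd
  obtain ⟨d0, hd0, rfl⟩ := hd
  obtain ⟨k, rfl⟩ := key j n (by interval_cases n <;> simp) d0 hd0
  exact ⟨k, by simp [hexV_eq_tr h]⟩

/-- The first dart of a clockwise arc. [folklore] -/
theorem first_mem_pdarts_compL (h : ℤ × ℤ) (j : Fin 6) {n : ℕ} (hn : 1 ≤ n) :
    (hexV h j, hexV h (j - 1)) ∈ pdarts (compL h j n) := by
  obtain ⟨n, rfl⟩ : ∃ n', n = n' + 1 := ⟨n - 1, by omega⟩
  rw [compL_succ, pdarts_cons_of_ne_nil _ (compL_ne_nil _ _ _), head_compL]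
  exact List.mem_cons_self

/-- The first dart of a counterclockwise arc. [folklore] -/
theorem first_mem_pdarts_arcL (h : ℤ × ℤ) (j : Fin 6) {m : ℕ} (hm : 1 ≤ m) :
    (hexV h j, hexV h (j + 1)) ∈ pdarts (arcL h j m) := by
  obtain ⟨m, rfl⟩ : ∃ m', m = m' + 1 := ⟨m - 1, by omega⟩
  rw [pdarts_arcL_succ]; exact List.mem_cons_self

/-- Facts about the arc pairs `(m, n) = (3,3), (4,2), (5,1)` decided at once: the last darts, the
end vertex of the clockwise arc, and the coverage of all six indices. [folklore] -/
theorem arc_pair_facts (h : ℤ × ℤ) (j : Fin 6) {m n : ℕ} (hmn : (m, n) ∈ [(3, 3), (4, 2), (5, 1)]) :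
    (hexV h (j + fin6 m - 1), hexV h (j + fin6 m)) ∈ pdarts (arcL h j m) ∧
    (hexV h (j + fin6 m + 1), hexV h (j + fin6 m)) ∈ pdarts (compL h j n) ∧
    j - fin6 n = j + fin6 m ∧ 1 ≤ m ∧ m ≤ 5 ∧ 1 ≤ n ∧ n ≤ 5 ∧
    (∀ k : Fin 6, (∃ i : Fin 6, i.val ≤ m ∧ k = j + i) ∨ (∃ i : Fin 6, 0 < i.val ∧ i.val < n ∧ k = j - i)) := by
  have key : ∀ j : Fin 6, ∀ mn ∈ [((3 : ℕ), (3 : ℕ)), (4, 2), (5, 1)],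
      (hexV (0, 0) (j + fin6 mn.1 - 1), hexV (0, 0) (j + fin6 mn.1)) ∈ pdarts (arcL (0, 0) j mn.1) ∧
      (hexV (0, 0) (j + fin6 mn.1 + 1), hexV (0, 0) (j + fin6 mn.1)) ∈ pdarts (compL (0, 0) j mn.2) ∧
      j - fin6 mn.2 = j + fin6 mn.1 ∧ 1 ≤ mn.1 ∧ mn.1 ≤ 5 ∧ 1 ≤ mn.2 ∧ mn.2 ≤ 5 ∧
      (∀ k : Fin 6, (∃ i : Fin 6, i.val ≤ mn.1 ∧ k = j + i) ∨
        (∃ i : Fin 6, 0 < i.val ∧ i.val < mn.2 ∧ k = j - i)) := by decide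
  obtain ⟨h1, h2, h3⟩ := key j (m, n) hmn
  dsimp only at h1 h2 h3
  refine ⟨?_, ?_, h3⟩
  · rw [arcL_eq_map, pdarts_map_tr, hexV_eq_tr h, hexV_eq_tr h (j + fin6 m)]
    exact List.mem_map.2 ⟨_, h1, rfl⟩
  · rw [compL_eq_map, pdarts_map_tr, hexV_eq_tr h, hexV_eq_tr h (j + fin6 m)]
    exact List.mem_map.2 ⟨_, h2, rfl⟩

/-- A neighbouring face is not the hexagon itself. [folklore] -/
theorem hexN_ne_self (h : ℤ × ℤ) (k : Fin 6) : hexN h k ≠ h := by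
  obtain ⟨h1, h2⟩ := h
  fin_cases k <;> simp [hexN]

end Arcs

/-! ### Replacing an arc of the top hexagon by the complementary arc -/

section ArcCase

variable {l : List HV} {h : ℤ × ℤ} {j : Fin 6} {m n : ℕ} {M : List HV}

/-- Data of the arc replacement: the simple cycle `l` starts with the counterclockwise arc of
`m` edges of the hexagon `h` from `hexV h j`, has winding number `1` around `h`, and uses no edge
of the complementary clockwise arc of `n = 6 - m` edges. [folklore] -/
structure ArcData (l : List HV) (h : ℤ × ℤ) (j : Fin 6) (m n : ℕ) (M : List HV) : Prop where
  /-- `l` is a simple cycle -/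
  cyc : IsCyc l
  /-- `(m, n)` is `(3,3)`, `(4,2)` or `(5,1)` -/
  hmn : (m, n) ∈ [(3, 3), (4, 2), (5, 1)]
  /-- `l` begins with the arc -/
  eq : l = arcL h j m ++ M
  /-- the hexagon has winding number one -/
  wh : wnd l h = 1
  /-- no complementary edge is used, in either direction -/
  comp : ∀ d ∈ pdarts (compL h j n), d ∉ cdarts l ∧ d.swap ∉ cdarts l

namespace ArcData

variable (A : ArcData l h j m n M)
include A

/-- The tail `M` is nonempty. [folklore] -/
theorem M_ne_nil : M ≠ [] := by
  intro hM
  have hl : l = arcL h j m := by rw [A.eq, hM, List.append_nil]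
  have hclose : (hexV h (j + fin6 m), hexV h j) ∈ cdarts l := by
    rw [hl, cdarts_eq (arcL_ne_nil _ _ _), getLast_arcL, head_arcL]; simp
  have hadj := A.cyc.2.2 _ hclose
  simp only at hadj
  rw [adj_hexV_iff] at hadj
  have hcomp := A.comp
  have hmn := A.hmn
  simp only [List.mem_cons, Prod.mk.injEq, List.not_mem_nil, or_false] at hmn
  have key1 : ∀ m ∈ [3, 4], ∀ j : Fin 6, j ≠ j + fin6 m + 1 := by decide
  have key2 : ∀ m ∈ [3, 4, 5], ∀ j : Fin 6, j ≠ j + fin6 m - 1 := by decide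
  rcases hadj with e | e | e
  · have e' := (hexV_injective h) e
    rcases hmn with ⟨rfl, rfl⟩ | ⟨rfl, rfl⟩ | ⟨rfl, rfl⟩
    · exact key1 3 (by simp) j e'
    · exact key1 4 (by simp) j e'
    · -- `m = 5`: the closing dart is the reverse of the unique complementary dart
      have hc1 := (hcomp _ (first_mem_pdarts_compL h j le_rfl)).2
      rw [Prod.swap_prod_mk] at hc1
      apply hc1
      have : ∀ j : Fin 6, j - 1 = j + fin6 5 := by decide
      rw [this]; exact hclose
  · have e' := (hexV_injective h) e
    rcases hmn with ⟨rfl, rfl⟩ | ⟨rfl, rfl⟩ | ⟨rfl, rfl⟩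
    · exact key2 3 (by simp) j e'
    · exact key2 4 (by simp) j e'
    · exact key2 5 (by simp) j e'
  · exact hexExt_ne_hexV h (j + fin6 m) j e.symm

/-- The vertex after the arc is the exterior neighbour of its last vertex. [folklore] -/
theorem head_M : M.head A.M_ne_nil = hexExt h (j + fin6 m) := by
  obtain ⟨hlastA, hlastC, hfin, hm1, hm5, hn1, hn5, -⟩ := arc_pair_facts h j A.hmn
  have hMne := A.M_ne_nil
  show M.head hMne = _
  have hj : (hexV h (j + fin6 m), M.head hMne) ∈ cdarts l := by
    rw [A.eq, cdarts_append _ _ (arcL_ne_nil _ _ _) hMne, getLast_arcL]; simp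
  have hadj := A.cyc.2.2 _ hj
  simp only at hadj
  rw [adj_hexV_iff] at hadj
  rcases hadj with e | e | e
  · -- `hexV (j+m+1)`: reverse of the last complementary dart
    exfalso
    have := (A.comp _ hlastC).2
    rw [Prod.swap_prod_mk, ← e] at this
    exact this hj
  · -- `hexV (j+m-1)`: reverse of the last arc dart
    exfalso
    have hin : (hexV h (j + fin6 m - 1), hexV h (j + fin6 m)) ∈ cdarts l := by
      rw [A.eq, cdarts_append _ _ (arcL_ne_nil _ _ _) hMne]; simp [hlastA]
    rw [← e] at hin
    exact A.cyc.not_mem_swap hin hj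
  · exact e

/-- The vertex before the arc is the exterior neighbour of its first vertex. [folklore] -/
theorem getLast_M : M.getLast A.M_ne_nil = hexExt h j := by
  obtain ⟨-, -, -, hm1, hm5, hn1, hn5, -⟩ := arc_pair_facts h j A.hmn
  have hMne := A.M_ne_nil
  show M.getLast hMne = _
  have hj : (M.getLast hMne, hexV h j) ∈ cdarts l := by
    rw [A.eq, cdarts_append _ _ (arcL_ne_nil _ _ _) hMne, head_arcL]; simp
  have hadj := (A.cyc.2.2 _ hj).symm
  simp only at hadj
  rw [adj_hexV_iff] at hadj
  rcases hadj with e | e | e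
  · exfalso
    have hin : (hexV h j, hexV h (j + 1)) ∈ cdarts l := by
      rw [A.eq, cdarts_append _ _ (arcL_ne_nil _ _ _) hMne]; simp [first_mem_pdarts_arcL h j hm1]
    rw [← e] at hin
    exact A.cyc.not_mem_swap hin hj
  · exfalso
    have := (A.comp _ (first_mem_pdarts_compL h j hn1)).2
    rw [Prod.swap_prod_mk, ← e] at this
    exact this hj
  · exact e

/-- Interior vertices of the complementary arc are not on the cycle. [folklore] -/
theorem interior_not_mem {i : Fin 6} (hi0 : 0 < i.val) (hin : i.val < n) : hexV h (j - i) ∉ l := by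
  obtain ⟨-, -, -, hm1, hm5, hn1, hn5, -⟩ := arc_pair_facts h j A.hmn
  intro hmem
  -- both neighbouring complementary darts, in both directions, are absent
  have hd1 : (hexV h (j - i + 1), hexV h (j - i)) ∈ pdarts (compL h j n) := by
    have key : ∀ j : Fin 6, ∀ n ∈ [0, 1, 2, 3, 4, 5], ∀ i : Fin 6, 0 < i.val → i.val < n →
        (hexV (0, 0) (j - i + 1), hexV (0, 0) (j - i)) ∈ pdarts (compL (0, 0) j n) := by decide
    rw [compL_eq_map, pdarts_map_tr, hexV_eq_tr h, hexV_eq_tr h (j - i)]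
    exact List.mem_map.2 ⟨_, key j n (by interval_cases n <;> simp) i hi0 hin, rfl⟩
  have hd2 : (hexV h (j - i), hexV h (j - i - 1)) ∈ pdarts (compL h j n) := by
    have key : ∀ j : Fin 6, ∀ n ∈ [0, 1, 2, 3, 4, 5], ∀ i : Fin 6, 0 < i.val → i.val < n →
        (hexV (0, 0) (j - i), hexV (0, 0) (j - i - 1)) ∈ pdarts (compL (0, 0) j n) := by decide
    rw [compL_eq_map, pdarts_map_tr, hexV_eq_tr h, hexV_eq_tr h (j - i - 1)]
    exact List.mem_map.2 ⟨_, key j n (by interval_cases n <;> simp) i hi0 hin, rfl⟩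
  obtain ⟨a1, a2⟩ := A.comp _ hd1
  obtain ⟨b1, b2⟩ := A.comp _ hd2
  rw [Prod.swap_prod_mk] at a2 b2
  obtain ⟨t, ht⟩ := exists_cdarts_fst hmem
  obtain ⟨s, hs⟩ := exists_cdarts_snd hmem
  have hta := A.cyc.2.2 _ ht
  have hsa := (A.cyc.2.2 _ hs).symm
  simp only at hta hsa
  rw [adj_hexV_iff] at hta hsa
  rcases hta with rfl | rfl | rfl
  · exact a2 ht
  · exact b1 ht
  · rcases hsa with rfl | rfl | rfl
    · exact a1 hs
    · exact b2 hs
    · exact A.cyc.not_mem_swap hs ht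

/-- The complementary cycle `compL h j n ++ M` is a simple cycle. [folklore] -/
theorem isCyc' : IsCyc (compL h j n ++ M) := by
  obtain ⟨-, -, hfin, hm1, hm5, hn1, hn5, hcover⟩ := arc_pair_facts h j A.hmn
  have hMne := A.M_ne_nil
  have hnd := A.cyc.2.1
  rw [A.eq] at hnd
  obtain ⟨hcnd, hcch⟩ := compL_nodup_isChain h j hn5
  refine ⟨by have := List.length_pos_iff.2 hMne; simp; omega, ?_, ?_⟩
  · -- nodup
    rw [List.nodup_append]
    refine ⟨hcnd, hnd.sublist (List.sublist_append_right _ _), fun v hv w hw hvw => ?_⟩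
    subst hvw
    rw [mem_compL_iff h j hn5] at hv
    obtain ⟨i, hi, rfl⟩ := hv
    rcases Nat.eq_zero_or_pos i.val with hi0 | hi0
    · have : i = 0 := Fin.ext hi0
      subst this
      rw [sub_zero] at hw
      have : hexV h j ∈ arcL h j m := by
        rw [mem_arcL_iff h j hm5]; exact ⟨0, by simp, by simp⟩
      exact (List.nodup_append.1 hnd).2.2 _ this _ hw rfl
    · rcases Nat.lt_or_ge i.val n with hin | hin
      · exact A.interior_not_mem hi0 hin (by rw [A.eq]; exact List.mem_append_right _ hw)
      · have : i = fin6 n := by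
          apply Fin.ext; simp only [fin6]; have := i.isLt; interval_cases n <;> omega
        subst this
        rw [hfin] at hw
        have : hexV h (j + fin6 m) ∈ arcL h j m := by
          rw [mem_arcL_iff h j hm5]; exact ⟨fin6 m, by simp [fin6]; interval_cases m <;> simp, rfl⟩
        exact (List.nodup_append.1 hnd).2.2 _ this _ hw rfl
  · -- adjacency
    intro d hd
    rw [cdarts_append _ _ (compL_ne_nil _ _ _) hMne, getLast_compL, hfin, head_compL] at hd
    simp only [List.mem_append, List.mem_cons, List.not_mem_nil, or_false] at hd
    rcases hd with (hd | rfl | hd) | rfl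
    · obtain ⟨i, hi, rfl⟩ := mem_pdarts_iff.1 hd
      exact hcch.getElem i hi
    · show hvGraph.Adj (hexV h (j + fin6 m)) (M.head hMne)
      rw [show M.head hMne = hexExt h (j + fin6 m) from A.head_M]; exact adj_hexV_hexExt h _
    · apply A.cyc.2.2
      rw [A.eq, cdarts_append _ _ (arcL_ne_nil _ _ _) hMne]
      simp [hd]
    · show hvGraph.Adj (M.getLast hMne) (hexV h j)
      rw [show M.getLast hMne = hexExt h j from A.getLast_M]; exact (adj_hexV_hexExt h j).symm

/-- Winding numbers of the complementary cycle: one less on the hexagon, unchanged elsewhere.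
[folklore] -/
theorem wnd' (F : ℤ × ℤ) : wnd (compL h j n ++ M) F = wnd l F - if F = h then 1 else 0 := by
  obtain ⟨-, -, hfin, -⟩ := arc_pair_facts h j A.hmn
  have hMne := A.M_ne_nil
  rw [wnd_eq_dwnd, wnd_eq_dwnd, A.eq, cdarts_append _ _ (compL_ne_nil _ _ _) hMne,
    cdarts_append _ _ (arcL_ne_nil _ _ _) hMne, getLast_compL, getLast_arcL, hfin, head_compL, head_arcL,
    ← dwnd_arcL_sub_compL h j A.hmn F]
  simp only [dwnd_append, dwnd_cons]
  ring

/-- The turning number is unchanged. [folklore] -/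
theorem cturn' : cturn (compL h j n ++ M) = cturn l := by
  obtain ⟨-, -, hfin, hm1, -, hn1, -⟩ := arc_pair_facts h j A.hmn
  have hMne := A.M_ne_nil
  rw [A.eq, cturn_split _ _ (by simp; omega) hMne, cturn_split _ _ (by simp; omega) hMne]
  simp only [getLast_compL, getLast_arcL, hfin, head_compL, head_arcL, A.head_M, A.getLast_M]
  rw [pturn_arcL_eq_compL h j A.hmn]

/-- Lengths: the complementary cycle is not longer. [folklore] -/
theorem length' : (compL h j n ++ M).length + (m - n) = l.length := by
  obtain ⟨-, -, -, hm1, hm5, hn1, hn5, -⟩ := arc_pair_facts h j A.hmn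
  have : n ≤ m := by
    have := A.hmn; simp only [List.mem_cons, Prod.mk.injEq, List.not_mem_nil, or_false] at this
    omega
  rw [A.eq]; simp; omega

/-- The total twist drops by one. [folklore] -/
theorem twist' : twist (compL h j n ++ M) + 1 = twist l := by
  classical
  have hl := A.cyc.2.2
  have hl' := A.isCyc'.2.2
  set B := wbox l ∪ wbox (compL h j n ++ M) ∪ {h} with hB
  have hBl : ∀ F, wnd l F ≠ 0 → F ∈ B := fun F hF =>
    Finset.mem_union_left _ (Finset.mem_union_left _ (mem_wbox_of_wnd_ne_zero hl hF))
  have hBl' : ∀ F, wnd (compL h j n ++ M) F ≠ 0 → F ∈ B := fun F hF =>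
    Finset.mem_union_left _ (Finset.mem_union_right _ (mem_wbox_of_wnd_ne_zero hl' hF))
  have hh : h ∈ B := Finset.mem_union_right _ (Finset.mem_singleton_self h)
  rw [twist_eq_sum hl B hBl, twist_eq_sum hl' B hBl', ← Finset.add_sum_erase B _ hh,
    ← Finset.add_sum_erase B _ hh, A.wnd', A.wh]
  simp only [if_true, sub_self, Int.natAbs_zero, zero_add, Int.natAbs_one]
  rw [add_comm]
  congr 1
  refine Finset.sum_congr rfl fun F hF => ?_
  rw [A.wnd', if_neg (Finset.ne_of_mem_erase hF), sub_zero]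

/-- **The arc replacement step**: if the complementary cycle is positively oriented (or its
reverse is), then so is `l`. [folklore] -/
theorem good (hIH : Good (compL h j n ++ M) ∨ Good (compL h j n ++ M).reverse) : Good l := by
  obtain ⟨-, -, hfin, hm1, hm5, hn1, hn5, hcover⟩ := arc_pair_facts h j A.hmn
  have hMne := A.M_ne_nil
  have hc := A.cyc
  have hc' := A.isCyc'
  -- Step 1: the reverse orientation is impossible (the outer face across the first
  -- complementary edge has winding number one)
  have hfirst : (hexV h j, hexV h (j - 1)) ∈ cdarts (compL h j n ++ M) := by
    rw [cdarts_append _ _ (compL_ne_nil _ _ _) hMne]; simp [first_mem_pdarts_compL h j hn1]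
  have hout : wnd l (hexN h (j - 1)) = 1 := by
    obtain ⟨c1, c2⟩ := A.comp _ (first_mem_pdarts_compL h j hn1)
    rw [Prod.swap_prod_mk] at c2
    have := wnd_left_sub_right hc.2.2 (adj_hexV_succ h (j - 1))
    rw [leftFace_hexV, rightFace_hexV, hc.flux_eq] at this
    simp only [sub_add_cancel, if_neg c1, if_neg c2, A.wh] at this
    omega
  have hgood' : Good (compL h j n ++ M) := by
    rcases hIH with hg | hg
    · exact hg
    · exfalso
      rw [good_reverse_iff hc'.1] at hg
      have := hg.2 _ hfirst
      simp only at this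
      rw [show leftFace (hexV h j) (hexV h (j - 1)) = hexN h (j - 1) by
        have := leftFace_hexV_rev h (j - 1); rwa [sub_add_cancel] at this, A.wnd',
        if_neg (hexN_ne_self h _), hout] at this
      omega
  -- Step 2: transfer
  refine ⟨by rw [← A.cturn']; exact hgood'.1, fun d hd => ?_⟩
  have hd' := hd
  rw [A.eq, cdarts_append _ _ (arcL_ne_nil _ _ _) hMne, getLast_arcL, head_arcL] at hd'
  simp only [List.mem_append, List.mem_cons, List.not_mem_nil, or_false] at hd'
  -- the darts other than arc darts are shared with the complementary cycle
  have hshared : d ∉ pdarts (arcL h j m) → d ∈ cdarts (compL h j n ++ M) := by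
    intro hna
    rw [cdarts_append _ _ (compL_ne_nil _ _ _) hMne, getLast_compL, hfin, head_compL]
    simp only [List.mem_append, List.mem_cons, List.not_mem_nil, or_false]
    tauto
  by_cases hda : d ∈ pdarts (arcL h j m)
  · -- an arc dart: locality on `l`
    obtain ⟨k, rfl⟩ := mem_pdarts_arcL hm5 hda
    have := wnd_left_sub_right hc.2.2 (adj_hexV_succ h k)
    rw [hc.flux_eq_one hd, leftFace_hexV, rightFace_hexV, A.wh] at this
    simp only [rightFace_hexV]
    omega
  · -- a dart shared with the complementary cycle
    have h0 := hgood'.2 d (hshared hda)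
    rw [A.wnd'] at h0
    suffices hne : rightFace d.1 d.2 ≠ h by rw [if_neg hne] at h0; omega
    intro heq
    obtain ⟨k, hk1, hk2⟩ := (rightFace_eq_iff (hc.2.2 d hd) h).1 heq
    -- `d = (hexV (k+1), hexV k)`: no such dart occurs among the junction darts or inside `M`
    rcases hd' with (hda' | rfl | hdM) | rfl
    · exact hda hda'
    · exact hexExt_ne_hexV h _ _ (A.head_M.symm.trans hk2)
    · -- inside `M`: then `hexV k ∈ M`, impossible for every `k`
      have hkM : hexV h k ∈ M := by rw [← hk2]; exact (mem_of_mem_pdarts hdM).2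
      have hnd := hc.2.1
      rw [A.eq] at hnd
      rcases hcover k with ⟨i, hi, rfl⟩ | ⟨i, hi0, hin, rfl⟩
      · have : hexV h (j + i) ∈ arcL h j m := (mem_arcL_iff h j hm5 _).2 ⟨i, hi, rfl⟩
        exact (List.nodup_append.1 hnd).2.2 _ this _ hkM rfl
      · exact A.interior_not_mem hi0 hin (by rw [A.eq]; exact List.mem_append_right _ hkM)
    · exact hexExt_ne_hexV h _ _ (A.getLast_M.symm.trans hk1)

end ArcData

end ArcCase

/-! ### The pinch: the top hexagon meets the cycle along its upper arc and its bottom edge -/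

section Pinch

variable {l : List HV} {h : ℤ × ℤ} {P₁ P₂ : List HV}

/-- `(-1 : Fin 6) = 5`, for normalising hexagon indices. [folklore] -/
@[simp] theorem fin6_neg_one : (-1 : Fin 6) = 5 := by decide

/-- Data of the pinch configuration: the cycle runs over the upper arc `hexV 0 → ⋯ → hexV 3` of the
hexagon `h`, later along its bottom edge `hexV 4 → hexV 5`, and uses neither `hexV 3 → hexV 4`
nor `hexV 5 → hexV 0`. [folklore] -/
structure PinchData (l : List HV) (h : ℤ × ℤ) (P₁ P₂ : List HV) : Prop where
  /-- `l` is a simple cycle -/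
  cyc : IsCyc l
  /-- the shape of `l` -/
  eq : l = arcL h 0 3 ++ (P₁ ++ hexV h 4 :: hexV h 5 :: P₂)
  /-- the hexagon has winding number one -/
  wh : wnd l h = 1
  /-- the edge `hexV 3 → hexV 4` is not used -/
  e3 : (hexV h 3, hexV h 4) ∉ cdarts l
  /-- the edge `hexV 5 → hexV 0` is not used -/
  e5 : (hexV h 5, hexV h 0) ∉ cdarts l

/-- The left lobe `hexV 3 :: P₁ ++ [hexV 4]` of the pinch configuration. [folklore] -/
def pc₁ (h : ℤ × ℤ) (P₁ : List HV) : List HV := hexV h 3 :: P₁ ++ [hexV h 4]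

/-- The right lobe `hexV 5 :: P₂ ++ [hexV 0]` of the pinch configuration. [folklore] -/
def pc₂ (h : ℤ × ℤ) (P₂ : List HV) : List HV := hexV h 5 :: P₂ ++ [hexV h 0]

/-- The six boundary darts of the hexagon, listed. [folklore] -/
theorem hexDarts_eq (h : ℤ × ℤ) : hexDarts h = [(hexV h 0, hexV h 1), (hexV h 1, hexV h 2),
    (hexV h 2, hexV h 3), (hexV h 3, hexV h 4), (hexV h 4, hexV h 5), (hexV h 5, hexV h 0)] := by
  simp [hexDarts, List.finRange_succ]

/-- A list all of whose path darts are edges is a chain. [folklore] -/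
theorem isChain_of_pdarts : ∀ {Q : List HV},
    (∀ d ∈ pdarts Q, hvGraph.Adj d.1 d.2) → Q.IsChain hvGraph.Adj
  | [], _ => List.isChain_nil
  | [_], _ => List.isChain_singleton _
  | a :: b :: Q, hQ => List.isChain_cons_cons.2 ⟨hQ (a, b) (by simp),
      isChain_of_pdarts fun d hd => hQ d (by simp [hd])⟩

namespace PinchData

variable (D : PinchData l h P₁ P₂)
include D

/-- The explicit list of darts of `l`. [folklore] -/
theorem cdarts_eq' (hP₁ : P₁ ≠ []) (hP₂ : P₂ ≠ []) : cdarts l =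
    [(hexV h 0, hexV h 1), (hexV h 1, hexV h 2), (hexV h 2, hexV h 3)] ++
      (hexV h 3, P₁.head hP₁) :: pdarts P₁ ++ (P₁.getLast hP₁, hexV h 4) :: (hexV h 4, hexV h 5) ::
      (hexV h 5, P₂.head hP₂) :: pdarts P₂ ++ [(P₂.getLast hP₂, hexV h 0)] := by
  have hM : P₁ ++ hexV h 4 :: hexV h 5 :: P₂ ≠ [] := by simp
  rw [D.eq, cdarts_append _ _ (arcL_ne_nil _ _ _) hM, pdarts_append _ _ hP₁ (List.cons_ne_nil _ _),
    List.head_cons, pdarts_cons_cons, pdarts_cons_of_ne_nil _ hP₂, List.head_append_of_ne_nil hP₁,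
    List.getLast_append_of_ne_nil _ (List.cons_ne_nil _ _), List.getLast_cons (List.cons_ne_nil _ _),
    List.getLast_cons hP₂]
  simp [arcL, pdarts]

/-- `P₁` is nonempty. [folklore] -/
theorem P₁_ne_nil : P₁ ≠ [] := by
  intro hP
  apply D.e3
  rw [D.eq, hP, List.nil_append, cdarts_append _ _ (arcL_ne_nil _ _ _) (List.cons_ne_nil _ _)]
  simp [arcL]

/-- `P₂` is nonempty. [folklore] -/
theorem P₂_ne_nil : P₂ ≠ [] := by
  intro hP
  apply D.e5
  rw [D.eq, hP, cdarts_append _ _ (arcL_ne_nil _ _ _) (by simp)]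
  simp [arcL]

/-- The vertex after `hexV 3` is the exterior neighbour. [folklore] -/
theorem head_P₁ : P₁.head D.P₁_ne_nil = hexExt h 3 := by
  have hd : (hexV h 3, P₁.head D.P₁_ne_nil) ∈ cdarts l := by rw [D.cdarts_eq' D.P₁_ne_nil D.P₂_ne_nil]; simp
  have h23 : (hexV h 2, hexV h 3) ∈ cdarts l := by rw [D.cdarts_eq' D.P₁_ne_nil D.P₂_ne_nil]; simp
  have hadj := D.cyc.2.2 _ hd
  simp only at hadj
  rw [adj_hexV_iff] at hadj
  simp only [Fin.reduceAdd, Fin.reduceSub] at hadj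
  rcases hadj with e | e | e
  · exact absurd (e ▸ hd) D.e3
  · exact absurd hd (e ▸ D.cyc.not_mem_swap h23)
  · exact e

/-- The vertex before `hexV 4` is the exterior neighbour. [folklore] -/
theorem getLast_P₁ : P₁.getLast D.P₁_ne_nil = hexExt h 4 := by
  have hd : (P₁.getLast D.P₁_ne_nil, hexV h 4) ∈ cdarts l := by
    rw [D.cdarts_eq' D.P₁_ne_nil D.P₂_ne_nil]; simp
  have h45 : (hexV h 4, hexV h 5) ∈ cdarts l := by rw [D.cdarts_eq' D.P₁_ne_nil D.P₂_ne_nil]; simp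
  have hadj := (D.cyc.2.2 _ hd).symm
  simp only at hadj
  rw [adj_hexV_iff] at hadj
  simp only [Fin.reduceAdd, Fin.reduceSub] at hadj
  rcases hadj with e | e | e
  · exact absurd hd (e ▸ D.cyc.not_mem_swap h45)
  · exact absurd (e ▸ hd) D.e3
  · exact e

/-- The vertex after `hexV 5` is the exterior neighbour. [folklore] -/
theorem head_P₂ : P₂.head D.P₂_ne_nil = hexExt h 5 := by
  have hd : (hexV h 5, P₂.head D.P₂_ne_nil) ∈ cdarts l := by rw [D.cdarts_eq' D.P₁_ne_nil D.P₂_ne_nil]; simp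
  have h45 : (hexV h 4, hexV h 5) ∈ cdarts l := by rw [D.cdarts_eq' D.P₁_ne_nil D.P₂_ne_nil]; simp
  have hadj := D.cyc.2.2 _ hd
  simp only at hadj
  rw [adj_hexV_iff] at hadj
  simp only [Fin.reduceAdd, Fin.reduceSub] at hadj
  rcases hadj with e | e | e
  · exact absurd (e ▸ hd) D.e5
  · exact absurd hd (e ▸ D.cyc.not_mem_swap h45)
  · exact e

/-- The vertex before `hexV 0` is the exterior neighbour. [folklore] -/
theorem getLast_P₂ : P₂.getLast D.P₂_ne_nil = hexExt h 0 := by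
  have hd : (P₂.getLast D.P₂_ne_nil, hexV h 0) ∈ cdarts l := by
    rw [D.cdarts_eq' D.P₁_ne_nil D.P₂_ne_nil]; simp
  have h01 : (hexV h 0, hexV h 1) ∈ cdarts l := by rw [D.cdarts_eq' D.P₁_ne_nil D.P₂_ne_nil]; simp
  have hadj := (D.cyc.2.2 _ hd).symm
  simp only at hadj
  rw [adj_hexV_iff] at hadj
  simp only [Fin.reduceAdd, fin6_neg_one, zero_sub] at hadj
  rcases hadj with e | e | e
  · exact absurd hd (e ▸ D.cyc.not_mem_swap h01)
  · exact absurd (e ▸ hd) D.e5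
  · exact e

/-- The darts of the left lobe. [folklore] -/
theorem cdarts_C₁ : cdarts (pc₁ h P₁) = (hexV h 3, P₁.head D.P₁_ne_nil) :: pdarts P₁ ++
    [(P₁.getLast D.P₁_ne_nil, hexV h 4), (hexV h 4, hexV h 3)] := by
  have hP₁ := D.P₁_ne_nil
  rw [pc₁, cdarts_append (hexV h 3 :: P₁) [hexV h 4] (List.cons_ne_nil _ _) (List.cons_ne_nil _ _),
    pdarts_cons_of_ne_nil _ hP₁, List.getLast_cons hP₁]
  simp

/-- The darts of the right lobe. [folklore] -/
theorem cdarts_C₂ : cdarts (pc₂ h P₂) = (hexV h 5, P₂.head D.P₂_ne_nil) :: pdarts P₂ ++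
    [(P₂.getLast D.P₂_ne_nil, hexV h 0), (hexV h 0, hexV h 5)] := by
  have hP₂ := D.P₂_ne_nil
  rw [pc₂, cdarts_append (hexV h 5 :: P₂) [hexV h 0] (List.cons_ne_nil _ _) (List.cons_ne_nil _ _),
    pdarts_cons_of_ne_nil _ hP₂, List.getLast_cons hP₂]
  simp

/-- The vertices of the lobes in `l`: `l = [v0,v1,v2] ++ C₁ ++ (C₂ minus its last)`. [folklore] -/
theorem eq' : l = [hexV h 0, hexV h 1, hexV h 2] ++ (pc₁ h P₁) ++ (hexV h 5 :: P₂) := by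
  rw [D.eq]; simp [arcL, pc₁]

/-- The left lobe is a simple cycle. [folklore] -/
theorem isCyc₁ : IsCyc (pc₁ h P₁) := by
  have hP₁ := D.P₁_ne_nil
  have hnd := D.cyc.2.1
  rw [D.eq'] at hnd
  refine ⟨by simp [pc₁]; have := List.length_pos_iff.2 hP₁; omega, ?_, fun d hd => ?_⟩
  · exact (hnd.sublist (List.sublist_append_left _ _)).sublist (List.sublist_append_right _ _)
  · rw [D.cdarts_C₁] at hd
    simp only [List.mem_cons, List.mem_append, List.not_mem_nil, or_false] at hd
    have hall : ∀ d' ∈ cdarts l, hvGraph.Adj d'.1 d'.2 := D.cyc.2.2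
    rw [D.cdarts_eq' hP₁ D.P₂_ne_nil] at hall
    rcases hd with (rfl | hd) | rfl | rfl
    · exact hall _ (by simp)
    · exact hall _ (by simp [hd])
    · exact hall _ (by simp)
    · exact (adj_hexV_succ h 3).symm

/-- The right lobe is a simple cycle. [folklore] -/
theorem isCyc₂ : IsCyc (pc₂ h P₂) := by
  have hP₂ := D.P₂_ne_nil
  have hnd := D.cyc.2.1
  rw [D.eq'] at hnd
  refine ⟨by simp [pc₂]; have := List.length_pos_iff.2 hP₂; omega, ?_, fun d hd => ?_⟩
  · rw [pc₂, List.nodup_append]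
    refine ⟨hnd.sublist (List.sublist_append_right _ _), List.nodup_singleton _, ?_⟩
    intro a ha b hb
    rw [List.mem_singleton] at hb
    subst hb
    rintro rfl
    have : (hexV h 0 :: ([hexV h 1, hexV h 2] ++ (pc₁ h P₁) ++ hexV h 5 :: P₂)).Nodup := by simpa using hnd
    exact (List.nodup_cons.1 this).1 (by simp [ha])
  · rw [D.cdarts_C₂] at hd
    simp only [List.mem_cons, List.mem_append, List.not_mem_nil, or_false] at hd
    have hall : ∀ d' ∈ cdarts l, hvGraph.Adj d'.1 d'.2 := D.cyc.2.2
    rw [D.cdarts_eq' D.P₁_ne_nil hP₂] at hall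
    rcases hd with (rfl | hd) | rfl | rfl
    · exact hall _ (by simp)
    · exact hall _ (by simp [hd])
    · exact hall _ (by simp)
    · have e : hvGraph.Adj (hexV h 5) (hexV h 0) := by simpa using adj_hexV_succ h 5
      exact e.symm

/-- **Winding numbers decompose**: `w_l = w_{C₁} + w_{C₂} + [· = h]`. [folklore] -/
theorem wnd_eq (F : ℤ × ℤ) : wnd l F = wnd (pc₁ h P₁) F + wnd (pc₂ h P₂) F + if F = h then 1 else 0 := by
  rw [wnd_eq_dwnd, wnd_eq_dwnd, wnd_eq_dwnd, D.cdarts_eq' D.P₁_ne_nil D.P₂_ne_nil, D.cdarts_C₁, D.cdarts_C₂,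
    ← dwnd_hexDarts, hexDarts_eq]
  simp only [dwnd_append, dwnd_cons, dwnd_nil]
  have e3 := dartWnd_swap (hexV h 3, hexV h 4) F
  have e5 := dartWnd_swap (hexV h 5, hexV h 0) F
  simp only [Prod.swap_prod_mk] at e3 e5
  rw [e3, e5]
  ring

/-- The hexagon has winding number `0` or `-1` for each lobe, according to its orientation, hence
(as the two add up to `0`) both lobes are positively oriented. [folklore] -/
theorem good₁₂ (h₁ : Good (pc₁ h P₁) ∨ Good (pc₁ h P₁).reverse) (h₂ : Good (pc₂ h P₂) ∨ Good (pc₂ h P₂).reverse) :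
    Good (pc₁ h P₁) ∧ Good (pc₂ h P₂) ∧ wnd (pc₁ h P₁) h = 0 ∧ wnd (pc₂ h P₂) h = 0 := by
  have hc₁ := D.isCyc₁
  have hc₂ := D.isCyc₂
  have hd₁ : (hexV h 4, hexV h 3) ∈ cdarts (pc₁ h P₁) := by rw [D.cdarts_C₁]; simp
  have hd₂ : (hexV h 0, hexV h 5) ∈ cdarts (pc₂ h P₂) := by rw [D.cdarts_C₂]; simp
  have r₁ : rightFace (hexV h 4) (hexV h 3) = h := by have := rightFace_hexV_rev h 3; simpa using this
  have r₂ : rightFace (hexV h 0) (hexV h 5) = h := by have := rightFace_hexV_rev h 5; simpa using this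
  have l₁ : leftFace (hexV h 4) (hexV h 3) = hexN h 3 := by have := leftFace_hexV_rev h 3; simpa using this
  have l₂ : leftFace (hexV h 0) (hexV h 5) = hexN h 5 := by have := leftFace_hexV_rev h 5; simpa using this
  -- values of `w_{Cᵢ}(h)` in the two orientations
  have v₁ : wnd (pc₁ h P₁) h = 0 ∨ (wnd (pc₁ h P₁) h = -1 ∧ ¬ Good (pc₁ h P₁)) := by
    rcases h₁ with hg | hg
    · left; have := hg.2 _ hd₁; rwa [r₁] at this
    · right
      rw [good_reverse_iff hc₁.1] at hg
      have h0 := hg.2 _ hd₁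
      have hloc := wnd_left_sub_right hc₁.2.2 (hc₁.2.2 _ hd₁)
      simp only at h0 hloc
      rw [hc₁.flux_eq_one hd₁, h0, r₁] at hloc
      refine ⟨by omega, fun hg' => ?_⟩
      have := hg'.2 _ hd₁; simp only at this; rw [r₁] at this; omega
  have v₂ : wnd (pc₂ h P₂) h = 0 ∨ (wnd (pc₂ h P₂) h = -1 ∧ ¬ Good (pc₂ h P₂)) := by
    rcases h₂ with hg | hg
    · left; have := hg.2 _ hd₂; rwa [r₂] at this
    · right
      rw [good_reverse_iff hc₂.1] at hg
      have h0 := hg.2 _ hd₂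
      have hloc := wnd_left_sub_right hc₂.2.2 (hc₂.2.2 _ hd₂)
      simp only at h0 hloc
      rw [hc₂.flux_eq_one hd₂, h0, r₂] at hloc
      refine ⟨by omega, fun hg' => ?_⟩
      have := hg'.2 _ hd₂; simp only at this; rw [r₂] at this; omega
  have hsum := D.wnd_eq h
  rw [D.wh, if_pos rfl] at hsum
  have w₁ : wnd (pc₁ h P₁) h = 0 := by rcases v₁ with v₁ | ⟨v₁, -⟩ <;> rcases v₂ with v₂ | ⟨v₂, -⟩ <;> omega
  have w₂ : wnd (pc₂ h P₂) h = 0 := by omega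
  refine ⟨?_, ?_, w₁, w₂⟩
  · rcases h₁ with hg | hg
    · exact hg
    · exfalso; rcases v₁ with v₁ | ⟨v₁, -⟩
      · rw [good_reverse_iff hc₁.1] at hg
        have h0 := hg.2 _ hd₁
        have hloc := wnd_left_sub_right hc₁.2.2 (hc₁.2.2 _ hd₁)
        simp only at h0 hloc
        rw [hc₁.flux_eq_one hd₁, h0, r₁] at hloc; omega
      · omega
  · rcases h₂ with hg | hg
    · exact hg
    · exfalso; rcases v₂ with v₂ | ⟨v₂, -⟩
      · rw [good_reverse_iff hc₂.1] at hg
        have h0 := hg.2 _ hd₂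
        have hloc := wnd_left_sub_right hc₂.2.2 (hc₂.2.2 _ hd₂)
        simp only at h0 hloc
        rw [hc₂.flux_eq_one hd₂, h0, r₂] at hloc; omega
      · omega

/-- **The turning number in the pinch configuration** is `τ(C₁) + τ(C₂) - 6`. [folklore] -/
theorem cturn_eq : cturn l = cturn (pc₁ h P₁) + cturn (pc₂ h P₂) - 6 := by
  have hP₁ := D.P₁_ne_nil
  have hP₂ := D.P₂_ne_nil
  obtain ⟨p, P₁', hp⟩ := List.exists_cons_of_ne_nil hP₁
  obtain ⟨q, P₂', hq⟩ := List.exists_cons_of_ne_nil hP₂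
  have hph : p = hexExt h 3 := by have := D.head_P₁; simp only [hp, List.head_cons] at this; exact this
  have hqh : q = hexExt h 5 := by have := D.head_P₂; simp only [hq, List.head_cons] at this; exact this
  -- the last elements
  obtain ⟨P₁'', p', hp'⟩ : ∃ P₁'' p', P₁ = P₁'' ++ [p'] := ⟨P₁.dropLast, P₁.getLast hP₁,
    (List.dropLast_append_getLast hP₁).symm⟩
  obtain ⟨P₂'', q', hq'⟩ : ∃ P₂'' q', P₂ = P₂'' ++ [q'] := ⟨P₂.dropLast, P₂.getLast hP₂,
    (List.dropLast_append_getLast hP₂).symm⟩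
  have hp'h : p' = hexExt h 4 := by have := D.getLast_P₁; simp only [hp', List.getLast_append_singleton] at this; exact this
  have hq'h : q' = hexExt h 0 := by have := D.getLast_P₂; simp only [hq', List.getLast_append_singleton] at this; exact this
  -- `cturn l`
  have hM : P₁ ++ hexV h 4 :: hexV h 5 :: P₂ ≠ [] := by simp
  have t0 : cturn l = pturn ((P₁ ++ hexV h 4 :: hexV h 5 :: P₂).getLast hM :: arcL h 0 3 ++
      [(P₁ ++ hexV h 4 :: hexV h 5 :: P₂).head hM]) +
      pturn ((arcL h 0 3).getLast (arcL_ne_nil _ _ _) :: (P₁ ++ hexV h 4 :: hexV h 5 :: P₂) ++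
        [(arcL h 0 3).head (arcL_ne_nil _ _ _)]) := by
    rw [D.eq]; exact cturn_split _ _ (by simp) hM
  rw [getLast_arcL, head_arcL, List.head_append_of_ne_nil hP₁,
    List.getLast_append_of_ne_nil _ (List.cons_ne_nil _ _), List.getLast_cons (List.cons_ne_nil _ _),
    List.getLast_cons hP₂] at t0
  -- split the long path at `hexV 4, hexV 5`
  have t1 : pturn (hexV h (0 + fin6 3) :: (P₁ ++ hexV h 4 :: hexV h 5 :: P₂) ++ [hexV h 0]) =
      pturn (hexV h 3 :: P₁ ++ [hexV h 4, hexV h 5]) + pturn (hexV h 4 :: hexV h 5 :: P₂ ++ [hexV h 0]) := by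
    have := pturn_append_cons_cons (hexV h 3 :: P₁) (P₂ ++ [hexV h 0]) (hexV h 4) (hexV h 5)
    simp only [List.cons_append, List.append_assoc] at this ⊢
    simpa [fin6] using this
  -- peel the extra turn at `hexV 4`
  have t2 : pturn (hexV h 3 :: P₁ ++ [hexV h 4, hexV h 5]) =
      pturn (hexV h 3 :: P₁ ++ [hexV h 4]) + turn p' (hexV h 4) (hexV h 5) := by
    have := pturn_append_cons_cons (hexV h 3 :: P₁'') [hexV h 5] p' (hexV h 4)
    rw [hp']
    simp only [List.cons_append, List.append_assoc, List.nil_append, pturn_cons₃, pturn_two,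
      add_zero] at this ⊢
    exact this
  -- `cturn C₁`
  have t3 : cturn (pc₁ h P₁) = turn (hexV h 4) (hexV h 3) p + pturn (hexV h 3 :: P₁ ++ [hexV h 4]) +
      turn p' (hexV h 4) (hexV h 3) := by
    rw [pc₁, cturn_split (hexV h 3 :: P₁) [hexV h 4] (by simp; exact List.length_pos_iff.2 hP₁) (by simp)]
    simp only [List.getLast_singleton, List.head_cons, List.cons_append, List.getLast_cons hP₁,
      List.nil_append]
    rw [show P₁.getLast hP₁ = p' from D.getLast_P₁.trans hp'h.symm]
    have hb : pturn (hexV h 4 :: hexV h 3 :: (P₁ ++ [hexV h 4])) =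
        turn (hexV h 4) (hexV h 3) p + pturn (hexV h 3 :: (P₁ ++ [hexV h 4])) := by rw [hp]; rfl
    rw [hb]
    simp only [pturn_cons₃, pturn_two, add_zero]
  -- the second long piece
  have t4 : pturn (hexV h 4 :: hexV h 5 :: P₂ ++ [hexV h 0]) =
      turn (hexV h 4) (hexV h 5) q + pturn (hexV h 5 :: P₂ ++ [hexV h 0]) := by
    conv_lhs => rw [hq]
    simp only [List.cons_append, pturn_cons₃]
    rw [← List.cons_append, ← hq]
  -- `cturn C₂`
  have t5 : cturn (pc₂ h P₂) = turn (hexV h 0) (hexV h 5) q + pturn (hexV h 5 :: P₂ ++ [hexV h 0]) +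
      turn q' (hexV h 0) (hexV h 5) := by
    rw [pc₂, cturn_split (hexV h 5 :: P₂) [hexV h 0] (by simp; exact List.length_pos_iff.2 hP₂) (by simp)]
    simp only [List.getLast_singleton, List.head_cons, List.cons_append, List.getLast_cons hP₂,
      List.nil_append]
    rw [show P₂.getLast hP₂ = q' from D.getLast_P₂.trans hq'h.symm]
    have hb : pturn (hexV h 0 :: hexV h 5 :: (P₂ ++ [hexV h 0])) =
        turn (hexV h 0) (hexV h 5) q + pturn (hexV h 5 :: (P₂ ++ [hexV h 0])) := by rw [hq]; rfl
    rw [hb]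
    simp only [pturn_cons₃, pturn_two, add_zero]
  -- the short top piece
  have t6 : pturn (q' :: arcL h 0 3 ++ [p]) = 0 := by
    rw [hq'h, hph]
    have key : pturn (hexExt (0, 0) 0 :: arcL (0, 0) 0 3 ++ [hexExt (0, 0) 3]) = 0 := by decide
    rw [← pturn_map_tr h] at key
    simpa [← arcL_eq_map, ← hexExt_eq_tr, ← hexV_eq_tr] using key
  -- the six local turns
  have u1 : turn p' (hexV h 4) (hexV h 5) = -1 := by rw [hp'h]; exact turn_hexExt_ccw h 4
  have u2 : turn (hexV h 4) (hexV h 3) p = 1 := by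
    rw [hph]; have := turn_cw_hexExt h 3; simpa using this
  have u3 : turn p' (hexV h 4) (hexV h 3) = 1 := by
    rw [hp'h]; have := turn_hexExt_cw h 4; simpa using this
  have u4 : turn (hexV h 4) (hexV h 5) q = -1 := by
    rw [hqh]; have := turn_ccw_hexExt h 5; simpa using this
  have u5 : turn (hexV h 0) (hexV h 5) q = 1 := by
    rw [hqh]; have := turn_cw_hexExt h 5; simpa using this
  have u6 : turn q' (hexV h 0) (hexV h 5) = 1 := by
    rw [hq'h]; have := turn_hexExt_cw h 0; simpa using this
  rw [t0, t1, t2, t4, show P₂.getLast hP₂ = q' from D.getLast_P₂.trans hq'h.symm,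
    show P₁.head hP₁ = p from D.head_P₁.trans hph.symm, t6]
  linarith [t3, t5]

/-- No hexagon vertex lies on `P₁`. [folklore] -/
theorem hexV_not_mem_P₁ (k : Fin 6) : hexV h k ∉ P₁ := by
  intro hk
  have hnd := D.cyc.2.1
  rw [D.eq] at hnd
  obtain ⟨-, h2, h3⟩ := List.nodup_append.1 hnd
  obtain ⟨-, -, h4⟩ := List.nodup_append.1 h2
  have hcases : hexV h k ∈ arcL h 0 3 ∨ hexV h k ∈ hexV h 4 :: hexV h 5 :: P₂ := by
    fin_cases k <;> simp [arcL]
  rcases hcases with hm | hm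
  · exact h3 _ hm _ (List.mem_append_left _ hk) rfl
  · exact h4 _ hk _ hm rfl

/-- No hexagon vertex lies on `P₂`. [folklore] -/
theorem hexV_not_mem_P₂ (k : Fin 6) : hexV h k ∉ P₂ := by
  intro hk
  have hnd := D.cyc.2.1
  rw [D.eq] at hnd
  obtain ⟨-, h2, h3⟩ := List.nodup_append.1 hnd
  obtain ⟨-, h5, -⟩ := List.nodup_append.1 h2
  have h6 := List.nodup_cons.1 h5
  have h7 := List.nodup_cons.1 h6.2
  have hcases : hexV h k ∈ arcL h 0 3 ∨ hexV h k = hexV h 4 ∨ hexV h k = hexV h 5 := by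
    fin_cases k <;> simp [arcL]
  rcases hcases with hm | hm | hm
  · exact h3 _ hm _ (List.mem_append_right _ (by simp [hk])) rfl
  · exact h6.1 (by rw [← hm]; exact List.mem_cons_of_mem _ hk)
  · exact h7.1 (by rw [← hm]; exact hk)

/-- `P₁` and `P₂` are disjoint. [folklore] -/
theorem disjoint₁₂ {x : HV} (h1 : x ∈ P₁) (h2 : x ∈ P₂) : False := by
  have hnd := D.cyc.2.1
  rw [D.eq] at hnd
  obtain ⟨-, h2', -⟩ := List.nodup_append.1 hnd
  obtain ⟨-, -, h4⟩ := List.nodup_append.1 h2'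
  exact h4 _ h1 _ (by simp [h2]) rfl

/-- Along the left lobe the winding number of the right lobe vanishes on the right faces.
[folklore] -/
theorem wnd₂_rightFace_eq_zero (w₂ : wnd (pc₂ h P₂) h = 0) {d : HV × HV} (hd : d ∈ pdarts (pc₁ h P₁)) :
    wnd (pc₂ h P₂) (rightFace d.1 d.2) = 0 := by
  have hc₁ := D.isCyc₁
  have hc₂ := D.isCyc₂
  -- the closed-up path `pc₁ ++ [hexV 3]` has the darts of the cycle `pc₁`
  have hQ : pdarts (pc₁ h P₁ ++ [hexV h 3]) = cdarts (pc₁ h P₁) := by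
    rw [pdarts_append_singleton _ (by simp [pc₁]), cdarts_eq (by simp [pc₁])]
    simp [pc₁]
  have hchain : (pc₁ h P₁ ++ [hexV h 3]).IsChain hvGraph.Adj :=
    isChain_of_pdarts fun d' hd' => hc₁.2.2 d' (by rw [← hQ]; exact hd')
  have hint : ∀ q ∈ (pc₁ h P₁ ++ [hexV h 3]).tail.dropLast, q ∉ pc₂ h P₂ := by
    intro q hq
    have hq' : q ∈ P₁ ∨ q = hexV h 4 := by
      simpa [pc₁, List.dropLast_append_of_ne_nil] using hq
    intro hmem
    simp only [pc₂, List.cons_append, List.mem_cons, List.mem_append, List.not_mem_nil, or_false] at hmem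
    rcases hq' with hq' | rfl
    · rcases hmem with rfl | hmem | rfl
      · exact D.hexV_not_mem_P₁ 5 hq'
      · exact D.disjoint₁₂ hq' hmem
      · exact D.hexV_not_mem_P₁ 0 hq'
    · rcases hmem with e | hmem | e
      · exact absurd ((hexV_injective h) e) (by decide)
      · exact D.hexV_not_mem_P₂ 4 hmem
      · exact absurd ((hexV_injective h) e) (by decide)
  have hd' : d ∈ pdarts (pc₁ h P₁ ++ [hexV h 3]) := by
    rw [hQ, cdarts_eq (by simp [pc₁])]; exact List.mem_append_left _ hd
  have hlast : (hexV h 4, hexV h 3) ∈ pdarts (pc₁ h P₁ ++ [hexV h 3]) := by rw [hQ, D.cdarts_C₁]; simp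
  have key := wnd_rightFace_pdarts_eq hc₂.2.2 _ hchain hint d hd' _ hlast
  rw [key]
  have r₁ : rightFace (hexV h 4) (hexV h 3) = h := by have := rightFace_hexV_rev h 3; simpa using this
  simp only [r₁]
  exact w₂

/-- Along the right lobe the winding number of the left lobe vanishes on the right faces.
[folklore] -/
theorem wnd₁_rightFace_eq_zero (w₁ : wnd (pc₁ h P₁) h = 0) {d : HV × HV} (hd : d ∈ pdarts (pc₂ h P₂)) :
    wnd (pc₁ h P₁) (rightFace d.1 d.2) = 0 := by
  have hc₁ := D.isCyc₁
  have hc₂ := D.isCyc₂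
  have hQ : pdarts (pc₂ h P₂ ++ [hexV h 5]) = cdarts (pc₂ h P₂) := by
    rw [pdarts_append_singleton _ (by simp [pc₂]), cdarts_eq (by simp [pc₂])]
    simp [pc₂]
  have hchain : (pc₂ h P₂ ++ [hexV h 5]).IsChain hvGraph.Adj :=
    isChain_of_pdarts fun d' hd' => hc₂.2.2 d' (by rw [← hQ]; exact hd')
  have hint : ∀ q ∈ (pc₂ h P₂ ++ [hexV h 5]).tail.dropLast, q ∉ pc₁ h P₁ := by
    intro q hq
    have hq' : q ∈ P₂ ∨ q = hexV h 0 := by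
      simpa [pc₂, List.dropLast_append_of_ne_nil] using hq
    intro hmem
    simp only [pc₁, List.cons_append, List.mem_cons, List.mem_append, List.not_mem_nil, or_false] at hmem
    rcases hq' with hq' | rfl
    · rcases hmem with rfl | hmem | rfl
      · exact D.hexV_not_mem_P₂ 3 hq'
      · exact D.disjoint₁₂ hmem hq'
      · exact D.hexV_not_mem_P₂ 4 hq'
    · rcases hmem with e | hmem | e
      · exact absurd ((hexV_injective h) e) (by decide)
      · exact D.hexV_not_mem_P₁ 0 hmem
      · exact absurd ((hexV_injective h) e) (by decide)
  have hd' : d ∈ pdarts (pc₂ h P₂ ++ [hexV h 5]) := by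
    rw [hQ, cdarts_eq (by simp [pc₂])]; exact List.mem_append_left _ hd
  have hlast : (hexV h 0, hexV h 5) ∈ pdarts (pc₂ h P₂ ++ [hexV h 5]) := by rw [hQ, D.cdarts_C₂]; simp
  have key := wnd_rightFace_pdarts_eq hc₁.2.2 _ hchain hint d hd' _ hlast
  rw [key]
  have r₂ : rightFace (hexV h 0) (hexV h 5) = h := by have := rightFace_hexV_rev h 5; simpa using this
  simp only [r₂]
  exact w₁

/-- Darts of the left lobe path have an endpoint on `P₁`. [folklore] -/
theorem mem_P₁_of_mem_pdarts {d : HV × HV} (hd : d ∈ pdarts (pc₁ h P₁)) : d.1 ∈ P₁ ∨ d.2 ∈ P₁ := by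
  have hP₁ := D.P₁_ne_nil
  rw [pc₁, List.cons_append, pdarts_cons_of_ne_nil _ (by simp), List.head_append_of_ne_nil hP₁,
    pdarts_append_singleton _ hP₁] at hd
  simp only [List.mem_cons, List.mem_append, List.not_mem_nil, or_false] at hd
  rcases hd with rfl | hd | rfl
  · exact Or.inr (List.head_mem _)
  · exact Or.inl (mem_of_mem_pdarts hd).1
  · exact Or.inl (List.getLast_mem _)

/-- Darts of the right lobe path have an endpoint on `P₂`. [folklore] -/
theorem mem_P₂_of_mem_pdarts {d : HV × HV} (hd : d ∈ pdarts (pc₂ h P₂)) : d.1 ∈ P₂ ∨ d.2 ∈ P₂ := by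
  have hP₂ := D.P₂_ne_nil
  rw [pc₂, List.cons_append, pdarts_cons_of_ne_nil _ (by simp), List.head_append_of_ne_nil hP₂,
    pdarts_append_singleton _ hP₂] at hd
  simp only [List.mem_cons, List.mem_append, List.not_mem_nil, or_false] at hd
  rcases hd with rfl | hd | rfl
  · exact Or.inr (List.head_mem _)
  · exact Or.inl (mem_of_mem_pdarts hd).1
  · exact Or.inl (List.getLast_mem _)

/-- **The pinch step**: if both lobes (or their reverses) are positively oriented, so is `l`.
[folklore] -/
theorem good (h₁ : Good (pc₁ h P₁) ∨ Good (pc₁ h P₁).reverse) (h₂ : Good (pc₂ h P₂) ∨ Good (pc₂ h P₂).reverse) :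
    Good l := by
  have hP₁ := D.P₁_ne_nil
  have hP₂ := D.P₂_ne_nil
  obtain ⟨g₁, g₂, w₁, w₂⟩ := D.good₁₂ h₁ h₂
  have hc := D.cyc
  refine ⟨by rw [D.cturn_eq, g₁.1, g₂.1]; norm_num, fun d hd => ?_⟩
  -- hexagon darts: locality on `l`
  have hhex : ∀ k : Fin 6, (hexV h k, hexV h (k + 1)) ∈ cdarts l →
      wnd l (rightFace (hexV h k) (hexV h (k + 1))) = 0 := by
    intro k hk
    have := wnd_left_sub_right hc.2.2 (adj_hexV_succ h k)
    rw [hc.flux_eq_one hk, leftFace_hexV, rightFace_hexV, D.wh] at this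
    rw [rightFace_hexV]; omega
  -- the decomposition of the darts of `l`
  have hsplit : d ∈ pdarts (pc₁ h P₁) ∨ d ∈ pdarts (pc₂ h P₂) ∨
      (d = (hexV h 0, hexV h 1) ∨ d = (hexV h 1, hexV h 2) ∨ d = (hexV h 2, hexV h 3) ∨
        d = (hexV h 4, hexV h 5)) := by
    have hd' := hd
    rw [D.cdarts_eq' hP₁ hP₂] at hd'
    have e1 : pdarts (pc₁ h P₁) = (hexV h 3, P₁.head hP₁) :: (pdarts P₁ ++ [(P₁.getLast hP₁, hexV h 4)]) := by
      rw [pc₁, List.cons_append, pdarts_cons_of_ne_nil _ (by simp), List.head_append_of_ne_nil hP₁,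
        pdarts_append_singleton _ hP₁]
    have e2 : pdarts (pc₂ h P₂) = (hexV h 5, P₂.head hP₂) :: (pdarts P₂ ++ [(P₂.getLast hP₂, hexV h 0)]) := by
      rw [pc₂, List.cons_append, pdarts_cons_of_ne_nil _ (by simp), List.head_append_of_ne_nil hP₂,
        pdarts_append_singleton _ hP₂]
    rcases List.mem_append.1 hd' with hd' | hd'
    · rcases List.mem_append.1 hd' with hd' | hd'
      · rcases List.mem_append.1 hd' with hd' | hd'
        · simp only [List.mem_cons, List.not_mem_nil, or_false] at hd'
          rcases hd' with h0 | h1 | h2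
          · exact Or.inr (Or.inr (Or.inl h0))
          · exact Or.inr (Or.inr (Or.inr (Or.inl h1)))
          · exact Or.inr (Or.inr (Or.inr (Or.inr (Or.inl h2))))
        · rcases List.mem_cons.1 hd' with rfl | hd'
          · left; rw [e1]; exact List.mem_cons_self
          · left; rw [e1]; exact List.mem_cons_of_mem _ (List.mem_append_left _ hd')
      · rcases List.mem_cons.1 hd' with rfl | hd'
        · left; rw [e1]; exact List.mem_cons_of_mem _ (List.mem_append_right _ (List.mem_singleton_self _))
        rcases List.mem_cons.1 hd' with h4 | hd'
        · exact Or.inr (Or.inr (Or.inr (Or.inr (Or.inr h4))))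
        rcases List.mem_cons.1 hd' with rfl | hd'
        · right; left; rw [e2]; exact List.mem_cons_self
        · right; left; rw [e2]; exact List.mem_cons_of_mem _ (List.mem_append_left _ hd')
    · rw [List.mem_singleton] at hd'
      subst hd'
      right; left; rw [e2]; exact List.mem_cons_of_mem _ (List.mem_append_right _ (List.mem_singleton_self _))
  rcases hsplit with hd₁ | hd₂ | hk
  · rw [D.wnd_eq, g₁.2 d (by rw [cdarts_eq (by simp [pc₁])]; exact List.mem_append_left _ hd₁),
      D.wnd₂_rightFace_eq_zero w₂ hd₁, if_neg]
    · simp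
    · intro heq
      obtain ⟨k, hk1, hk2⟩ := (rightFace_eq_iff (hc.2.2 d hd) h).1 heq
      rcases D.mem_P₁_of_mem_pdarts hd₁ with hm | hm
      · exact D.hexV_not_mem_P₁ (k + 1) (hk1 ▸ hm)
      · exact D.hexV_not_mem_P₁ k (hk2 ▸ hm)
  · rw [D.wnd_eq, g₂.2 d (by rw [cdarts_eq (by simp [pc₂])]; exact List.mem_append_left _ hd₂),
      D.wnd₁_rightFace_eq_zero w₁ hd₂, if_neg]
    · simp
    · intro heq
      obtain ⟨k, hk1, hk2⟩ := (rightFace_eq_iff (hc.2.2 d hd) h).1 heq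
      rcases D.mem_P₂_of_mem_pdarts hd₂ with hm | hm
      · exact D.hexV_not_mem_P₂ (k + 1) (hk1 ▸ hm)
      · exact D.hexV_not_mem_P₂ k (hk2 ▸ hm)
  · have H : ∀ k : Fin 6, d = (hexV h k, hexV h (k + 1)) → wnd l (rightFace d.1 d.2) = 0 := by
      rintro k rfl; exact hhex k hd
    rcases hk with rfl | rfl | rfl | rfl
    · exact H 0 (by simp)
    · exact H 1 (by simp)
    · exact H 2 (by simp)
    · exact H 4 (by simp)

/-- Lengths of the lobes. [folklore] -/
theorem length₁ : (pc₁ h P₁).length + P₂.length + 4 = l.length := by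
  rw [D.eq]; simp [pc₁]; omega

/-- Lengths of the lobes. [folklore] -/
theorem length₂ : (pc₂ h P₂).length + P₁.length + 4 = l.length := by
  rw [D.eq]; simp [pc₂]; omega

end PinchData

/-! ### The impossible configuration: upper arc counterclockwise, bottom edge clockwise -/

/-- Data of the impossible configuration: the cycle runs over the upper arc of the hexagon `h`
and later along its bottom edge backwards, `hexV 5 → hexV 4`, using neither `hexV 3 → hexV 4`
nor `hexV 5 → hexV 0`. [folklore] -/
structure RevData (l : List HV) (h : ℤ × ℤ) (P₁ P₂ : List HV) : Prop where
  /-- `l` is a simple cycle -/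
  cyc : IsCyc l
  /-- the shape of `l` -/
  eq : l = arcL h 0 3 ++ (P₁ ++ hexV h 5 :: hexV h 4 :: P₂)
  /-- the edge `hexV 5 → hexV 0` is not used -/
  e5 : (hexV h 5, hexV h 0) ∉ cdarts l

namespace RevData

variable (R : RevData l h P₁ P₂)
include R

/-- The truncated cycle `hexV 0, …, hexV 3, P₁, hexV 5` (a prefix of `l`). [folklore] -/
theorem prefix_eq : l = (arcL h 0 3 ++ P₁ ++ [hexV h 5]) ++ (hexV h 4 :: P₂) := by
  rw [R.eq]; simp

/-- `P₂` is nonempty (`hexV 4` and `hexV 0` are not adjacent). [folklore] -/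
theorem P₂_ne_nil : P₂ ≠ [] := by
  intro hP
  have hclose : (hexV h 4, hexV h 0) ∈ cdarts l := by
    rw [R.prefix_eq, hP, cdarts_append _ _ (by simp) (List.cons_ne_nil _ _)]
    simp [arcL]
  have := R.cyc.2.2 _ hclose
  simp only at this
  rw [adj_hexV_iff] at this
  simp only [Fin.reduceAdd, Fin.reduceSub] at this
  rcases this with e | e | e
  · exact absurd ((hexV_injective h) e) (by decide)
  · exact absurd ((hexV_injective h) e) (by decide)
  · exact hexExt_ne_hexV h 4 0 e.symm

/-- The truncated list is a simple cycle. [folklore] -/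
theorem isCyc' : IsCyc (arcL h 0 3 ++ P₁ ++ [hexV h 5]) := by
  have hc := R.cyc
  have hnd := hc.2.1
  rw [R.prefix_eq] at hnd
  refine ⟨by simp, hnd.sublist (List.sublist_append_left _ _), fun d hd => ?_⟩
  rw [cdarts_eq (by simp)] at hd
  rcases List.mem_append.1 hd with hd | hd
  · -- a path dart of the prefix is a path dart of `l`
    apply hc.2.2
    rw [R.prefix_eq, cdarts_append _ _ (by simp) (List.cons_ne_nil _ _)]
    exact List.mem_append_left _ (List.mem_append_left _ hd)
  · rw [List.mem_singleton] at hd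
    subst hd
    simp only [List.append_assoc, List.cons_append, List.head_cons, arcL]
    simpa using adj_hexV_succ h 5

/-- The last vertex of `P₂` is the exterior neighbour of `hexV 0`. [folklore] -/
theorem getLast_P₂ : P₂.getLast R.P₂_ne_nil = hexExt h 0 := by
  have hP₂ := R.P₂_ne_nil
  have hclose : (P₂.getLast hP₂, hexV h 0) ∈ cdarts l := by
    rw [R.prefix_eq, cdarts_append _ _ (by simp) (List.cons_ne_nil _ _), List.getLast_cons hP₂]
    simp [arcL]
  have h01 : (hexV h 0, hexV h 1) ∈ cdarts l := by
    rw [R.prefix_eq, cdarts_append _ _ (by simp) (List.cons_ne_nil _ _)]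
    simp [arcL]
  have hadj := (R.cyc.2.2 _ hclose).symm
  simp only at hadj
  rw [adj_hexV_iff] at hadj
  simp only [Fin.reduceAdd, zero_sub, fin6_neg_one] at hadj
  rcases hadj with e | e | e
  · exact absurd hclose (e ▸ R.cyc.not_mem_swap h01)
  · exact absurd (e ▸ hclose) R.e5
  · exact e

/-- **The configuration is impossible**: the winding number of the truncated cycle is constant
on the faces along the remaining path `hexV 5 → hexV 4 → P₂ → hexV 0`, which starts to the right of
`hexV 5 → hexV 4` (the hexagon, winding number `w`) and ends to the right of `hexExt 0 → hexV 0`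
(the outer face `hexN 0`, winding number `w - 1`). [folklore] -/
theorem false : False := by
  have hc := R.cyc
  have hc' := R.isCyc'
  have hP₂ := R.P₂_ne_nil
  set C := arcL h 0 3 ++ P₁ ++ [hexV h 5] with hC
  -- the path `Q = hexV 5 :: hexV 4 :: P₂ ++ [hexV 0]`
  set Q := hexV h 5 :: hexV h 4 :: (P₂ ++ [hexV h 0]) with hQ
  have hlq : cdarts l = pdarts (arcL h 0 3 ++ P₁ ++ [hexV h 5]) ++ pdarts Q := by
    rw [R.prefix_eq, cdarts_append _ _ (by simp) (List.cons_ne_nil _ _), List.getLast_append_singleton,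
      List.head_cons, List.getLast_cons hP₂, pdarts_cons_of_ne_nil _ hP₂, hQ, pdarts_cons_cons,
      pdarts_cons_of_ne_nil _ (by simp [hP₂]), List.head_append_of_ne_nil hP₂, pdarts_append_singleton _ hP₂]
    simp [arcL]
  have hchain : Q.IsChain hvGraph.Adj :=
    isChain_of_pdarts fun d hd => hc.2.2 d (by rw [hlq]; exact List.mem_append_right _ hd)
  have hint : ∀ q ∈ Q.tail.dropLast, q ∉ C := by
    intro q hq
    have hq' : q = hexV h 4 ∨ q ∈ P₂ := by
      simpa [hQ, List.dropLast_append_of_ne_nil, List.dropLast_cons_of_ne_nil] using hq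
    have hnd := hc.2.1
    rw [R.prefix_eq] at hnd
    obtain ⟨-, -, hdis⟩ := List.nodup_append.1 hnd
    intro hqC
    refine hdis q hqC q ?_ rfl
    rcases hq' with rfl | hq'
    · exact List.mem_cons_self
    · exact List.mem_cons_of_mem _ hq'
  have hfirst : (hexV h 5, hexV h 4) ∈ pdarts Q := by simp [hQ]
  have hlast : (P₂.getLast hP₂, hexV h 0) ∈ pdarts Q := by
    rw [hQ, pdarts_cons_cons, pdarts_cons_of_ne_nil _ (by simp [hP₂]), List.head_append_of_ne_nil hP₂,
      pdarts_append_singleton _ hP₂]; simp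
  have key := wnd_rightFace_pdarts_eq hc'.2.2 Q hchain hint _ hfirst _ hlast
  rw [R.getLast_P₂] at key
  simp only at key
  have r1 : rightFace (hexV h 5) (hexV h 4) = h := by have := rightFace_hexV_rev h 4; simpa using this
  have r2 : rightFace (hexExt h 0) (hexV h 0) = hexN h 0 := by
    obtain ⟨h1, h2⟩ := h; simp [rightFace, hexExt, hexV, hexN]
  rw [r1, r2] at key
  -- but the first dart `hexV 0 → hexV 1` of `C` separates `h` (left) from `hexN 0` (right)
  have h01 : (hexV h 0, hexV h 1) ∈ cdarts C := by
    rw [hC, cdarts_eq (by simp)]; simp [arcL]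
  have hloc := wnd_left_sub_right hc'.2.2 (adj_hexV_succ h 0)
  rw [hc'.flux_eq_one (by simpa using h01), leftFace_hexV, rightFace_hexV] at hloc
  omega

end RevData

/-! ### The hexagon itself -/

/-- Cyclic darts translate. [folklore] -/
theorem cdarts_map_tr (t : ℤ × ℤ) (l : List HV) :
    cdarts (l.map (tr t)) = (cdarts l).map fun d => (tr t d.1, tr t d.2) := by
  rw [cdarts, cdarts, ← List.map_rotate, List.zip_map]
  rfl

/-- **The boundary of a hexagon is positively oriented.** [folklore] -/
theorem good_hexagon (h : ℤ × ℤ) : Good (arcL h 0 5) := by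
  have hcd : cdarts (arcL h 0 5) = hexDarts h := by
    have key : cdarts (arcL (0, 0) 0 5) = hexDarts (0, 0) := by decide
    rw [arcL_eq_map, cdarts_map_tr, key]
    simp [hexDarts, hexV_eq_tr h]
  refine ⟨?_, fun d hd => ?_⟩
  · have key : cturn (arcL (0, 0) 0 5) = 6 := by decide
    rw [arcL_eq_map, cturn, ← List.map_take, ← List.map_append, pturn_map_tr, ← cturn, key]
  · rw [hcd] at hd
    simp only [hexDarts, List.mem_map, List.mem_finRange, true_and] at hd
    obtain ⟨k, rfl⟩ := hd
    rw [rightFace_hexV, wnd_eq_dwnd, hcd, dwnd_hexDarts, if_neg (hexN_ne_self h k)]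

end Pinch

/-! ### Assembly: every simple cycle is positively oriented or its reverse is -/

section Main

variable {l : List HV}

/-- The total twist is invariant under reversal. [folklore] -/
theorem twist_reverse (hc : IsCyc l) : twist l.reverse = twist l := by
  classical
  have hl := hc.2.2
  have hl' := hc.reverse.2.2
  set B := wbox l ∪ wbox l.reverse
  rw [twist_eq_sum hl B (fun F hF => Finset.mem_union_left _ (mem_wbox_of_wnd_ne_zero hl hF)),
    twist_eq_sum hl' B (fun F hF => Finset.mem_union_right _ (mem_wbox_of_wnd_ne_zero hl' hF))]
  exact Finset.sum_congr rfl fun F _ => by rw [wnd_reverse, Int.natAbs_neg]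

/-- The total twist is invariant under rotation. [folklore] -/
theorem twist_rotate (hc : IsCyc l) (k : ℕ) : twist (l.rotate k) = twist l := by
  classical
  have hl := hc.2.2
  have hl' := (hc.rotate k).2.2
  set B := wbox l ∪ wbox (l.rotate k)
  rw [twist_eq_sum hl B (fun F hF => Finset.mem_union_left _ (mem_wbox_of_wnd_ne_zero hl hF)),
    twist_eq_sum hl' B (fun F hF => Finset.mem_union_right _ (mem_wbox_of_wnd_ne_zero hl' hF))]
  exact Finset.sum_congr rfl fun F _ => by rw [wnd_rotate]

/-- A path dart determines a splitting of the list. [folklore] -/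
theorem exists_split_of_mem_pdarts {M : List HV} {x y : HV} (h : (x, y) ∈ pdarts M) :
    ∃ P₁ P₂, M = P₁ ++ x :: y :: P₂ := by
  obtain ⟨i, hi, he⟩ := mem_pdarts_iff.1 h
  simp only [Prod.mk.injEq] at he
  refine ⟨M.take i, M.drop (i + 2), ?_⟩
  rw [he.1, he.2]
  conv_lhs => rw [← List.take_append_drop i M]
  rw [List.drop_eq_getElem_cons (by omega), List.drop_eq_getElem_cons (by omega)]

/-- The explicit darts of `arcL h 0 3 ++ M`. [folklore] -/
theorem cdarts_front {h : ℤ × ℤ} {M : List HV} (hM : M ≠ []) :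
    cdarts (arcL h 0 3 ++ M) = [(hexV h 0, hexV h 1), (hexV h 1, hexV h 2), (hexV h 2, hexV h 3)] ++
      (hexV h 3, M.head hM) :: pdarts M ++ [(M.getLast hM, hexV h 0)] := by
  rw [cdarts_append _ _ (arcL_ne_nil _ _ _) hM]; simp [arcL]

/-- **The positively oriented case of the inductive step**: the simple cycle `l` winds once,
counterclockwise, around the top hexagon `h`, hence contains the darts of its upper arc; assuming
the theorem for shorter cycles and for cycles of the same length and smaller total twist, `l` is
positively oriented. The proof is the case analysis on which of the three lower edges of the
hexagon the cycle uses. [folklore] -/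
theorem good_of_front (hc : IsCyc l) {h : ℤ × ℤ} {M : List HV} (hl : l = arcL h 0 3 ++ M) (hw : wnd l h = 1)
    (rec : ∀ l' : List HV, IsCyc l' →
      (l'.length < l.length ∨ (l'.length = l.length ∧ twist l' < twist l)) → Good l' ∨ Good l'.reverse) :
    Good l := by
  -- `M` is nonempty: `hexV 3 → hexV 0` is not an edge
  have hM : M ≠ [] := by
    rintro rfl
    have : (hexV h 3, hexV h 0) ∈ cdarts l := by rw [hl, List.append_nil, cdarts_eq (arcL_ne_nil _ _ _)]; simp
    have hadj := hc.2.2 _ this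
    simp only at hadj
    rw [adj_hexV_iff] at hadj
    simp only [Fin.reduceAdd, Fin.reduceSub] at hadj
    rcases hadj with e | e | e
    · exact absurd ((hexV_injective h) e) (by decide)
    · exact absurd ((hexV_injective h) e) (by decide)
    · exact hexExt_ne_hexV h 3 0 e.symm
  have hcd := cdarts_front (h := h) hM
  rw [← hl] at hcd
  have h01 : (hexV h 0, hexV h 1) ∈ cdarts l := by rw [hcd]; simp
  have h12 : (hexV h 1, hexV h 2) ∈ cdarts l := by rw [hcd]; simp
  have h23 : (hexV h 2, hexV h 3) ∈ cdarts l := by rw [hcd]; simp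
  have hjun : (hexV h 3, M.head hM) ∈ cdarts l := by rw [hcd]; simp
  have hclo : (M.getLast hM, hexV h 0) ∈ cdarts l := by rw [hcd]; simp
  have hnd := hc.2.1
  -- uniqueness consequences
  have n05 : (hexV h 0, hexV h 5) ∉ cdarts l := fun e =>
    absurd ((hexV_injective h) (cdarts_succ_unique hnd h01 e)) (by decide)
  have n43 : (hexV h 4, hexV h 3) ∉ cdarts l := fun e =>
    absurd ((hexV_injective h) (cdarts_pred_unique hnd h23 e)) (by decide)
  -- a hexagon dart not involving `hexV 0, …, hexV 3` as expected lies inside `M`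
  have inM : ∀ x y : HV, (x, y) ∈ cdarts l → x ≠ hexV h 0 → x ≠ hexV h 1 → x ≠ hexV h 2 → x ≠ hexV h 3 →
      y ≠ hexV h 0 → (x, y) ∈ pdarts M := by
    intro x y hxy hx0 hx1 hx2 hx3 hy0
    rw [hcd] at hxy
    simp only [List.mem_append, List.mem_cons, Prod.mk.injEq, List.not_mem_nil, or_false] at hxy
    rcases hxy with ((⟨e, -⟩ | ⟨e, -⟩ | ⟨e, -⟩) | ⟨e, -⟩ | hxy) | ⟨-, e⟩
    · exact absurd e hx0
    · exact absurd e hx1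
    · exact absurd e hx2
    · exact absurd e hx3
    · exact hxy
    · exact absurd e hy0
  -- the measure bookkeeping for an arc replacement on a rotation `L` of `l`
  have arc_rec : ∀ (L : List HV) (j : Fin 6) (m n : ℕ) (M' : List HV), L.length = l.length → twist L = twist l →
      (A : ArcData L h j m n M') → Good (compL h j n ++ M') ∨ Good (compL h j n ++ M').reverse := by
    intro L j m n M' hlen htw A
    apply rec _ A.isCyc'
    have h1 := A.length'
    have h2 := A.twist'
    have hmn := A.hmn
    simp only [List.mem_cons, Prod.mk.injEq, List.not_mem_nil, or_false] at hmn
    rcases hmn with ⟨rfl, rfl⟩ | ⟨rfl, rfl⟩ | ⟨rfl, rfl⟩ <;> omega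
  by_cases e3 : (hexV h 3, hexV h 4) ∈ cdarts l
  · -- `M = hexV 4 :: M₁`
    have hM4 : M.head hM = hexV h 4 := cdarts_succ_unique hnd hjun e3
    obtain ⟨M₁, hM₁⟩ : ∃ M₁, M = hexV h 4 :: M₁ := ⟨M.tail, by rw [← hM4, List.cons_head_tail]⟩
    have n54 : (hexV h 5, hexV h 4) ∉ cdarts l := fun e =>
      absurd ((hexV_injective h) (cdarts_pred_unique hnd e3 e)) (by decide)
    have hl₁ : l = arcL h 0 4 ++ M₁ := by rw [hl, hM₁]; simp [arcL]
    have h40_of : M₁ = [] → (hexV h 4, hexV h 0) ∈ cdarts l := by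
      rintro rfl
      rw [hl₁, List.append_nil, cdarts_eq (arcL_ne_nil _ _ _), getLast_arcL, head_arcL]; simp [fin6]
    by_cases e4 : (hexV h 4, hexV h 5) ∈ cdarts l
    · -- `M₁ = hexV 5 :: M₂`
      have hM₁ne : M₁ ≠ [] := fun hnil =>
        absurd ((hexV_injective h) (cdarts_succ_unique hnd e4 (h40_of hnil))) (by decide)
      have hjun₁ : (hexV h 4, M₁.head hM₁ne) ∈ cdarts l := by
        rw [hl₁, cdarts_append _ _ (arcL_ne_nil _ _ _) hM₁ne]; simp
      have hM5 : M₁.head hM₁ne = hexV h 5 := cdarts_succ_unique hnd hjun₁ e4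
      obtain ⟨M₂, hM₂⟩ : ∃ M₂, M₁ = hexV h 5 :: M₂ := ⟨M₁.tail, by rw [← hM5, List.cons_head_tail]⟩
      have hl₂ : l = arcL h 0 5 ++ M₂ := by rw [hl₁, hM₂]; simp [arcL]
      by_cases e5 : (hexV h 5, hexV h 0) ∈ cdarts l
      · -- the hexagon itself
        have hM₂ : M₂ = [] := by
          by_contra hne
          have hjun₂ : (hexV h 5, M₂.head hne) ∈ cdarts l := by
            rw [hl₂, cdarts_append _ _ (arcL_ne_nil _ _ _) hne]; simp
          have h0 : M₂.head hne = hexV h 0 := cdarts_succ_unique hnd hjun₂ e5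
          have : hexV h 0 ∈ M₂ := h0 ▸ List.head_mem hne
          rw [hl₂] at hnd
          exact (List.nodup_append.1 hnd).2.2 _ (by simp [arcL]) _ this rfl
        rw [hl₂, hM₂, List.append_nil]
        exact good_hexagon h
      · -- arc `(0, 5, 1)`
        have A : ArcData l h 0 5 1 M₂ :=
          { cyc := hc, hmn := by simp, eq := hl₂, wh := hw
            comp := fun d hd => by
              simp only [compL_succ, compL_zero, pdarts_cons_cons, pdarts_singleton, List.mem_singleton,
                zero_sub, fin6_neg_one] at hd
              subst hd; exact ⟨n05, e5⟩ }
        exact A.good (arc_rec l 0 5 1 M₂ rfl rfl A)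
    · by_cases e5 : (hexV h 5, hexV h 0) ∈ cdarts l
      · -- arc `(5, 5, 1)` on the rotation starting at `hexV 5`
        have hM₁ne : M₁ ≠ [] := fun hnil =>
          absurd ((hexV_injective h) (cdarts_pred_unique hnd e5 (h40_of hnil))) (by decide)
        have hclo₁ : (M₁.getLast hM₁ne, hexV h 0) ∈ cdarts l := by
          rw [hl₁, cdarts_append _ _ (arcL_ne_nil _ _ _) hM₁ne]; simp
        have hlast : M₁.getLast hM₁ne = hexV h 5 := cdarts_pred_unique hnd hclo₁ e5
        set L := l.rotate (l.length - 1) with hL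
        have hLeq : L = arcL h 5 5 ++ M₁.dropLast := by
          rw [hL, hl₁, rotate_to_front _ _ hM₁ne, hlast]; simp [arcL]
        have hcL : IsCyc L := hc.rotate _
        have A : ArcData L h 5 5 1 M₁.dropLast :=
          { cyc := hcL, hmn := by simp, eq := hLeq, wh := by rw [hL, wnd_rotate, hw]
            comp := fun d hd => by
              simp only [compL_succ, compL_zero, pdarts_cons_cons, pdarts_singleton, List.mem_singleton,
                Fin.reduceSub] at hd
              subst hd
              simp only [hL, (cdarts_rotate_perm l _).mem_iff, Prod.swap_prod_mk]
              exact ⟨fun e => absurd ((hexV_injective h) (cdarts_succ_unique hnd e5 e)) (by decide), e4⟩ }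
        have hg := A.good (arc_rec L 5 5 1 _ (by rw [hL, List.length_rotate]) (by rw [hL, twist_rotate hc]) A)
        rwa [hL, good_rotate_iff hc.1] at hg
      · -- arc `(0, 4, 2)`
        have A : ArcData l h 0 4 2 M₁ :=
          { cyc := hc, hmn := by simp, eq := hl₁, wh := hw
            comp := fun d hd => by
              simp only [compL_succ, compL_zero, pdarts_cons_cons, pdarts_singleton, List.mem_cons,
                zero_sub, fin6_neg_one, Fin.reduceSub, List.not_mem_nil, or_false] at hd
              rcases hd with rfl | rfl
              · exact ⟨n05, e5⟩
              · exact ⟨n54, e4⟩ }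
        exact A.good (arc_rec l 0 4 2 M₁ rfl rfl A)
  · by_cases e4 : (hexV h 4, hexV h 5) ∈ cdarts l
    · -- `hexV 4 → hexV 5` lies inside `M`
      obtain ⟨P₁, P₂, hMP⟩ := exists_split_of_mem_pdarts (inM _ _ e4
        (fun e => absurd ((hexV_injective h) e) (by decide)) (fun e => absurd ((hexV_injective h) e) (by decide))
        (fun e => absurd ((hexV_injective h) e) (by decide)) (fun e => absurd ((hexV_injective h) e) (by decide))
        (fun e => absurd ((hexV_injective h) e) (by decide)))
      by_cases e5 : (hexV h 5, hexV h 0) ∈ cdarts l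
      · -- arc `(4, 5, 1)` on the rotation starting at `hexV 4`; here `P₂ = []`
        have hl' : l = (arcL h 0 3 ++ P₁ ++ [hexV h 4, hexV h 5]) ++ P₂ := by rw [hl, hMP]; simp
        have hP₂ : P₂ = [] := by
          by_contra hne
          have hjun₂ : (hexV h 5, P₂.head hne) ∈ cdarts l := by
            rw [hl', cdarts_append _ _ (by simp) hne]; simp
          have h0 : P₂.head hne = hexV h 0 := cdarts_succ_unique hnd hjun₂ e5
          have hmem : hexV h 0 ∈ M := by rw [hMP, ← h0]; simp [List.head_mem hne]
          rw [hl] at hnd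
          exact (List.nodup_append.1 hnd).2.2 _ (by simp [arcL]) _ hmem rfl
        set L := l.rotate (l.length - 2) with hL
        have hLeq : L = arcL h 4 5 ++ P₁ := by
          have e1 : l = (arcL h 0 3 ++ P₁) ++ [hexV h 4, hexV h 5] := by rw [hl', hP₂]; simp
          have e2 : l.length - 2 = (arcL h 0 3 ++ P₁).length := by rw [e1]; simp
          rw [hL, e2]
          conv_lhs => rw [e1]
          rw [List.rotate_append_length_eq]
          simp [arcL]
        have hcL : IsCyc L := hc.rotate _
        have A : ArcData L h 4 5 1 P₁ :=
          { cyc := hcL, hmn := by simp, eq := hLeq, wh := by rw [hL, wnd_rotate, hw]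
            comp := fun d hd => by
              simp only [compL_succ, compL_zero, pdarts_cons_cons, pdarts_singleton, List.mem_singleton,
                Fin.reduceSub] at hd
              subst hd
              simp only [hL, (cdarts_rotate_perm l _).mem_iff, Prod.swap_prod_mk]
              exact ⟨fun e => absurd ((hexV_injective h) (cdarts_succ_unique hnd e4 e)) (by decide), e3⟩ }
        have hg := A.good (arc_rec L 4 5 1 _ (by rw [hL, List.length_rotate]) (by rw [hL, twist_rotate hc]) A)
        rwa [hL, good_rotate_iff hc.1] at hg
      · -- the pinch
        have D : PinchData l h P₁ P₂ := { cyc := hc, eq := by rw [hl, hMP], wh := hw, e3 := e3, e5 := e5 }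
        have h₁ := rec _ D.isCyc₁ (Or.inl (by have := D.length₁; omega))
        have h₂ := rec _ D.isCyc₂ (Or.inl (by have := D.length₂; omega))
        exact D.good h₁ h₂
    · by_cases e5 : (hexV h 5, hexV h 0) ∈ cdarts l
      · -- arc `(5, 4, 2)` on the rotation starting at `hexV 5`
        have hlast : M.getLast hM = hexV h 5 := cdarts_pred_unique hnd hclo e5
        set L := l.rotate (l.length - 1) with hL
        have hLeq : L = arcL h 5 4 ++ M.dropLast := by
          rw [hL, hl, rotate_to_front _ _ hM, hlast]; simp [arcL]
        have hcL : IsCyc L := hc.rotate _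
        have A : ArcData L h 5 4 2 M.dropLast :=
          { cyc := hcL, hmn := by simp, eq := hLeq, wh := by rw [hL, wnd_rotate, hw]
            comp := fun d hd => by
              simp only [compL_succ, compL_zero, pdarts_cons_cons, pdarts_singleton, List.mem_cons,
                Fin.reduceSub, List.not_mem_nil, or_false] at hd
              simp only [hL, (cdarts_rotate_perm l _).mem_iff]
              rcases hd with rfl | rfl
              · exact ⟨fun e => absurd ((hexV_injective h) (cdarts_succ_unique hnd e5 e)) (by decide), e4⟩
              · exact ⟨n43, e3⟩ }
        have hg := A.good (arc_rec L 5 4 2 _ (by rw [hL, List.length_rotate]) (by rw [hL, twist_rotate hc]) A)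
        rwa [hL, good_rotate_iff hc.1] at hg
      · by_cases r4 : (hexV h 5, hexV h 4) ∈ cdarts l
        · -- the impossible configuration
          obtain ⟨P₁, P₂, hMP⟩ := exists_split_of_mem_pdarts (inM _ _ r4
            (fun e => absurd ((hexV_injective h) e) (by decide)) (fun e => absurd ((hexV_injective h) e) (by decide))
            (fun e => absurd ((hexV_injective h) e) (by decide)) (fun e => absurd ((hexV_injective h) e) (by decide))
            (fun e => absurd ((hexV_injective h) e) (by decide)))
          have R : RevData l h P₁ P₂ := { cyc := hc, eq := by rw [hl, hMP], e5 := e5 }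
          exact R.false.elim
        · -- arc `(0, 3, 3)`: same length, smaller twist
          have A : ArcData l h 0 3 3 M :=
            { cyc := hc, hmn := by simp, eq := hl, wh := hw
              comp := fun d hd => by
                simp only [compL_succ, compL_zero, pdarts_cons_cons, pdarts_singleton, List.mem_cons,
                  zero_sub, fin6_neg_one, Fin.reduceSub, List.not_mem_nil, or_false] at hd
                rcases hd with rfl | rfl | rfl
                · exact ⟨n05, e5⟩
                · exact ⟨r4, e4⟩
                · exact ⟨n43, e3⟩ }
          exact A.good (arc_rec l 0 3 3 M rfl rfl A)

/-- The darts of the upper arc from the three upper darts. [folklore] -/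
theorem pdarts_arcL_zero_three_sub {h : ℤ × ℤ}
    (hd : ∀ k : Fin 6, k.val < 3 → (hexV h k, hexV h (k + 1)) ∈ cdarts l) :
    ∀ d ∈ pdarts (arcL h 0 3), d ∈ cdarts l := by
  intro d hd'
  simp only [arcL_succ, arcL_zero, pdarts_cons_cons, pdarts_singleton, List.mem_cons, List.not_mem_nil,
    or_false, Fin.reduceAdd] at hd'
  rcases hd' with rfl | rfl | rfl
  · simpa using hd 0 (by decide)
  · simpa using hd 1 (by decide)
  · simpa using hd 2 (by decide)

/-- **The inductive step**, positively oriented case. [folklore] -/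
theorem good_of_top_pos (hc : IsCyc l) {h : ℤ × ℤ} (hw : wnd l h = 1)
    (hd : ∀ k : Fin 6, k.val < 3 → (hexV h k, hexV h (k + 1)) ∈ cdarts l)
    (rec : ∀ l' : List HV, IsCyc l' →
      (l'.length < l.length ∨ (l'.length = l.length ∧ twist l' < twist l)) → Good l' ∨ Good l'.reverse) :
    Good l := by
  obtain ⟨k, M, hk⟩ := exists_rotate_eq_arcL hc h 3 0 (by norm_num) (by norm_num)
    (pdarts_arcL_zero_three_sub hd)
  have hg : Good (l.rotate k) := good_of_front (hc.rotate k) hk (by rw [wnd_rotate, hw]) fun l' hc' hlt =>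
    rec l' hc' (by rwa [List.length_rotate, twist_rotate hc] at hlt)
  rwa [good_rotate_iff hc.1] at hg

/-- **The inductive step**: the top face has winding number `±1`; in the negative case pass to
the reversed cycle. [folklore] -/
theorem good_step (hc : IsCyc l)
    (rec : ∀ l' : List HV, IsCyc l' →
      (l'.length < l.length ∨ (l'.length = l.length ∧ twist l' < twist l)) → Good l' ∨ Good l'.reverse) :
    Good l ∨ Good l.reverse := by
  obtain ⟨h, h0, htop⟩ := exists_top hc
  rcases top_cases hc h0 htop with ⟨hw, hd⟩ | ⟨hw, hd⟩
  · exact Or.inl (good_of_top_pos hc hw hd rec)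
  · right
    refine good_of_top_pos hc.reverse (h := h) (by rw [wnd_reverse, hw]; norm_num) (fun k hk => ?_) ?_
    · exact (cdarts_reverse_perm l).mem_iff.2 (List.mem_map.2 ⟨_, hd k hk, rfl⟩)
    · intro l' hc' hlt
      apply rec l' hc'
      rwa [List.length_reverse, twist_reverse hc] at hlt

/-- **The discrete Umlaufsatz / Jordan curve theorem for the honeycomb lattice**: every simple
cycle of `ℍ` is positively oriented or its reverse is — its turning number is `±6` (`±2π`), and
the faces along it have winding numbers `1` (resp. `-1`) on the inside and `0` on the outside.
Proof: induction on the length and the total twist, removing the top hexagon. [folklore] -/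
theorem good_or_good_reverse (hc : IsCyc l) : Good l ∨ Good l.reverse := by
  suffices H : ∀ (n t : ℕ) (l : List HV), IsCyc l → l.length = n → twist l = t → Good l ∨ Good l.reverse from
    H _ _ l hc rfl rfl
  intro n
  induction n using Nat.strong_induction_on with
  | _ n IHn =>
    intro t
    induction t using Nat.strong_induction_on with
    | _ t IHt =>
      intro l hc hn ht
      refine good_step hc fun l' hc' hlt => ?_
      rcases hlt with hlt | ⟨heq, hlt⟩
      · exact IHn l'.length (hn ▸ hlt) (twist l') l' hc' rfl rfl
      · exact IHt (twist l') (ht ▸ hlt) l' hc' (heq.trans hn) rfl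

/-- **The turning number of a simple cycle of the honeycomb lattice is `±6`** (i.e. `±2π`).
[folklore] -/
theorem cturn_eq_six_or (hc : IsCyc l) : cturn l = 6 ∨ cturn l = -6 := by
  rcases good_or_good_reverse hc with hg | hg
  · exact Or.inl hg.1
  · rw [good_reverse_iff hc.1] at hg; exact Or.inr hg.1

/-! ### The loop lemma: orientation of a cycle seen from an outside edge -/

section Loop

/-- Turns between the neighbours of a vertex of type `0`: to the counterclockwise-next neighbour
one turns right. [folklore] -/
@[simp] theorem turn_f01 (a b : ℤ) : turn (a, b, true) (a, b, false) (a - 1, b, true) = -1 := by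
  have := turn_tr (a, b) (0, 0, true) (0, 0, false) (-1, 0, true)
  simp only [tr, zero_add, neg_add_eq_sub] at this; rw [this]; decide
/-- Turns between the neighbours of a vertex of type `0`. [folklore] -/
@[simp] theorem turn_f12 (a b : ℤ) : turn (a - 1, b, true) (a, b, false) (a, b - 1, true) = -1 := by
  have := turn_tr (a, b) (-1, 0, true) (0, 0, false) (0, -1, true)
  simp only [tr, zero_add, neg_add_eq_sub] at this; rw [this]; decide
/-- Turns between the neighbours of a vertex of type `0`. [folklore] -/
@[simp] theorem turn_f20 (a b : ℤ) : turn (a, b - 1, true) (a, b, false) (a, b, true) = -1 := by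
  have := turn_tr (a, b) (0, -1, true) (0, 0, false) (0, 0, true)
  simp only [tr, zero_add, neg_add_eq_sub] at this; rw [this]; decide
/-- Turns between the neighbours of a vertex of type `0`. [folklore] -/
@[simp] theorem turn_f10 (a b : ℤ) : turn (a - 1, b, true) (a, b, false) (a, b, true) = 1 := by
  rw [turn_rev, turn_f01]; rfl
/-- Turns between the neighbours of a vertex of type `0`. [folklore] -/
@[simp] theorem turn_f21 (a b : ℤ) : turn (a, b - 1, true) (a, b, false) (a - 1, b, true) = 1 := by
  rw [turn_rev, turn_f12]; rfl
/-- Turns between the neighbours of a vertex of type `0`. [folklore] -/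
@[simp] theorem turn_f02 (a b : ℤ) : turn (a, b, true) (a, b, false) (a, b - 1, true) = 1 := by
  rw [turn_rev, turn_f20]; rfl
/-- Turns between the neighbours of a vertex of type `1`. [folklore] -/
@[simp] theorem turn_t01 (a b : ℤ) : turn (a, b, false) (a, b, true) (a + 1, b, false) = -1 := by
  have := turn_tr (a, b) (0, 0, false) (0, 0, true) (1, 0, false)
  simp only [tr, zero_add, add_comm (1 : ℤ) a] at this; rw [this]; decide
/-- Turns between the neighbours of a vertex of type `1`. [folklore] -/
@[simp] theorem turn_t12 (a b : ℤ) : turn (a + 1, b, false) (a, b, true) (a, b + 1, false) = -1 := by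
  have := turn_tr (a, b) (1, 0, false) (0, 0, true) (0, 1, false)
  simp only [tr, zero_add, add_comm (1 : ℤ)] at this; rw [this]; decide
/-- Turns between the neighbours of a vertex of type `1`. [folklore] -/
@[simp] theorem turn_t20 (a b : ℤ) : turn (a, b + 1, false) (a, b, true) (a, b, false) = -1 := by
  have := turn_tr (a, b) (0, 1, false) (0, 0, true) (0, 0, false)
  simp only [tr, zero_add, add_comm (1 : ℤ)] at this; rw [this]; decide
/-- Turns between the neighbours of a vertex of type `1`. [folklore] -/
@[simp] theorem turn_t10 (a b : ℤ) : turn (a + 1, b, false) (a, b, true) (a, b, false) = 1 := by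
  rw [turn_rev, turn_t01]; rfl
/-- Turns between the neighbours of a vertex of type `1`. [folklore] -/
@[simp] theorem turn_t21 (a b : ℤ) : turn (a, b + 1, false) (a, b, true) (a + 1, b, false) = 1 := by
  rw [turn_rev, turn_t12]; rfl
/-- Turns between the neighbours of a vertex of type `1`. [folklore] -/
@[simp] theorem turn_t02 (a b : ℤ) : turn (a, b, false) (a, b, true) (a, b + 1, false) = 1 := by
  rw [turn_rev, turn_t20]; rfl

/-- **The loop lemma** (the topological input of the pair cancellation in DCS's proof of Lemma 1):
a simple cycle `v → t₁ → ⋯ → t → v` seen from a neighbour `s` of `v` off the cycle, with the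
faces along the edge `{v, s}` outside the cycle (winding number `0`), has turning number `-6`
times the turn `s → v → t₁`: entering the loop by a left turn means going around it clockwise.
[cite: DuminilCopinSmirnov2012, proof of Lemma 1 ("we used the fact that a is on the boundary
and Ω is simply connected")] -/
theorem cturn_eq_neg_six_mul_turn {v : HV} {L : List HV} (hc : IsCyc (v :: L)) (hL : L ≠ []) {s : HV}
    (hs : hvGraph.Adj v s) (hsn : s ∉ v :: L) (h0 : wnd (v :: L) (leftFace v s) = 0) :
    cturn (v :: L) = -6 * turn s v (L.head hL) := by
  have ht₁ : (v, L.head hL) ∈ cdarts (v :: L) := by rw [cdarts_cons, pdarts_cons_of_ne_nil _ hL]; simp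
  have ht : (L.getLast hL, v) ∈ cdarts (v :: L) := by rw [cdarts_cons, List.getLast_cons hL]; simp
  have a₁ := hc.2.2 _ ht₁
  have a₂ := (hc.2.2 _ ht).symm
  simp only at a₁ a₂
  have e0 := wnd_left_eq_right hc.2.2 hs (flux_eq_zero_of_not_mem (Or.inr hsn))
  have key : ∀ (w : ℤ), (w = 1 ∨ w = -1) → cturn (v :: L) = 6 * w →
      wnd (v :: L) (leftFace v (L.head hL)) = (w + 1) / 2 →
      wnd (v :: L) (rightFace v (L.head hL)) = (w - 1) / 2 →
      wnd (v :: L) (rightFace v (L.getLast hL)) = (w + 1) / 2 →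
      wnd (v :: L) (leftFace v (L.getLast hL)) = (w - 1) / 2 →
      cturn (v :: L) = -6 * turn s v (L.head hL) := by
    intro w hw hct l₁ r₁ l₂ r₂
    rw [hct]
    generalize L.head hL = t₁ at *
    generalize L.getLast hL = t at *
    obtain ⟨a, b, c⟩ := v
    obtain ⟨x, y, z⟩ := s
    obtain ⟨x₁, y₁, z₁⟩ := t₁
    obtain ⟨x₂, y₂, z₂⟩ := t
    cases c <;> cases z <;> simp only [hvGraph_adj, AdjRel] at hs <;> simp at hs <;>
      cases z₁ <;> simp only [hvGraph_adj, AdjRel] at a₁ <;> simp at a₁ <;>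
      cases z₂ <;> simp only [hvGraph_adj, AdjRel] at a₂ <;> simp at a₂
    · rcases hs with ⟨e1, e2⟩ | ⟨e1, e2⟩ | ⟨e1, e2⟩ <;> rcases a₁ with ⟨f1, f2⟩ | ⟨f1, f2⟩ | ⟨f1, f2⟩ <;>
        rcases a₂ with ⟨g1, g2⟩ | ⟨g1, g2⟩ | ⟨g1, g2⟩ <;> subst x y x₁ y₁ x₂ y₂ <;>
        simp only [leftFace_ff0, leftFace_ff1, leftFace_ff2, rightFace_ff0, rightFace_ff1, rightFace_ff2,
          turn_f01, turn_f12, turn_f20, turn_f10, turn_f21, turn_f02] at h0 e0 l₁ r₁ l₂ r₂ ⊢ <;> omega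
    · rcases hs with ⟨e1, e2⟩ | ⟨e1, e2⟩ | ⟨e1, e2⟩ <;> rcases a₁ with ⟨f1, f2⟩ | ⟨f1, f2⟩ | ⟨f1, f2⟩ <;>
        rcases a₂ with ⟨g1, g2⟩ | ⟨g1, g2⟩ | ⟨g1, g2⟩ <;> subst x y x₁ y₁ x₂ y₂ <;>
        simp only [leftFace_tt0, leftFace_tt1, leftFace_tt2, rightFace_tt0, rightFace_tt1, rightFace_tt2,
          turn_t01, turn_t12, turn_t20, turn_t10, turn_t21, turn_t02] at h0 e0 l₁ r₁ l₂ r₂ ⊢ <;> omega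
  rcases good_or_good_reverse hc with hg | hg
  · have l₁ := hg.wnd_leftFace hc ht₁
    have r₁ := hg.2 _ ht₁
    have l₂ := hg.wnd_leftFace hc ht
    have r₂ := hg.2 _ ht
    exact key 1 (Or.inl rfl) (by rw [hg.1]; norm_num) l₁ r₁ l₂ r₂
  · have hg' := (good_reverse_iff hc.1).1 hg
    have l₁ := hg'.2 _ ht₁
    have l₂ := hg'.2 _ ht
    have r₁ : wnd (v :: L) (rightFace v (L.head hL)) = -1 := by
      have := wnd_left_sub_right hc.2.2 a₁; rw [hc.flux_eq_one ht₁] at this; simp only at l₁; omega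
    have r₂ : wnd (v :: L) (rightFace (L.getLast hL) v) = -1 := by
      have := wnd_left_sub_right hc.2.2 (hc.2.2 _ ht); rw [hc.flux_eq_one ht] at this; simp only at l₂ this
      omega
    exact key (-1) (Or.inr rfl) (by rw [hg'.1]; norm_num) l₁ r₁ l₂ r₂

end Loop

end Main

end HV

end Literature.Probability.RandomPlanarGeometry.SAW
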